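import Literature.NumberTheory.LFunctions.BondarenkoHeap2026Section6
import Literature.NumberTheory.LFunctions.BondarenkoHeap2026Sections3to5
import Literature.NumberTheory.LFunctions.BondarenkoHeap2026CharacterSumsProofs
import Literature.NumberTheory.LFunctions.MertensElementary
import Literature.NumberTheory.LFunctions.QuadraticCharacterShiftSums

/-!
# Bondarenko–Heap 2026, §6.3–6.5: the three range bounds as theorems — (23) from Lemma 4
# and (16), (27) from (24) and Lemmas 7–8, (40) from (28) and Lemmas 9–10 — proofs

Topic `Literature/NumberTheory/LFunctions`, namespace
`Literature.NumberTheory.LFunctions.BondarenkoHeap2026`. PROOF LAYER (RH-free, no new facts) over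
the statement file `BondarenkoHeap2026Section6`: A. Bondarenko, W. Heap, arXiv:2608.07399v1, §6.4
(authors' TeX l.880–996).

* `norm_corrSumE_le_sqrt_mul_sqrt` — display (24) (TeX l.899): writing `χ(m)χ(km + r) = χ(k + r m̄)`
  (`χ(m)² = 1`, `(m,q) = 1`) and grouping by `x ≡ r m̄ (mod q)`,
  `|E(K,M,R)| ≤ (∑_x |W_x|²)^{1/2} (∑_x |∑_k a_k Λ(k) χ(k+x)|²)^{1/2}`.
* `rangeII_bound_of_lemma7_lemma8` — (27) (TeX l.986–996) as a THEOREM from the named facts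
  `lemma7` (25) and `lemma8` (26): "bounding `Λ(k)²` trivially", `q ≪ K`, `R/q^{1/2} ≪ q^{−δ}`,
  `R/M ≪ K/T ≪ q^{−η}`, "on taking `ε` sufficiently small" (`ε = η/16` suffices; the text's
  `q ≥ q₀` for `R ≤ M` is replaced by the trivial bound `|E| ≤ 8KMR log 2K` at the finitely many
  small `q`, which the constant absorbs).
* `rangeIII_bound_of_lemma9_lemma10` — (40) (TeX l.998–1024, l.1295–1306) as a THEOREM from the
  named facts `lemma9_bound` (32) and `lemma10`, via the proved identity (28)
  (`corrSumE_eq_sum_characters`): the terms with `(k,q) > 1` are prime powers `p^j`, `p ∣ q`,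
  `j ≤ log₂ 2K`, bounded trivially (`sum_vonMangoldt_not_coprime_le`); for `(k,q) = 1`,
  Lemma 9 (32) bounds `(1/φ(q))|∑ b_m c_r T_ψ(r m̄)|` by `q^ε RM q^{−1/2}` (resp. `q^{−1}` for
  `ψ ∈ {ψ₀, χ}`), Lemma 10 bounds `∑_{ψ ∉ {ψ₀,χ}} |∑ a_k Λ(k) ψ(k)|` with `V(x) = a(Kx)`
  (`lemma10Weight_of_isSmoothDyadicWeight`), and the two exceptional characters are bounded by
  `2K log 2K`; `ε = δ/8`.
* `rangeI_bound_of_lemma4` — (23) (TeX l.864–878) as a THEOREM from the sibling's named fact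
  `lemma4` (Lemma 4, (12); itself a theorem modulo (14) in `…Sections3to5Proofs`) and the PROVED
  (16) `eq16_holds`: Lemma 4 for the `m`-sum with the dyadic weight `b` (its `BV` norm is
  `≤ 1 + A₁ q^{δ₄}`, `bvNorm_le_of_isSmoothDyadicWeight`), (16) for the `r`-sums of `(r,Q)` and
  `√(r,Q)`, the `k`-sum trivially; `R/q ≤ C₀² q^{−1/2−δ}`, `K√q/T ≤ q^{−η}`; `ε = η/16`.

* `lemma7_holds` — **Lemma 7, (25)** (TeX l.906–940) PROVED: "on discarding the coefficients" the
  energy `∑_x |W_x|²` is at most the number of `(r₁,m₁,r₂,m₂)` in the box with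
  `q ∣ r₁m₂ − r₂m₁`; for fixed `(r₁,r₂)` and `h = r₁m₂ − r₂m₁ = ℓq` (`O(1 + RM/q)` values of `ℓ`) the
  `m₁` lie in one class mod `r₁/(r₁,r₂)` (`≤ 2(r₁,r₂)M/r₁ + 1` of them — the text's `gM/R`), and
  `∑_{r₁,r₂ ≤ 2R} (r₁,r₂) ≤ 4R²(1 + log 2R)`; `1 + log 2R ≤ (2 + C/ε) q^ε` from `R ≤ M ≤ q^C`.
  Corollary `rangeII_bound_of_lemma8 : lemma8 → rangeII_bound`.
* `rangeII_bound_holds : rangeII_bound` — (27) DISCHARGED outright, from `lemma7_holds` and the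
  sibling `lemma8_holds` (`…CharacterSumsProofs`, Lemma 8 (26) by completion).
* `lemma9_bound_of_lemma9_exact : lemma9_exact → lemma9_bound` — **Lemma 9, (32) from (30)–(31)**
  (TeX l.1049–1105): `T_ψ(y)` is the tree's `shiftSum ψ⁻¹ χ 1 y` (`genJacobiSum_eq_shiftSum`); with
  `q = 2^ν Q` ((11), `modulus_eq_two_pow_mul_odd_squarefree`) it factorises by the CRT
  (`shiftSum_eq_mul_of_coprime`): the factor mod `2^ν` is `≤ 8` trivially (`norm_shiftSum_le`),
  the factor mod `Q` is (30) for the CRT components, so `|T_ψ(r m̄)| ≤ 8 · {√Q; 1} · ∑_{d∣Q, d∣r} d`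
  (`norm_genJacobiSum_le_of_lemma9_exact`, Kluyver's `|c_s(r)| ≤ ∑_{d∣s, d∣r} d`); then
  `∑_{r ≤ 2R} ∑_{d∣Q, d∣r} d ≤ 2R·d(Q)`, `d(Q) ≪ q^ε`, `q/φ(q) ≪ q^ε`.
* `bvNorm_le_of_deriv_bound`, `rangeI_bound_core_of_lemma4` (v8), `rangeII_bound_core_of_lemma7_lemma8` (v9): the `‖·‖_BV` bound and (23) over raw
  weight data (`‖b‖ ≤ 1`, `‖b′‖ ≤ D/M`, support, `‖a‖,‖c‖ ≤ 1`) — refactor cores for the primed weight class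
  (E-ah-3); `bvNorm_le_of_isSmoothDyadicWeight` and `rangeI_bound_of_lemma4` are their corollaries.
* `rangeIII_bound_core_of_lemma9` (v10): (40) over raw weight data — `‖a‖,‖b‖,‖c‖ ≤ 1`, the
  windows of `b, c`, and the OUTPUT of Lemma 10 for `V(x) = a(Kx)` (at `ε = δ/8`, constant `C₁₀`)
  as a hypothesis — so that both `lemma10` (here: `rangeIII_bound_of_lemma9_lemma10`, statement
  unchanged) and the primed `lemma10'` (sibling `…Section6WeightsProofs`) instantiate it.
* `lemma9_bound_holds : lemma9_bound` — **Lemma 9, (32) PROVED OUTRIGHT** (TeX l.1026–1105): only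
  local BOUNDS are needed, not the identity (30) — at an odd prime `P`, for the quadratic `χ_P`
  and any `ψ`, `|∑_m ψ(m)χ_P(m+t)| ≤ P` (`t = 0`) and `≤ √P` (`t ≠ 0`: `= ψ(−t)χ_P(t)J(ψ,χ_P)`,
  `|J| ≤ √P` by `J = g(ψ)g(χ)/g(ψχ)` and `|g| = √P`, with `J(χ₀,χ) = −1`, `J(χ,χ) = −χ(−1)` in the
  degenerate cases; `norm_jacobiSum_le_sqrt`, `norm_sum_mul_quad_shift_le`), `≤ 1` for
  `ψ ∈ {χ₀, χ_P}`; the CRT induction `norm_shiftSum_quad_le_aux` gives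
  `|∑_m ψ(m)χ(m + y)| ≤ (y,q)√q` (resp. `(y,q)`) for odd `q`; then the `2^ν`-part (`≤ 8`),
  `∑_{r≤2R}(r,Q) ≤ 2R·d(Q)` (`gcd_sum_le`), `d(Q) ≪ q^ε`, `q/φ(q) ≪ q^ε`.
  Corollary `rangeIII_bound_of_lemma10 : lemma10 → rangeIII_bound`.

With `corrSumPowerSaving_of_ranges` (sibling `…Section6`) and `prop6_of_reduction_of_ranges`
(sibling `…Section6Reduction`), Proposition 6 is thereby a theorem modulo the boundary facts
{`offDiag_reduction`, `eq14` (via `lemma4`), `lemma10`}.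

## References

* [BondarenkoHeap2026] arXiv:2608.07399v1, §6.3–6.5, (23)–(28), (32), (40), TeX l.864–1309;
  Lemma 7 (25) l.906–940; Lemma 9 (29)–(32) l.1026–1105; §4 Lemma 4 (12) and (16).
* [MontgomeryVaughan2007] Thm 4.1 (4.7) (Kluyver's form of `c_q(h)`), Lemma 9.3 (CRT components).
* [HardyWright2008] Thm 328 (`φ(n) ≫ n / log log n`, via the tree's `MertensElementary`).
-/

noncomputable section

open scoped ContDiff ArithmeticFunction.vonMangoldt
open Finset

namespace Literature.NumberTheory.LFunctions.BondarenkoHeap2026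

/-! ### Elementary rewriting of the summand and small helpers -/

/-- `χ(m) χ(km + s r) = χ(k + s r m̄)` for `(m, q) = 1` and `χ` quadratic (TeX l.884:
"since `χ(m)² = 1` where `m̄` is the multiplicative inverse of `m mod q`").
[cite: BondarenkoHeap2026, §6.4, TeX l.884] -/
theorem chi_mul_chi_shift {q : ℕ} [NeZero q] (χ : DirichletCharacter ℂ q) (hχ : χ.IsQuadratic)
    (s : ℤ) (k m r : ℕ) (hm : m.Coprime q) :
    χ (m : ZMod q) * χ (((k : ℤ) * m + s * r : ℤ) : ZMod q) =
      χ ((k : ZMod q) + ((s * r : ℤ) : ZMod q) * (m : ZMod q)⁻¹) := by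
  have hmu : IsUnit (m : ZMod q) := (ZMod.isUnit_iff_coprime m q).mpr hm
  have hχm : χ (m : ZMod q) * χ (m : ZMod q) = 1 := by
    rcases hχ (m : ZMod q) with h0 | h1 | h1
    · exact absurd h0 (hmu.map χ).ne_zero
    · rw [h1]; norm_num
    · rw [h1]; norm_num
  have hminv : (m : ZMod q) * (m : ZMod q)⁻¹ = 1 := ZMod.mul_inv_of_unit _ hmu
  have hcast : (((k : ℤ) * m + s * r : ℤ) : ZMod q) =
      (m : ZMod q) * ((k : ZMod q) + ((s * r : ℤ) : ZMod q) * (m : ZMod q)⁻¹) := by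
    push_cast
    linear_combination (-((s : ZMod q) * (r : ZMod q))) * hminv
  rw [hcast, map_mul, ← mul_assoc (χ (m : ZMod q)), hχm, one_mul]

/-- Cauchy–Schwarz for a finite sum of products of complex numbers. [folklore] -/
private theorem norm_sum_mul_le_sqrt_mul_sqrt {ι : Type*} (s : Finset ι) (f g : ι → ℂ) :
    ‖∑ i ∈ s, f i * g i‖ ≤
      Real.sqrt (∑ i ∈ s, ‖f i‖ ^ 2) * Real.sqrt (∑ i ∈ s, ‖g i‖ ^ 2) := by
  have h1 : ‖∑ i ∈ s, f i * g i‖ ≤ ∑ i ∈ s, ‖f i‖ * ‖g i‖ :=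
    (norm_sum_le _ _).trans (le_of_eq (Finset.sum_congr rfl fun i _ => norm_mul _ _))
  have h2 : (∑ i ∈ s, ‖f i‖ * ‖g i‖) ^ 2 ≤ (∑ i ∈ s, ‖f i‖ ^ 2) * ∑ i ∈ s, ‖g i‖ ^ 2 :=
    Finset.sum_mul_sq_le_sq_mul_sq s _ _
  have h3 : ∑ i ∈ s, ‖f i‖ * ‖g i‖ ≤
      Real.sqrt (∑ i ∈ s, ‖f i‖ ^ 2) * Real.sqrt (∑ i ∈ s, ‖g i‖ ^ 2) := by
    rw [← Real.sqrt_mul (Finset.sum_nonneg fun _ _ => sq_nonneg _)]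
    calc ∑ i ∈ s, ‖f i‖ * ‖g i‖ = Real.sqrt ((∑ i ∈ s, ‖f i‖ * ‖g i‖) ^ 2) :=
          (Real.sqrt_sq (Finset.sum_nonneg fun _ _ =>
            mul_nonneg (norm_nonneg _) (norm_nonneg _))).symm
      _ ≤ _ := Real.sqrt_le_sqrt h2
  exact h1.trans h3

/-- `log u ≤ u^ε / ε` for `u ≥ 1`, `ε > 0`. [folklore] -/
private theorem log_le_rpow_div {u ε : ℝ} (hu : 1 ≤ u) (hε : 0 < ε) :
    Real.log u ≤ u ^ ε / ε := by
  have hu0 : 0 < u := by linarith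
  have h := Real.log_le_sub_one_of_pos (Real.rpow_pos_of_pos hu0 ε)
  rw [Real.log_rpow hu0] at h
  rw [le_div_iff₀ hε]
  linarith

/-! ### (24): Cauchy–Schwarz after grouping by `x ≡ r m̄ (mod q)` -/

/-- **(24)** (TeX l.886–903). If `b_m` is supported on `(m,q) = 1` ("retaining the condition
`(m,q) = 1` in `b_m`") and `χ` is quadratic, then
`E(K,M,R) = ∑_{x mod q} (∑_{m,r : r m̄ ≡ x} b_m c_r) (∑_k a_k Λ(k) χ(k+x))`, whence by
Cauchy–Schwarz `|E(K,M,R)| ≤ (∑_x |W_x|²)^{1/2} (∑_x |∑_k a_k Λ(k) χ(k+x)|²)^{1/2}` with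
`W_x = ∑_{r,m : (s r) m̄ ≡ x} c_r b_m` (sign `s` of the shift as in `corrSumE`). PROVED.
[cite: BondarenkoHeap2026, eq. (24), TeX l.899] -/
theorem norm_corrSumE_le_sqrt_mul_sqrt {q : ℕ} [NeZero q] (χ : DirichletCharacter ℂ q)
    (hχ : χ.IsQuadratic) (s : ℤ) (K M R : ℝ) (a b c : ℝ → ℂ)
    (hb : ∀ m : ℕ, b m ≠ 0 → m.Coprime q) :
    ‖corrSumE χ s K M R a b c‖ ≤
      Real.sqrt (∑ x : ZMod q, ‖∑ r ∈ Icc 1 ⌊2 * R⌋₊, ∑ m ∈ Icc 1 ⌊2 * M⌋₊,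
          (if ((s * r : ℤ) : ZMod q) * (m : ZMod q)⁻¹ = x then c r * b m else 0)‖ ^ 2) *
        Real.sqrt (∑ x : ZMod q,
          ‖∑ k ∈ Icc 1 ⌊2 * K⌋₊, a k * ((Λ k : ℝ) : ℂ) * χ ((k : ZMod q) + x)‖ ^ 2) := by
  classical
  set A : ZMod q → ℂ := fun x =>
    ∑ k ∈ Icc 1 ⌊2 * K⌋₊, a k * ((Λ k : ℝ) : ℂ) * χ ((k : ZMod q) + x) with hA
  set W : ZMod q → ℂ := fun x => ∑ r ∈ Icc 1 ⌊2 * R⌋₊, ∑ m ∈ Icc 1 ⌊2 * M⌋₊,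
    (if ((s * r : ℤ) : ZMod q) * (m : ZMod q)⁻¹ = x then c r * b m else 0) with hW
  -- Step 1: rewrite the summand with `χ(m)χ(km + s r) = χ(k + s r m̄)` and sum over `k` inside.
  have h1 : corrSumE χ s K M R a b c = ∑ m ∈ Icc 1 ⌊2 * M⌋₊, ∑ r ∈ Icc 1 ⌊2 * R⌋₊,
      b m * c r * A (((s * r : ℤ) : ZMod q) * (m : ZMod q)⁻¹) := by
    have h1a : corrSumE χ s K M R a b c = ∑ k ∈ Icc 1 ⌊2 * K⌋₊, ∑ m ∈ Icc 1 ⌊2 * M⌋₊,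
        ∑ r ∈ Icc 1 ⌊2 * R⌋₊, b m * c r *
          (a k * ((Λ k : ℝ) : ℂ) * χ ((k : ZMod q) + ((s * r : ℤ) : ZMod q) * (m : ZMod q)⁻¹)) := by
      simp only [corrSumE, Finset.mul_sum]
      refine Finset.sum_congr rfl fun k _ => Finset.sum_congr rfl fun m _ =>
        Finset.sum_congr rfl fun r _ => ?_
      by_cases hbm : b m = 0
      · simp [hbm]
      rw [chi_mul_chi_shift χ hχ s k m r (hb m hbm)]
      ring
    rw [h1a, Finset.sum_comm]
    refine Finset.sum_congr rfl fun m _ => ?_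
    rw [Finset.sum_comm]
    refine Finset.sum_congr rfl fun r _ => ?_
    simp only [hA, Finset.mul_sum]
  -- Step 2: group by `x`.
  have h2 : ∑ x : ZMod q, W x * A x = ∑ m ∈ Icc 1 ⌊2 * M⌋₊, ∑ r ∈ Icc 1 ⌊2 * R⌋₊,
      b m * c r * A (((s * r : ℤ) : ZMod q) * (m : ZMod q)⁻¹) := by
    have h2a : ∀ x : ZMod q, W x * A x = ∑ r ∈ Icc 1 ⌊2 * R⌋₊, ∑ m ∈ Icc 1 ⌊2 * M⌋₊,
        (if ((s * r : ℤ) : ZMod q) * (m : ZMod q)⁻¹ = x then c r * b m * A x else 0) := by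
      intro x
      simp only [hW, Finset.sum_mul]
      refine Finset.sum_congr rfl fun r _ => Finset.sum_congr rfl fun m _ => ?_
      split_ifs <;> simp
    simp_rw [h2a]
    rw [Finset.sum_comm]
    have h2b : ∀ r ∈ Icc 1 ⌊2 * R⌋₊, (∑ x : ZMod q, ∑ m ∈ Icc 1 ⌊2 * M⌋₊,
        (if ((s * r : ℤ) : ZMod q) * (m : ZMod q)⁻¹ = x then c r * b m * A x else 0)) =
        ∑ m ∈ Icc 1 ⌊2 * M⌋₊, c r * b m * A (((s * r : ℤ) : ZMod q) * (m : ZMod q)⁻¹) := by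
      intro r _
      rw [Finset.sum_comm]
      refine Finset.sum_congr rfl fun m _ => ?_
      rw [Finset.sum_ite_eq Finset.univ]
      simp
    rw [Finset.sum_congr rfl h2b, Finset.sum_comm]
    exact Finset.sum_congr rfl fun m _ => Finset.sum_congr rfl fun r _ => by ring
  rw [h1, ← h2]
  exact norm_sum_mul_le_sqrt_mul_sqrt _ W A

/-! ### Trivial bounds -/

/-- `∑_{k ≤ 2K} Λ(k) ≤ 2K log(2K)` and `∑_{k ≤ 2K} Λ(k)² ≤ 2K log²(2K)` in the form needed
("bounding `Λ(k)²` trivially", TeX l.986): for `K ≥ 1` and any `1`-bounded `a`,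
`∑_{k ≤ 2K} ‖a_k Λ(k)‖² ≤ 2K (log 2K)²`. [cite: BondarenkoHeap2026, §6.4, TeX l.986] -/
theorem sum_norm_sq_weight_vonMangoldt_le {K : ℝ} (hK : 1 ≤ K) (a : ℝ → ℂ)
    (ha : ∀ x : ℝ, ‖a x‖ ≤ 1) :
    ∑ k ∈ Icc 1 ⌊2 * K⌋₊, ‖a k * ((Λ k : ℝ) : ℂ)‖ ^ 2 ≤ 2 * K * Real.log (2 * K) ^ 2 := by
  have h2K : (1 : ℝ) ≤ 2 * K := by linarith
  have hlog0 : 0 ≤ Real.log (2 * K) := Real.log_nonneg h2K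
  have hterm : ∀ k ∈ Icc 1 ⌊2 * K⌋₊, ‖a k * ((Λ k : ℝ) : ℂ)‖ ^ 2 ≤ Real.log (2 * K) ^ 2 := by
    intro k hk
    rw [Finset.mem_Icc] at hk
    have hk1 : (1 : ℝ) ≤ k := by exact_mod_cast hk.1
    have hk2 : (k : ℝ) ≤ 2 * K := by
      have := Nat.floor_le (by linarith : (0 : ℝ) ≤ 2 * K)
      exact le_trans (by exact_mod_cast hk.2) this
    have hΛ : ‖((Λ k : ℝ) : ℂ)‖ ≤ Real.log (2 * K) := by
      rw [Complex.norm_real, Real.norm_eq_abs,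
        abs_of_nonneg ArithmeticFunction.vonMangoldt_nonneg]
      exact ArithmeticFunction.vonMangoldt_le_log.trans (Real.log_le_log (by linarith) hk2)
    rw [norm_mul]
    have h01 : ‖a k‖ * ‖((Λ k : ℝ) : ℂ)‖ ≤ 1 * Real.log (2 * K) :=
      mul_le_mul (ha k) hΛ (norm_nonneg _) zero_le_one
    rw [one_mul] at h01
    exact pow_le_pow_left₀ (mul_nonneg (norm_nonneg _) (norm_nonneg _)) h01 2
  calc ∑ k ∈ Icc 1 ⌊2 * K⌋₊, ‖a k * ((Λ k : ℝ) : ℂ)‖ ^ 2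
      ≤ ∑ k ∈ Icc 1 ⌊2 * K⌋₊, Real.log (2 * K) ^ 2 := Finset.sum_le_sum hterm
    _ = (⌊2 * K⌋₊ : ℝ) * Real.log (2 * K) ^ 2 := by
        rw [Finset.sum_const, Nat.card_Icc, nsmul_eq_mul]
        norm_num
    _ ≤ 2 * K * Real.log (2 * K) ^ 2 := by
        gcongr
        exact Nat.floor_le (by linarith)

/-- **Trivial bound** `|E(K,M,R)| ≤ 2K log(2K) · 2M · 2R` for `1`-bounded coefficients, `K ≥ 1`,
`M, R ≥ 0` (`|χ| ≤ 1`, `Λ(k) ≤ log k`). [cite: BondarenkoHeap2026, §6.2, TeX l.840] -/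
theorem norm_corrSumE_le_trivial {q : ℕ} [NeZero q] (χ : DirichletCharacter ℂ q) (s : ℤ)
    {K M R : ℝ} (hK : 1 ≤ K) (hM : 0 ≤ M) (hR : 0 ≤ R) (a b c : ℝ → ℂ)
    (ha : ∀ x : ℝ, ‖a x‖ ≤ 1) (hb : ∀ x : ℝ, ‖b x‖ ≤ 1) (hc : ∀ x : ℝ, ‖c x‖ ≤ 1) :
    ‖corrSumE χ s K M R a b c‖ ≤ 2 * K * Real.log (2 * K) * (2 * M) * (2 * R) := by
  have h2K : (1 : ℝ) ≤ 2 * K := by linarith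
  -- inner double sum bounded by `(2M)(2R)`
  have hinner : ∀ k : ℕ, ‖∑ m ∈ Icc 1 ⌊2 * M⌋₊, ∑ r ∈ Icc 1 ⌊2 * R⌋₊,
      b m * c r * (χ (m : ZMod q) * χ (((k : ℤ) * m + s * r : ℤ) : ZMod q))‖ ≤ (2 * M) * (2 * R) := by
    intro k
    calc ‖∑ m ∈ Icc 1 ⌊2 * M⌋₊, ∑ r ∈ Icc 1 ⌊2 * R⌋₊,
          b m * c r * (χ (m : ZMod q) * χ (((k : ℤ) * m + s * r : ℤ) : ZMod q))‖
        ≤ ∑ m ∈ Icc 1 ⌊2 * M⌋₊, ∑ r ∈ Icc 1 ⌊2 * R⌋₊, (1 : ℝ) := by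
          refine (norm_sum_le _ _).trans (Finset.sum_le_sum fun m _ => ?_)
          refine (norm_sum_le _ _).trans (Finset.sum_le_sum fun r _ => ?_)
          rw [norm_mul, norm_mul, norm_mul]
          have h1 : ‖b m‖ * ‖c r‖ ≤ 1 := by
            calc ‖b m‖ * ‖c r‖ ≤ 1 * 1 := mul_le_mul (hb m) (hc r) (norm_nonneg _) zero_le_one
              _ = 1 := one_mul 1
          have h2 : ‖χ (m : ZMod q)‖ * ‖χ (((k : ℤ) * m + s * r : ℤ) : ZMod q)‖ ≤ 1 := by
            calc ‖χ (m : ZMod q)‖ * ‖χ (((k : ℤ) * m + s * r : ℤ) : ZMod q)‖ ≤ 1 * 1 :=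
                  mul_le_mul (χ.norm_le_one _) (χ.norm_le_one _) (norm_nonneg _) zero_le_one
              _ = 1 := one_mul 1
          calc ‖b m‖ * ‖c r‖ * (‖χ (m : ZMod q)‖ * ‖χ (((k : ℤ) * m + s * r : ℤ) : ZMod q)‖)
              ≤ 1 * 1 := mul_le_mul h1 h2 (by positivity) zero_le_one
            _ = 1 := one_mul 1
      _ = (⌊2 * M⌋₊ : ℝ) * (⌊2 * R⌋₊ : ℝ) := by
          simp only [Finset.sum_const, Nat.card_Icc, mul_one, nsmul_eq_mul]
          push_cast
          ring
      _ ≤ (2 * M) * (2 * R) := by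
          gcongr
          · exact Nat.floor_le (by linarith)
          · exact Nat.floor_le (by linarith)
  calc ‖corrSumE χ s K M R a b c‖
      ≤ ∑ k ∈ Icc 1 ⌊2 * K⌋₊, Real.log (2 * K) * ((2 * M) * (2 * R)) := by
        refine (norm_sum_le _ _).trans (Finset.sum_le_sum fun k hk => ?_)
        rw [Finset.mem_Icc] at hk
        have hk2 : (k : ℝ) ≤ 2 * K :=
          le_trans (by exact_mod_cast hk.2) (Nat.floor_le (by linarith))
        have hk1 : (1 : ℝ) ≤ k := by exact_mod_cast hk.1
        rw [norm_mul, norm_mul]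
        have hΛ : ‖((Λ k : ℝ) : ℂ)‖ ≤ Real.log (2 * K) := by
          rw [Complex.norm_real, Real.norm_eq_abs,
            abs_of_nonneg ArithmeticFunction.vonMangoldt_nonneg]
          exact ArithmeticFunction.vonMangoldt_le_log.trans (Real.log_le_log (by linarith) hk2)
        have haΛ : ‖a k‖ * ‖((Λ k : ℝ) : ℂ)‖ ≤ Real.log (2 * K) := by
          calc ‖a k‖ * ‖((Λ k : ℝ) : ℂ)‖ ≤ 1 * Real.log (2 * K) :=
                mul_le_mul (ha k) hΛ (norm_nonneg _) zero_le_one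
            _ = Real.log (2 * K) := one_mul _
        exact mul_le_mul haΛ (hinner k) (norm_nonneg _) (Real.log_nonneg h2K)
    _ = (⌊2 * K⌋₊ : ℝ) * (Real.log (2 * K) * ((2 * M) * (2 * R))) := by
        rw [Finset.sum_const, Nat.card_Icc, nsmul_eq_mul]
        norm_num
    _ ≤ 2 * K * (Real.log (2 * K) * ((2 * M) * (2 * R))) := by
        have h0 : 0 ≤ Real.log (2 * K) * ((2 * M) * (2 * R)) := by
          have := Real.log_nonneg h2K
          positivity
        exact mul_le_mul_of_nonneg_right (Nat.floor_le (by linarith)) h0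
    _ = 2 * K * Real.log (2 * K) * (2 * M) * (2 * R) := by ring

/-- Restricting `b` to `(m,q) = 1` does not change `E(K,M,R)` (`χ(m) = 0` otherwise; "retaining
the condition `(m,q) = 1` in `b_m`", TeX l.887). [cite: BondarenkoHeap2026, §6.4, TeX l.887] -/
theorem corrSumE_restrict_coprime {q : ℕ} [NeZero q] (χ : DirichletCharacter ℂ q) (s : ℤ)
    (K M R : ℝ) (a b c : ℝ → ℂ) :
    corrSumE χ s K M R a b c =
      corrSumE χ s K M R a (fun x => if (⌊x⌋₊).Coprime q then b x else 0) c := by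
  unfold corrSumE
  refine Finset.sum_congr rfl fun k _ => ?_
  congr 1
  refine Finset.sum_congr rfl fun m _ => Finset.sum_congr rfl fun r _ => ?_
  by_cases hm : m.Coprime q
  · simp [Nat.floor_natCast, hm]
  · have hχ0 : χ (m : ZMod q) = 0 :=
      χ.map_nonunit (mt (ZMod.isUnit_iff_coprime m q).mp hm)
    simp [Nat.floor_natCast, hm, hχ0]

/-! ### (27) from Lemmas 7 and 8 -/

/-- The energy bound (25) of Lemma 7 for the grouped coefficients `W_x = ∑_{(s r) m̄ ≡ x} c_r b_m`
of (24), for either sign `s` of the shift (for `s = −1` reindex `x ↦ −x`).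
[cite: BondarenkoHeap2026, Lemma 7, eq. (25), TeX l.906–921] -/
theorem energy_le_of_lemma7 (h7 : lemma7) {C ε : ℝ} (hC : 0 < C) (hε : 0 < ε) :
    ∃ C' : ℝ, 0 < C' ∧ ∀ (q : ℕ) [NeZero q] (R M : ℝ), 1 ≤ R → R ≤ M → M ≤ (q : ℝ) ^ C →
      ∀ (s : ℤ), (s = 1 ∨ s = -1) → ∀ (b c : ℝ → ℂ), (∀ x, ‖b x‖ ≤ 1) → (∀ x, ‖c x‖ ≤ 1) →
      (∀ m : ℕ, b m ≠ 0 → (M ≤ m ∧ (m : ℝ) ≤ 2 * M) ∧ m.Coprime q) →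
      (∀ r : ℕ, c r ≠ 0 → R ≤ r ∧ (r : ℝ) ≤ 2 * R) →
      ∑ x : ZMod q, ‖∑ r ∈ Icc 1 ⌊2 * R⌋₊, ∑ m ∈ Icc 1 ⌊2 * M⌋₊,
          (if ((s * r : ℤ) : ZMod q) * (m : ZMod q)⁻¹ = x then c r * b m else 0)‖ ^ 2 ≤
        C' * (q : ℝ) ^ ε * (R * M + R ^ 2 * M ^ 2 / q) := by
  classical
  obtain ⟨C', hC', H⟩ := h7 C hC ε hε
  refine ⟨C', hC', ?_⟩
  intro q _ R M hR hRM hMq s hs b c hb1 hc1 hbsupp hcsupp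
  have key := H q R M hR hRM hMq (fun r m => c r * b m)
    (fun r m => by
      calc ‖c r * b m‖ = ‖c r‖ * ‖b m‖ := norm_mul _ _
        _ ≤ 1 * 1 := mul_le_mul (hc1 r) (hb1 m) (norm_nonneg _) zero_le_one
        _ = 1 := one_mul 1)
    (fun r m hrm => ⟨hcsupp r (left_ne_zero_of_mul hrm), (hbsupp m (right_ne_zero_of_mul hrm)).1,
      (hbsupp m (right_ne_zero_of_mul hrm)).2⟩)
  rcases hs with rfl | rfl
  · simpa only [one_mul, Int.cast_natCast] using key
  · have hre : ∀ x : ZMod q, (∑ r ∈ Icc 1 ⌊2 * R⌋₊, ∑ m ∈ Icc 1 ⌊2 * M⌋₊,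
        (if ((-1 * r : ℤ) : ZMod q) * (m : ZMod q)⁻¹ = x then c r * b m else 0)) =
        ∑ r ∈ Icc 1 ⌊2 * R⌋₊, ∑ m ∈ Icc 1 ⌊2 * M⌋₊,
          (if (r : ZMod q) * (m : ZMod q)⁻¹ = -x then c r * b m else 0) := by
      intro x
      refine Finset.sum_congr rfl fun r _ => Finset.sum_congr rfl fun m _ => ?_
      have hiff : (((-1 * r : ℤ) : ZMod q) * (m : ZMod q)⁻¹ = x) ↔
          ((r : ZMod q) * (m : ZMod q)⁻¹ = -x) := by
        push_cast
        rw [neg_one_mul, neg_mul, neg_eq_iff_eq_neg]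
      simp only [hiff]
    simp_rw [hre]
    have hneg := Equiv.sum_comp (Equiv.neg (ZMod q)) (fun x => ‖∑ r ∈ Icc 1 ⌊2 * R⌋₊,
      ∑ m ∈ Icc 1 ⌊2 * M⌋₊, (if (r : ZMod q) * (m : ZMod q)⁻¹ = x then c r * b m else 0)‖ ^ 2)
    simp only [Equiv.neg_apply] at hneg
    rw [hneg]
    exact key

/-- **(27) from Lemmas 7 and 8** (TeX l.986–996): "Applying these in the Cauchy–Schwarz bound
(24) and bounding `Λ(k)²` trivially gives
`E(K,M,R)/KM ≪ (1/KM) q^ε (RM + (RM)²/q)^{1/2} ((q+K)K)^{1/2} ≪ q^ε (√(R/M) + R/q^{1/2})`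
since `q ≪ K`. Then using `R/q^{1/2} ≪ q^{−δ}`, as before, and `R/M ≪ K/T ≪ q^{−η}` in this range,
gives (27) `E(K,M,R)/KM ≪ q^{−η/2+ε} + q^{−δ+ε} ≪ q^{−η/4}` on taking `ε` sufficiently small."
PROVED: the named fact `rangeII_bound` follows from the named facts `lemma7` and `lemma8`
(`ε = η/16`; small `q` by the trivial bound). CORE FORM over raw weight data (v9, refactor-then-
corollary for the primed class, E-ah-3): only the supports and `‖a‖, ‖b‖, ‖c‖ ≤ 1` are used (no
derivative of any weight enters Range II). [cite: BondarenkoHeap2026, eq. (27), TeX l.986–996] -/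
theorem rangeII_bound_core_of_lemma7_lemma8 (h7 : lemma7) (h8 : lemma8) :
    ∀ δ : ℝ, 0 < δ → δ < 1 / 100 → ∀ C₀ : ℝ, 0 < C₀ → ∃ C : ℝ, 0 < C ∧
      ∀ (q : ℕ) [NeZero q] (χ : DirichletCharacter ℂ q), χ.IsPrimitive → χ.IsQuadratic →
      ∀ (K M R : ℝ), IsAdmissibleScale q δ C₀ K M R → InRangeII δ q K →
      ∀ (s : ℤ), (s = 1 ∨ s = -1) → ∀ (a b c : ℝ → ℂ),
        (∀ x : ℝ, a x ≠ 0 → K ≤ x ∧ x ≤ 2 * K) → (∀ x : ℝ, ‖a x‖ ≤ 1) →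
        (∀ x : ℝ, b x ≠ 0 → M ≤ x ∧ x ≤ 2 * M) → (∀ x : ℝ, ‖b x‖ ≤ 1) →
        (∀ x : ℝ, c x ≠ 0 → R ≤ x ∧ x ≤ 2 * R) → (∀ x : ℝ, ‖c x‖ ≤ 1) →
        ‖corrSumE χ s K M R a b c‖ ≤ C * (K * M) * (q : ℝ) ^ (-(δ / 10 / 4)) := by
  classical
  intro δ hδ _hδ1 C₀ hC₀
  have hη0 : 0 < δ / 10 := by positivity
  set ε : ℝ := δ / 10 / 16 with hε
  have hε0 : 0 < ε := by positivity
  obtain ⟨C₇, hC₇, H7⟩ := energy_le_of_lemma7 h7 (by norm_num : (0 : ℝ) < 3) hε0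
  obtain ⟨C₈, hC₈, H8⟩ := h8 ε hε0
  have h2C₀ : 0 < 2 * C₀ := by positivity
  -- the main-case constant `D` and the small-`q` constant `D'`
  set D : ℝ := C₇ * C₈ * ((2 * C₀) ^ (2 * ε) / ε ^ 2) * (4 * (C₀ + C₀ ^ 4)) with hD
  have hD0 : 0 < D := by positivity
  set Q₁ : ℝ := max (max (C₀ ^ (6 : ℝ)) (C₀ ^ (1 / (δ / 10)))) 1 with hQ₁
  have hQ₁1 : 1 ≤ Q₁ := le_max_right _ _
  have hQ₁0 : 0 < Q₁ := by positivity
  set D' : ℝ := 16 * C₀ ^ 3 * Q₁ ^ (10 / 3 + δ / 10 / 4) with hD'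
  have hD'0 : 0 < D' := by positivity
  refine ⟨Real.sqrt D + D', by positivity, ?_⟩
  intro q _ χ hχp hχq K M R hadm hrange s hs a b c hasu ha1 hbsu hb1 hcsu hc1
  obtain ⟨hK1, hM1, hR1, hRle, hKMle⟩ := hadm
  obtain ⟨hKlow, hKup⟩ := hrange
  have hq1 : (1 : ℝ) ≤ q := by exact_mod_cast NeZero.one_le
  have hq0 : (0 : ℝ) < q := by positivity
  have hK0 : 0 < K := by linarith
  have hM0 : 0 < M := by linarith
  have hR0 : 0 < R := by linarith
  have hKM0 : 0 < K * M := by positivity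
  have hT0 : 0 < (q : ℝ) ^ (7 / 3 + δ) := by positivity
  have htarget0 : 0 < (q : ℝ) ^ (-(δ / 10 / 4)) := by positivity
  -- (i) `R ≤ C₀² q^{1/2−δ}` ("`R ≪ L/T = q^{1/2−δ}` always")
  have hRq : R ≤ C₀ ^ 2 * (q : ℝ) ^ (1 / 2 - δ) := by
    have h1 : R ≤ C₀ * (C₀ * (q : ℝ) ^ (17 / 6 : ℝ)) / (q : ℝ) ^ (7 / 3 + δ) :=
      hRle.trans (by gcongr)
    have h2 : (q : ℝ) ^ (17 / 6 : ℝ) / (q : ℝ) ^ (7 / 3 + δ) = (q : ℝ) ^ (1 / 2 - δ) := by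
      rw [← Real.rpow_sub hq0]
      exact congrArg (fun t : ℝ => (q : ℝ) ^ t) (by ring)
    calc R ≤ C₀ * (C₀ * (q : ℝ) ^ (17 / 6 : ℝ)) / (q : ℝ) ^ (7 / 3 + δ) := h1
      _ = C₀ ^ 2 * ((q : ℝ) ^ (17 / 6 : ℝ) / (q : ℝ) ^ (7 / 3 + δ)) := by ring
      _ = C₀ ^ 2 * (q : ℝ) ^ (1 / 2 - δ) := by rw [h2]
  -- (ii) `K ≤ C₀ q^{17/6}` and `log(2K) ≥ 0`
  have hKq : K ≤ C₀ * (q : ℝ) ^ (17 / 6 : ℝ) :=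
    (le_mul_of_one_le_right hK0.le hM1).trans hKMle
  have h2K1 : (1 : ℝ) ≤ 2 * K := by linarith
  have hlog0 : 0 ≤ Real.log (2 * K) := Real.log_nonneg h2K1
  by_cases hmain : R ≤ M ∧ M ≤ (q : ℝ) ^ (3 : ℝ)
  · /- MAIN CASE: Cauchy–Schwarz (24), Lemma 7 for `W_x`, Lemma 8 with `b_k = a_k Λ(k)`. -/
    obtain ⟨hRM, hMq⟩ := hmain
    set b' : ℝ → ℂ := fun x => if (⌊x⌋₊).Coprime q then b x else 0 with hb'
    have hb'1 : ∀ x, ‖b' x‖ ≤ 1 := fun x => by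
      simp only [hb']
      split_ifs
      · exact hb1 x
      · simp
    have hb'supp : ∀ m : ℕ, b' m ≠ 0 → (M ≤ m ∧ (m : ℝ) ≤ 2 * M) ∧ m.Coprime q := by
      intro m hm
      have hm' : m.Coprime q ∧ b m ≠ 0 := by
        simpa [hb', Nat.floor_natCast] using hm
      exact ⟨hbsu m hm'.2, hm'.1⟩
    have hb'cop : ∀ m : ℕ, b' m ≠ 0 → m.Coprime q := fun m hm => (hb'supp m hm).2
    have hEq : corrSumE χ s K M R a b c = corrSumE χ s K M R a b' c :=
      corrSumE_restrict_coprime χ s K M R a b c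
    have h24 := norm_corrSumE_le_sqrt_mul_sqrt χ hχq s K M R a b' c hb'cop
    have hSW := H7 q R M hR1 hRM hMq s hs b' c hb'1 hc1 hb'supp (fun r hr => hcsu r hr)
    have hSA := H8 q χ hχp hχq K hK1 (fun k => a k * ((Λ k : ℝ) : ℂ))
      (fun k hk => hasu k (left_ne_zero_of_mul hk))
    have hΛ2 := sum_norm_sq_weight_vonMangoldt_le hK1 a ha1
    -- the two bounds `BW`, `BA`
    set BW : ℝ := C₇ * (q : ℝ) ^ ε * (R * M + R ^ 2 * M ^ 2 / q) with hBW
    set BA : ℝ := C₈ * (q : ℝ) ^ ε * ((q : ℝ) + K) * (2 * K * Real.log (2 * K) ^ 2) with hBA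
    have hBW0 : 0 ≤ BW := by positivity
    have hBA0 : 0 ≤ BA := by positivity
    have hSA' : ∑ x : ZMod q, ‖∑ k ∈ Icc 1 ⌊2 * K⌋₊,
        a k * ((Λ k : ℝ) : ℂ) * χ ((k : ZMod q) + x)‖ ^ 2 ≤ BA :=
      hSA.trans (mul_le_mul_of_nonneg_left hΛ2 (by positivity))
    have hE1 : ‖corrSumE χ s K M R a b c‖ ≤ Real.sqrt (BW * BA) := by
      rw [hEq]
      refine h24.trans ?_
      rw [← Real.sqrt_mul (Finset.sum_nonneg fun _ _ => sq_nonneg _)]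
      exact Real.sqrt_le_sqrt (mul_le_mul hSW hSA' (Finset.sum_nonneg fun _ _ => sq_nonneg _)
        hBW0)
    -- (a) `q ≤ K` ("`K ≫ q` in this range"), so `q + K ≤ 2K`
    have hqK : (q : ℝ) ≤ K := by
      have h1 : (q : ℝ) ^ (1 : ℝ) ≤ (q : ℝ) ^ (7 / 3 + δ) * (q : ℝ) ^ (-(1 / 2 + δ / 10)) := by
        rw [← Real.rpow_add hq0]
        exact Real.rpow_le_rpow_of_exponent_le hq1 (by linarith)
      rw [Real.rpow_one] at h1
      exact h1.trans hKlow.le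
    have hqK2 : (q : ℝ) + K ≤ 2 * K := by linarith
    -- (b) `R ≤ C₀ q^{−η} M` ("`R/M ≪ K/T ≤ q^{−η}`")
    have hRM' : R ≤ C₀ * (q : ℝ) ^ (-(δ / 10)) * M := by
      have h1 : C₀ * (K * M) / (q : ℝ) ^ (7 / 3 + δ) ≤
          C₀ * ((q : ℝ) ^ (7 / 3 + δ) * (q : ℝ) ^ (-(δ / 10)) * M) / (q : ℝ) ^ (7 / 3 + δ) := by
        gcongr
      have h2 : C₀ * ((q : ℝ) ^ (7 / 3 + δ) * (q : ℝ) ^ (-(δ / 10)) * M) / (q : ℝ) ^ (7 / 3 + δ) =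
          C₀ * (q : ℝ) ^ (-(δ / 10)) * M := by
        rw [show C₀ * ((q : ℝ) ^ (7 / 3 + δ) * (q : ℝ) ^ (-(δ / 10)) * M) =
            C₀ * (q : ℝ) ^ (-(δ / 10)) * M * (q : ℝ) ^ (7 / 3 + δ) by ring,
          mul_div_cancel_right₀ _ hT0.ne']
      linarith [hRle, h1, h2.le, h2.ge]
    -- (c) `R²/q ≤ C₀⁴ q^{−2δ} ≤ C₀⁴ q^{−η}`
    have hR2q : R ^ 2 / q ≤ C₀ ^ 4 * (q : ℝ) ^ (-(δ / 10)) := by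
      have h1 : R ^ 2 ≤ (C₀ ^ 2 * (q : ℝ) ^ (1 / 2 - δ)) ^ 2 :=
        pow_le_pow_left₀ hR0.le hRq 2
      have h2 : (C₀ ^ 2 * (q : ℝ) ^ (1 / 2 - δ)) ^ 2 / q = C₀ ^ 4 * (q : ℝ) ^ (-(2 * δ)) := by
        rw [mul_pow, pow_two ((q : ℝ) ^ (1 / 2 - δ)), ← Real.rpow_add hq0, mul_div_assoc,
          ← Real.rpow_sub_one hq0.ne', ← pow_mul,
          show (1 : ℝ) / 2 - δ + (1 / 2 - δ) - 1 = -(2 * δ) by ring]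
      have h3 : (q : ℝ) ^ (-(2 * δ)) ≤ (q : ℝ) ^ (-(δ / 10)) :=
        Real.rpow_le_rpow_of_exponent_le hq1 (by linarith)
      calc R ^ 2 / q ≤ (C₀ ^ 2 * (q : ℝ) ^ (1 / 2 - δ)) ^ 2 / q := by gcongr
        _ = C₀ ^ 4 * (q : ℝ) ^ (-(2 * δ)) := h2
        _ ≤ C₀ ^ 4 * (q : ℝ) ^ (-(δ / 10)) := by gcongr
    -- (d) `log(2K) ≤ (2C₀)^ε q^{17ε/6} / ε`
    have hlog : Real.log (2 * K) ≤ (2 * C₀) ^ ε * (q : ℝ) ^ (17 / 6 * ε) / ε := by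
      have h1 : Real.log (2 * K) ≤ (2 * K) ^ ε / ε := log_le_rpow_div h2K1 hε0
      have h2 : (2 * K) ^ ε ≤ (2 * C₀ * (q : ℝ) ^ (17 / 6 : ℝ)) ^ ε :=
        Real.rpow_le_rpow (by linarith) (by linarith [hKq]) hε0.le
      have h3 : (2 * C₀ * (q : ℝ) ^ (17 / 6 : ℝ)) ^ ε = (2 * C₀) ^ ε * (q : ℝ) ^ (17 / 6 * ε) := by
        rw [Real.mul_rpow h2C₀.le (by positivity), ← Real.rpow_mul hq0.le]
      calc Real.log (2 * K) ≤ (2 * K) ^ ε / ε := h1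
        _ ≤ (2 * C₀ * (q : ℝ) ^ (17 / 6 : ℝ)) ^ ε / ε := by gcongr
        _ = (2 * C₀) ^ ε * (q : ℝ) ^ (17 / 6 * ε) / ε := by rw [h3]
    have hlog2 : Real.log (2 * K) ^ 2 ≤ (2 * C₀) ^ (2 * ε) * (q : ℝ) ^ (17 / 3 * ε) / ε ^ 2 := by
      have h1 : Real.log (2 * K) ^ 2 ≤ ((2 * C₀) ^ ε * (q : ℝ) ^ (17 / 6 * ε) / ε) ^ 2 :=
        pow_le_pow_left₀ hlog0 hlog 2
      have h2 : ((2 * C₀) ^ ε * (q : ℝ) ^ (17 / 6 * ε) / ε) ^ 2 =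
          (2 * C₀) ^ (2 * ε) * (q : ℝ) ^ (17 / 3 * ε) / ε ^ 2 := by
        rw [div_pow, mul_pow, pow_two ((2 * C₀) ^ ε), pow_two ((q : ℝ) ^ (17 / 6 * ε)),
          ← Real.rpow_add h2C₀, ← Real.rpow_add hq0,
          show ε + ε = 2 * ε by ring, show (17 : ℝ) / 6 * ε + 17 / 6 * ε = 17 / 3 * ε by ring]
      exact h1.trans h2.le
    -- (e) the product of the two bounds
    have hprod : BW * BA ≤ D * (K * M) ^ 2 * (q : ℝ) ^ (-(δ / 10 / 2)) := by
      -- `(RM + R²M²/q)(q+K)(2K) ≤ 4 (KM)² (C₀ + C₀⁴) q^{−η}`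
      have hgeom : (R * M + R ^ 2 * M ^ 2 / q) * (((q : ℝ) + K) * (2 * K)) ≤
          4 * (C₀ + C₀ ^ 4) * (K * M) ^ 2 * (q : ℝ) ^ (-(δ / 10)) := by
        have h1 : R * M + R ^ 2 * M ^ 2 / q ≤
            (C₀ * (q : ℝ) ^ (-(δ / 10)) * M) * M + (C₀ ^ 4 * (q : ℝ) ^ (-(δ / 10))) * M ^ 2 := by
          have h1a : R * M ≤ (C₀ * (q : ℝ) ^ (-(δ / 10)) * M) * M :=
            mul_le_mul_of_nonneg_right hRM' hM0.le
          have h1b : R ^ 2 * M ^ 2 / q ≤ (C₀ ^ 4 * (q : ℝ) ^ (-(δ / 10))) * M ^ 2 := by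
            rw [show R ^ 2 * M ^ 2 / (q : ℝ) = R ^ 2 / q * M ^ 2 by ring]
            exact mul_le_mul_of_nonneg_right hR2q (sq_nonneg M)
          exact add_le_add h1a h1b
        have h2 : ((q : ℝ) + K) * (2 * K) ≤ 4 * K ^ 2 :=
          calc ((q : ℝ) + K) * (2 * K) ≤ (2 * K) * (2 * K) :=
                mul_le_mul_of_nonneg_right hqK2 (by linarith)
            _ = 4 * K ^ 2 := by ring
        have h3 : 0 ≤ R * M + R ^ 2 * M ^ 2 / q :=
          add_nonneg (mul_nonneg hR0.le hM0.le) (div_nonneg (by positivity) hq0.le)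
        have h4 : 0 ≤ (C₀ * (q : ℝ) ^ (-(δ / 10)) * M) * M +
            (C₀ ^ 4 * (q : ℝ) ^ (-(δ / 10))) * M ^ 2 := h3.trans h1
        calc (R * M + R ^ 2 * M ^ 2 / q) * (((q : ℝ) + K) * (2 * K))
            ≤ ((C₀ * (q : ℝ) ^ (-(δ / 10)) * M) * M + (C₀ ^ 4 * (q : ℝ) ^ (-(δ / 10))) * M ^ 2) *
                (4 * K ^ 2) :=
              mul_le_mul h1 h2 (mul_nonneg (by linarith) (by linarith)) h4
          _ = 4 * (C₀ + C₀ ^ 4) * (K * M) ^ 2 * (q : ℝ) ^ (-(δ / 10)) := by ring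
      -- exponents: `q^{ε} q^{ε} q^{17ε/3} q^{−η} = q^{23ε/3 − η} ≤ q^{−η/2}`
      have hexp : (q : ℝ) ^ ε * (q : ℝ) ^ ε * (q : ℝ) ^ (17 / 3 * ε) * (q : ℝ) ^ (-(δ / 10)) ≤
          (q : ℝ) ^ (-(δ / 10 / 2)) := by
        rw [← Real.rpow_add hq0, ← Real.rpow_add hq0, ← Real.rpow_add hq0]
        refine Real.rpow_le_rpow_of_exponent_le hq1 ?_
        linarith [hε]
      calc BW * BA
          = C₇ * C₈ * ((q : ℝ) ^ ε * (q : ℝ) ^ ε) * Real.log (2 * K) ^ 2 *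
              ((R * M + R ^ 2 * M ^ 2 / q) * (((q : ℝ) + K) * (2 * K))) := by
            rw [hBW, hBA]; ring
        _ ≤ C₇ * C₈ * ((q : ℝ) ^ ε * (q : ℝ) ^ ε) *
              ((2 * C₀) ^ (2 * ε) * (q : ℝ) ^ (17 / 3 * ε) / ε ^ 2) *
              (4 * (C₀ + C₀ ^ 4) * (K * M) ^ 2 * (q : ℝ) ^ (-(δ / 10))) := by
            have hP : 0 ≤ C₇ * C₈ * ((q : ℝ) ^ ε * (q : ℝ) ^ ε) := by positivity
            have hG : 0 ≤ (R * M + R ^ 2 * M ^ 2 / q) * (((q : ℝ) + K) * (2 * K)) :=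
              mul_nonneg (add_nonneg (mul_nonneg hR0.le hM0.le) (div_nonneg (by positivity) hq0.le))
                (mul_nonneg (by linarith) (by linarith))
            have hL : 0 ≤ C₇ * C₈ * ((q : ℝ) ^ ε * (q : ℝ) ^ ε) *
                ((2 * C₀) ^ (2 * ε) * (q : ℝ) ^ (17 / 3 * ε) / ε ^ 2) :=
              mul_nonneg hP (by positivity)
            exact mul_le_mul (mul_le_mul_of_nonneg_left hlog2 hP) hgeom hG hL
        _ = D * (K * M) ^ 2 *
              ((q : ℝ) ^ ε * (q : ℝ) ^ ε * (q : ℝ) ^ (17 / 3 * ε) * (q : ℝ) ^ (-(δ / 10))) := by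
            rw [hD]; ring
        _ ≤ D * (K * M) ^ 2 * (q : ℝ) ^ (-(δ / 10 / 2)) :=
            mul_le_mul_of_nonneg_left hexp (mul_nonneg hD0.le (sq_nonneg _))
    -- conclude the main case
    have hq2 : ((q : ℝ) ^ (-(δ / 10 / 4))) ^ 2 = (q : ℝ) ^ (-(δ / 10 / 2)) := by
      rw [pow_two, ← Real.rpow_add hq0]
      exact congrArg (fun t : ℝ => (q : ℝ) ^ t) (by ring)
    have hsq : D * (K * M) ^ 2 * (q : ℝ) ^ (-(δ / 10 / 2)) =
        (Real.sqrt D * (K * M) * (q : ℝ) ^ (-(δ / 10 / 4))) ^ 2 := by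
      rw [mul_pow (Real.sqrt D * (K * M)) ((q : ℝ) ^ (-(δ / 10 / 4))) 2,
        mul_pow (Real.sqrt D) (K * M) 2, Real.sq_sqrt hD0.le, hq2]
    have hfin : Real.sqrt D * (K * M) * (q : ℝ) ^ (-(δ / 10 / 4)) ≤
        (Real.sqrt D + D') * (K * M) * (q : ℝ) ^ (-(δ / 10 / 4)) :=
      mul_le_mul_of_nonneg_right
        (mul_le_mul_of_nonneg_right (le_add_of_nonneg_right hD'0.le) hKM0.le) htarget0.le
    calc ‖corrSumE χ s K M R a b c‖ ≤ Real.sqrt (BW * BA) := hE1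
      _ ≤ Real.sqrt ((Real.sqrt D * (K * M) * (q : ℝ) ^ (-(δ / 10 / 4))) ^ 2) :=
          Real.sqrt_le_sqrt (hprod.trans hsq.le)
      _ = Real.sqrt D * (K * M) * (q : ℝ) ^ (-(δ / 10 / 4)) :=
          Real.sqrt_sq (mul_nonneg (mul_nonneg (Real.sqrt_nonneg D) hKM0.le) htarget0.le)
      _ ≤ (Real.sqrt D + D') * (K * M) * (q : ℝ) ^ (-(δ / 10 / 4)) := hfin
  · /- SMALL `q`: if `R > M` or `M > q³` then `q ≤ Q₁`, and the trivial bound suffices. -/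
    have hqQ : (q : ℝ) ≤ Q₁ := by
      rcases not_and_or.mp hmain with hRM | hMq
      · -- `M < R ≤ C₀ K M / T`, `K ≤ T q^{−η}` ⟹ `q^{η} < C₀` ⟹ `q < C₀^{1/η}`
        have hMR : M < R := lt_of_not_ge hRM
        have h1 : M * (q : ℝ) ^ (7 / 3 + δ) < C₀ * (K * M) :=
          (lt_div_iff₀ hT0).mp (hMR.trans_le hRle)
        have h1' : (q : ℝ) ^ (7 / 3 + δ) * M < C₀ * K * M := by linarith
        have h2 : (q : ℝ) ^ (7 / 3 + δ) < C₀ * K := lt_of_mul_lt_mul_right h1' hM0.le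
        have h3 : C₀ * K ≤ C₀ * ((q : ℝ) ^ (7 / 3 + δ) * (q : ℝ) ^ (-(δ / 10))) :=
          mul_le_mul_of_nonneg_left hKup hC₀.le
        have h6 : (1 : ℝ) < C₀ * (q : ℝ) ^ (-(δ / 10)) := by
          have h5 : (q : ℝ) ^ (7 / 3 + δ) * 1 <
              (q : ℝ) ^ (7 / 3 + δ) * (C₀ * (q : ℝ) ^ (-(δ / 10))) := by
            calc (q : ℝ) ^ (7 / 3 + δ) * 1 = (q : ℝ) ^ (7 / 3 + δ) := mul_one _
              _ < C₀ * K := h2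
              _ ≤ C₀ * ((q : ℝ) ^ (7 / 3 + δ) * (q : ℝ) ^ (-(δ / 10))) := h3
              _ = (q : ℝ) ^ (7 / 3 + δ) * (C₀ * (q : ℝ) ^ (-(δ / 10))) := by ring
          exact lt_of_mul_lt_mul_left h5 hT0.le
        have h7' : (q : ℝ) ^ (δ / 10) * (q : ℝ) ^ (-(δ / 10)) = 1 := by
          rw [← Real.rpow_add hq0, add_neg_cancel, Real.rpow_zero]
        have h4 : (q : ℝ) ^ (δ / 10) < C₀ := by
          have hpos : 0 < (q : ℝ) ^ (δ / 10) := Real.rpow_pos_of_pos hq0 _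
          calc (q : ℝ) ^ (δ / 10) = (q : ℝ) ^ (δ / 10) * 1 := (mul_one _).symm
            _ < (q : ℝ) ^ (δ / 10) * (C₀ * (q : ℝ) ^ (-(δ / 10))) := mul_lt_mul_of_pos_left h6 hpos
            _ = C₀ * ((q : ℝ) ^ (δ / 10) * (q : ℝ) ^ (-(δ / 10))) := by ring
            _ = C₀ := by rw [h7', mul_one]
        have h5 : (q : ℝ) < C₀ ^ (1 / (δ / 10)) := by
          have := Real.rpow_lt_rpow (Real.rpow_nonneg hq0.le _) h4 (one_div_pos.mpr hη0)
          rwa [← Real.rpow_mul hq0.le, mul_one_div_cancel hη0.ne', Real.rpow_one] at this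
        exact h5.le.trans ((le_max_right _ _).trans (le_max_left _ _))
      · -- `q³ < M ≤ K M ≤ C₀ q^{17/6}` ⟹ `q^{1/6} < C₀` ⟹ `q < C₀^6`
        have hMq' : (q : ℝ) ^ (3 : ℝ) < M := lt_of_not_ge hMq
        have h1 : (q : ℝ) ^ (3 : ℝ) < C₀ * (q : ℝ) ^ (17 / 6 : ℝ) :=
          hMq'.trans_le ((le_mul_of_one_le_left hM0.le hK1).trans hKMle)
        have h2 : (q : ℝ) ^ (1 / 6 : ℝ) < C₀ := by
          have h3 : (q : ℝ) ^ (3 : ℝ) = (q : ℝ) ^ (1 / 6 : ℝ) * (q : ℝ) ^ (17 / 6 : ℝ) := by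
            rw [← Real.rpow_add hq0]
            exact congrArg (fun t : ℝ => (q : ℝ) ^ t) (by norm_num)
          rw [h3] at h1
          exact lt_of_mul_lt_mul_right h1 (Real.rpow_nonneg hq0.le _)
        have h5 : (q : ℝ) < C₀ ^ (6 : ℝ) := by
          have := Real.rpow_lt_rpow (Real.rpow_nonneg hq0.le _) h2 (by norm_num : (0 : ℝ) < 6)
          rwa [← Real.rpow_mul hq0.le, show (1 / 6 : ℝ) * 6 = 1 by norm_num,
            Real.rpow_one] at this
        exact h5.le.trans ((le_max_left _ _).trans (le_max_left _ _))
    have htriv := norm_corrSumE_le_trivial χ s hK1 hM0.le hR0.le a b c ha1 hb1 hc1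
    -- `R ≤ C₀² q^{1/2}`, `log(2K) ≤ 2K ≤ 2C₀ q^{17/6}`
    have hRq' : R ≤ C₀ ^ 2 * (q : ℝ) ^ (1 / 2 : ℝ) :=
      hRq.trans (mul_le_mul_of_nonneg_left (Real.rpow_le_rpow_of_exponent_le hq1 (by linarith))
        (sq_nonneg C₀))
    have hlogK : Real.log (2 * K) ≤ 2 * C₀ * (q : ℝ) ^ (17 / 6 : ℝ) := by
      have h1 : Real.log (2 * K) ≤ 2 * K :=
        (Real.log_le_sub_one_of_pos (by linarith)).trans (by linarith)
      linarith [hKq]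
    have hpow : (q : ℝ) ^ (1 / 2 : ℝ) * (q : ℝ) ^ (17 / 6 : ℝ) ≤
        Q₁ ^ (10 / 3 + δ / 10 / 4) * (q : ℝ) ^ (-(δ / 10 / 4)) := by
      have h1 : (q : ℝ) ^ (1 / 2 : ℝ) * (q : ℝ) ^ (17 / 6 : ℝ) =
          (q : ℝ) ^ (10 / 3 + δ / 10 / 4) * (q : ℝ) ^ (-(δ / 10 / 4)) := by
        rw [← Real.rpow_add hq0, ← Real.rpow_add hq0]
        exact congrArg (fun t : ℝ => (q : ℝ) ^ t) (by ring)
      rw [h1]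
      exact mul_le_mul_of_nonneg_right
        (Real.rpow_le_rpow hq0.le hqQ (by positivity)) htarget0.le
    have hfin : D' * (K * M) * (q : ℝ) ^ (-(δ / 10 / 4)) ≤
        (Real.sqrt D + D') * (K * M) * (q : ℝ) ^ (-(δ / 10 / 4)) :=
      mul_le_mul_of_nonneg_right
        (mul_le_mul_of_nonneg_right (le_add_of_nonneg_left (Real.sqrt_nonneg D)) hKM0.le)
        htarget0.le
    calc ‖corrSumE χ s K M R a b c‖ ≤ 2 * K * Real.log (2 * K) * (2 * M) * (2 * R) := htriv
      _ = 8 * (K * M) * (Real.log (2 * K) * R) := by ring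
      _ ≤ 8 * (K * M) * ((2 * C₀ * (q : ℝ) ^ (17 / 6 : ℝ)) * (C₀ ^ 2 * (q : ℝ) ^ (1 / 2 : ℝ))) :=
          mul_le_mul_of_nonneg_left (mul_le_mul hlogK hRq' hR0.le (by positivity))
            (mul_nonneg (by norm_num) hKM0.le)
      _ = 16 * C₀ ^ 3 * (K * M) * ((q : ℝ) ^ (1 / 2 : ℝ) * (q : ℝ) ^ (17 / 6 : ℝ)) := by ring
      _ ≤ 16 * C₀ ^ 3 * (K * M) * (Q₁ ^ (10 / 3 + δ / 10 / 4) * (q : ℝ) ^ (-(δ / 10 / 4))) :=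
          mul_le_mul_of_nonneg_left hpow (by positivity)
      _ = D' * (K * M) * (q : ℝ) ^ (-(δ / 10 / 4)) := by rw [hD']; ring
      _ ≤ (Real.sqrt D + D') * (K * M) * (q : ℝ) ^ (-(δ / 10 / 4)) := hfin


/-- **(27) from Lemmas 7 and 8**, as typed (`rangeII_bound`): corollary of
`rangeII_bound_core_of_lemma7_lemma8` (the dyadic weight class is used only through the supports
and `‖a‖, ‖b‖, ‖c‖ ≤ 1`). [cite: BondarenkoHeap2026, eq. (27), TeX l.986–996] -/
theorem rangeII_bound_of_lemma7_lemma8 (h7 : lemma7) (h8 : lemma8) : rangeII_bound := by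
  intro δ hδ hδ1 C₀ hC₀ _A
  obtain ⟨C, hC, H⟩ := rangeII_bound_core_of_lemma7_lemma8 h7 h8 δ hδ hδ1 C₀ hC₀
  refine ⟨1, one_pos, C, hC, ?_⟩
  intro q _ χ hχp hχq K M R hadm hrange s hs a b c ha hb hc
  exact H q χ hχp hχq K M R hadm hrange s hs a b c ha.2.1 ha.2.2.1 hb.2.1 hb.2.2.1 hc.2.1 hc.2.2.1

/-! ### §6.5: (40) from Lemma 9 (32), Lemma 10 and (28) — auxiliary lemmas -/

/-- Splitting `E(K,M,R)` according to `(k,q) = 1` or not (TeX l.1004: "we may assume that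
`(k,q) = 1` and we retain this condition implicitly in the `a_k`"; the complementary part is
estimated trivially). [cite: BondarenkoHeap2026, §6.5, TeX l.1004] -/
theorem corrSumE_split_coprime {q : ℕ} [NeZero q] (χ : DirichletCharacter ℂ q) (s : ℤ)
    (K M R : ℝ) (a b c : ℝ → ℂ) :
    corrSumE χ s K M R a b c =
      corrSumE χ s K M R (fun x => if (⌊x⌋₊).Coprime q then a x else 0) b c +
        corrSumE χ s K M R (fun x => if (⌊x⌋₊).Coprime q then 0 else a x) b c := by
  unfold corrSumE
  rw [← Finset.sum_add_distrib]
  refine Finset.sum_congr rfl fun k _ => ?_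
  simp only [Nat.floor_natCast]
  split_ifs <;> ring

/-- `|E(K,M,R)| ≤ (∑_{k ≤ 2K} |a_k| Λ(k)) · 2M · 2R` for `1`-bounded `b, c` (`|χ| ≤ 1`).
[cite: BondarenkoHeap2026, §6.2, TeX l.840] -/
theorem norm_corrSumE_le_weighted {q : ℕ} [NeZero q] (χ : DirichletCharacter ℂ q) (s : ℤ)
    (K : ℝ) {M R : ℝ} (hM : 0 ≤ M) (hR : 0 ≤ R) (a b c : ℝ → ℂ)
    (hb : ∀ x : ℝ, ‖b x‖ ≤ 1) (hc : ∀ x : ℝ, ‖c x‖ ≤ 1) :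
    ‖corrSumE χ s K M R a b c‖ ≤
      (∑ k ∈ Icc 1 ⌊2 * K⌋₊, ‖a k‖ * Λ k) * ((2 * M) * (2 * R)) := by
  have hinner : ∀ k : ℕ, ‖∑ m ∈ Icc 1 ⌊2 * M⌋₊, ∑ r ∈ Icc 1 ⌊2 * R⌋₊,
      b m * c r * (χ (m : ZMod q) * χ (((k : ℤ) * m + s * r : ℤ) : ZMod q))‖ ≤
        (2 * M) * (2 * R) := by
    intro k
    calc ‖∑ m ∈ Icc 1 ⌊2 * M⌋₊, ∑ r ∈ Icc 1 ⌊2 * R⌋₊,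
          b m * c r * (χ (m : ZMod q) * χ (((k : ℤ) * m + s * r : ℤ) : ZMod q))‖
        ≤ ∑ m ∈ Icc 1 ⌊2 * M⌋₊, ∑ r ∈ Icc 1 ⌊2 * R⌋₊, (1 : ℝ) := by
          refine (norm_sum_le _ _).trans (Finset.sum_le_sum fun m _ => ?_)
          refine (norm_sum_le _ _).trans (Finset.sum_le_sum fun r _ => ?_)
          rw [norm_mul, norm_mul, norm_mul]
          have h1 : ‖b m‖ * ‖c r‖ ≤ 1 := by
            calc ‖b m‖ * ‖c r‖ ≤ 1 * 1 := mul_le_mul (hb m) (hc r) (norm_nonneg _) zero_le_one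
              _ = 1 := one_mul 1
          have h2 : ‖χ (m : ZMod q)‖ * ‖χ (((k : ℤ) * m + s * r : ℤ) : ZMod q)‖ ≤ 1 := by
            calc ‖χ (m : ZMod q)‖ * ‖χ (((k : ℤ) * m + s * r : ℤ) : ZMod q)‖ ≤ 1 * 1 :=
                  mul_le_mul (χ.norm_le_one _) (χ.norm_le_one _) (norm_nonneg _) zero_le_one
              _ = 1 := one_mul 1
          calc ‖b m‖ * ‖c r‖ * (‖χ (m : ZMod q)‖ * ‖χ (((k : ℤ) * m + s * r : ℤ) : ZMod q)‖)
              ≤ 1 * 1 := mul_le_mul h1 h2 (by positivity) zero_le_one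
            _ = 1 := one_mul 1
      _ = (⌊2 * M⌋₊ : ℝ) * (⌊2 * R⌋₊ : ℝ) := by
          simp only [Finset.sum_const, Nat.card_Icc, mul_one, nsmul_eq_mul]
          push_cast
          ring
      _ ≤ (2 * M) * (2 * R) := by
          gcongr
          · exact Nat.floor_le (by linarith)
          · exact Nat.floor_le (by linarith)
  calc ‖corrSumE χ s K M R a b c‖
      ≤ ∑ k ∈ Icc 1 ⌊2 * K⌋₊, ‖a k‖ * Λ k * ((2 * M) * (2 * R)) := by
        refine (norm_sum_le _ _).trans (Finset.sum_le_sum fun k _ => ?_)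
        rw [norm_mul, norm_mul, Complex.norm_real, Real.norm_eq_abs,
          abs_of_nonneg ArithmeticFunction.vonMangoldt_nonneg]
        exact mul_le_mul_of_nonneg_left (hinner k)
          (mul_nonneg (norm_nonneg _) ArithmeticFunction.vonMangoldt_nonneg)
    _ = (∑ k ∈ Icc 1 ⌊2 * K⌋₊, ‖a k‖ * Λ k) * ((2 * M) * (2 * R)) := by
        rw [Finset.sum_mul]

/-- `∑_{k ≤ 2K} |a_k| Λ(k) ≤ 2K log(2K)` for `1`-bounded `a`, `K ≥ 1`.
[cite: BondarenkoHeap2026, §6.4, TeX l.986] -/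
theorem sum_norm_weight_vonMangoldt_le {K : ℝ} (hK : 1 ≤ K) (a : ℝ → ℂ)
    (ha : ∀ x : ℝ, ‖a x‖ ≤ 1) :
    ∑ k ∈ Icc 1 ⌊2 * K⌋₊, ‖a k‖ * Λ k ≤ 2 * K * Real.log (2 * K) := by
  have h2K : (1 : ℝ) ≤ 2 * K := by linarith
  have hlog0 : 0 ≤ Real.log (2 * K) := Real.log_nonneg h2K
  have hterm : ∀ k ∈ Icc 1 ⌊2 * K⌋₊, ‖a k‖ * Λ k ≤ Real.log (2 * K) := by
    intro k hk
    rw [Finset.mem_Icc] at hk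
    have hk1 : (1 : ℝ) ≤ k := by exact_mod_cast hk.1
    have hk2 : (k : ℝ) ≤ 2 * K := le_trans (by exact_mod_cast hk.2) (Nat.floor_le (by linarith))
    have hΛ : Λ k ≤ Real.log (2 * K) :=
      ArithmeticFunction.vonMangoldt_le_log.trans (Real.log_le_log (by linarith) hk2)
    calc ‖a k‖ * Λ k ≤ 1 * Real.log (2 * K) :=
          mul_le_mul (ha k) hΛ ArithmeticFunction.vonMangoldt_nonneg zero_le_one
      _ = Real.log (2 * K) := one_mul _
  calc ∑ k ∈ Icc 1 ⌊2 * K⌋₊, ‖a k‖ * Λ k ≤ ∑ k ∈ Icc 1 ⌊2 * K⌋₊, Real.log (2 * K) :=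
        Finset.sum_le_sum hterm
    _ = (⌊2 * K⌋₊ : ℝ) * Real.log (2 * K) := by
        rw [Finset.sum_const, Nat.card_Icc, nsmul_eq_mul]; norm_num
    _ ≤ 2 * K * Real.log (2 * K) :=
        mul_le_mul_of_nonneg_right (Nat.floor_le (by linarith)) hlog0

/-- **Prime powers of primes dividing `q`** (TeX l.1004: "If `(k, q) > 1` then we must have
`k = p^j` for some prime `p | q` … bounding trivially"): crude form
`∑_{k ≤ N, (k,q) > 1} Λ(k) ≤ ω(q) · (log₂ N + 1) · log q`. [cite: BondarenkoHeap2026, §6.5, TeX l.1004] -/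
theorem sum_vonMangoldt_not_coprime_le {q : ℕ} (hq : q ≠ 0) (N : ℕ) :
    ∑ k ∈ (Icc 1 N).filter (fun k => ¬ k.Coprime q), Λ k ≤
      q.primeFactors.card * (Nat.log 2 N + 1) * Real.log q := by
  classical
  -- the support of `Λ` inside the filter consists of prime powers `p^j`, `p ∣ q`, `j ≤ log₂ N`
  set S := ((Icc 1 N).filter (fun k => ¬ k.Coprime q)).filter (fun k => Λ k ≠ 0) with hS
  have hsub : S ⊆ (q.primeFactors ×ˢ Finset.range (Nat.log 2 N + 1)).image
      (fun pj : ℕ × ℕ => pj.1 ^ pj.2) := by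
    intro k hk
    simp only [hS, Finset.mem_filter, Finset.mem_Icc] at hk
    obtain ⟨⟨⟨hk1, hkN⟩, hcop⟩, hΛ⟩ := hk
    rw [Ne, ArithmeticFunction.vonMangoldt_eq_zero_iff, not_not] at hΛ
    obtain ⟨p, j, hp, hj, rfl⟩ := (isPrimePow_nat_iff _).mp hΛ
    rw [Finset.mem_image]
    refine ⟨(p, j), ?_, rfl⟩
    rw [Finset.mem_product, Finset.mem_range, Nat.mem_primeFactors]
    refine ⟨⟨hp, ?_, hq⟩, ?_⟩
    · -- a prime dividing `gcd(p^j, q)` is `p`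
      rw [Nat.Coprime, ← ne_eq] at hcop
      obtain ⟨r, hr, hrdvd⟩ := Nat.ne_one_iff_exists_prime_dvd.mp hcop
      have hrp : r ∣ p ^ j := hrdvd.trans (Nat.gcd_dvd_left _ _)
      have hrq : r ∣ q := hrdvd.trans (Nat.gcd_dvd_right _ _)
      rwa [(Nat.prime_dvd_prime_iff_eq hr hp).mp (hr.dvd_of_dvd_pow hrp)] at hrq
    · have h2j : 2 ^ j ≤ N := (Nat.pow_le_pow_left hp.two_le j).trans hkN
      exact Nat.lt_succ_of_le (Nat.le_log_of_pow_le (by norm_num) h2j)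
  -- each term is `≤ log q`
  have hq1 : (1 : ℝ) ≤ q := by exact_mod_cast Nat.one_le_iff_ne_zero.mpr hq
  have hlog0 : 0 ≤ Real.log q := Real.log_nonneg hq1
  have hterm : ∀ k ∈ S, Λ k ≤ Real.log q := by
    intro k hk
    have hk' := hsub hk
    rw [Finset.mem_image] at hk'
    obtain ⟨⟨p, j⟩, hpj, hpjk⟩ := hk'
    rw [Finset.mem_product, Nat.mem_primeFactors] at hpj
    obtain ⟨⟨hp, hpq, -⟩, -⟩ := hpj
    rw [← hpjk]
    rcases Nat.eq_zero_or_pos j with rfl | hj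
    · rw [pow_zero, ArithmeticFunction.vonMangoldt_apply_one]
      exact hlog0
    · rw [ArithmeticFunction.vonMangoldt_apply_pow hj.ne',
        ArithmeticFunction.vonMangoldt_apply_prime hp]
      exact Real.log_le_log (by exact_mod_cast hp.pos)
        (by exact_mod_cast Nat.le_of_dvd (Nat.pos_of_ne_zero hq) hpq)
  have hcard : S.card ≤ q.primeFactors.card * (Nat.log 2 N + 1) :=
    (Finset.card_le_card hsub).trans
      (Finset.card_image_le.trans (by rw [Finset.card_product, Finset.card_range]))
  calc ∑ k ∈ (Icc 1 N).filter (fun k => ¬ k.Coprime q), Λ k = ∑ k ∈ S, Λ k := by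
        rw [hS, Finset.sum_filter_ne_zero]
    _ ≤ ∑ k ∈ S, Real.log q := Finset.sum_le_sum hterm
    _ = S.card * Real.log q := by rw [Finset.sum_const, nsmul_eq_mul]
    _ ≤ (q.primeFactors.card * (Nat.log 2 N + 1) : ℕ) * Real.log q :=
        mul_le_mul_of_nonneg_right (by exact_mod_cast hcard) hlog0
    _ = q.primeFactors.card * (Nat.log 2 N + 1) * Real.log q := by push_cast; ring

/-- `log₂⌊2K⌋ + 1 ≤ 4 log(2K)` for `K ≥ 1` (crude). [folklore] -/
private theorem natLog_two_floor_add_one_le {K : ℝ} (hK : 1 ≤ K) :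
    ((Nat.log 2 ⌊2 * K⌋₊ : ℕ) : ℝ) + 1 ≤ 4 * Real.log (2 * K) := by
  set N := ⌊2 * K⌋₊ with hN
  have h2K : (2 : ℝ) ≤ 2 * K := by linarith
  have hN2 : 2 ≤ N := by
    rw [hN]; exact Nat.le_floor (by exact_mod_cast h2K)
  have hN0 : N ≠ 0 := by omega
  have hNle : (N : ℝ) ≤ 2 * K := Nat.floor_le (by linarith)
  have hlog2 : (1 / 2 : ℝ) < Real.log 2 := by
    have := Real.log_two_gt_d9; linarith
  have hlogK : Real.log 2 ≤ Real.log (2 * K) := Real.log_le_log (by norm_num) h2K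
  -- `2^(log₂ N) ≤ N ≤ 2K`
  have hpow : ((2 : ℕ) ^ Nat.log 2 N : ℝ) ≤ 2 * K := by
    have := Nat.pow_log_le_self 2 hN0
    exact le_trans (by exact_mod_cast this) hNle
  have hL : (Nat.log 2 N : ℝ) * Real.log 2 ≤ Real.log (2 * K) := by
    have h := Real.log_le_log (by positivity) hpow
    simpa [Real.log_pow] using h
  nlinarith [hL, hlog2, hlogK, Nat.cast_nonneg (α := ℝ) (Nat.log 2 N)]

/-- The weight `a` at scale `K`, read as `V(x) = a(Kx)` on `[1,2]` ("we may express `a_k = V(k/K)`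
for some smooth function `V(x)` supported on `[1,2]` satisfying `‖V^{(j)}‖_∞ ≪ q^ε`", TeX l.836):
the hypotheses of Lemma 10 for `V`. [cite: BondarenkoHeap2026, §6.2, TeX l.836] -/
theorem lemma10Weight_of_isSmoothDyadicWeight {K : ℝ} (hK : 0 < K) {A : ℕ → ℝ} {Q : ℝ}
    {a : ℝ → ℂ} (ha : IsSmoothDyadicWeight K A Q a) :
    ContDiff ℝ ∞ (fun x : ℝ => a (K * x)) ∧
      (∀ x : ℝ, a (K * x) ≠ 0 → 1 ≤ x ∧ x ≤ 2) ∧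
      (∀ (j : ℕ) (x : ℝ), ‖iteratedDeriv j (fun x : ℝ => a (K * x)) x‖ ≤ A j * Q) := by
  obtain ⟨hsmooth, hsupp, -, hder⟩ := ha
  refine ⟨hsmooth.comp (contDiff_const.mul contDiff_id), fun x hx => ?_, fun j x => ?_⟩
  · obtain ⟨h1, h2⟩ := hsupp (K * x) hx
    constructor
    · exact le_of_mul_le_mul_left (by linarith : K * 1 ≤ K * x) hK
    · exact le_of_mul_le_mul_left (by linarith : K * x ≤ K * 2) hK
  · have hcd : ContDiff ℝ j a := hsmooth.of_le (by exact_mod_cast le_top)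
    rw [iteratedDeriv_comp_const_smul hcd K]
    simp only [norm_smul, norm_pow, Real.norm_eq_abs, abs_of_pos hK]
    have hKj : 0 < K ^ j := pow_pos hK j
    calc K ^ j * ‖iteratedDeriv j a (K * x)‖ ≤ K ^ j * (A j * Q / K ^ j) :=
          mul_le_mul_of_nonneg_left (hder j (K * x)) hKj.le
      _ = A j * Q := by field_simp

/-! ### §6.5: (40) from (28), Lemma 9 (32) and Lemma 10 -/

/-- **Core of (40), over raw weight data** (refactor-then-corollary for the primed weight class
of `BondarenkoHeap2026Section6Weights`, E-ah-3/G-ah-9): the Range III bound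
`‖E(K,M,R)‖ ≤ C·KM·q^{−δ/2}` for scales `K, M, R ≥ 1` with `R ≤ C₀KM/T`, `KM ≤ C₀q^{17/6}`,
`K ≥ q^{7/3+2δ/10}`, and weights of which ONLY the following is used (TeX l.998–1024,
l.1295–1306): `‖a‖, ‖b‖, ‖c‖ ≤ 1`, the windows `[M,2M] ∋ supp b`, `[R,2R] ∋ supp c` (Lemma 9 (32)
takes arbitrary bounded coefficients), and — in place of Lemma 10 itself — its OUTPUT for the
weight `V(x) = a(Kx)` at `ε = δ/8` with constant `C₁₀`:
`∑_{ψ ∉ {ψ₀,χ}} |∑_n Λ(n)ψ(n)V(n/K)| ≤ C₁₀ K q^{δ/8}`. The constant `C` depends on `δ, C₀, C₁₀`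
and Lemma 9's constant only. Both `rangeIII_bound_of_lemma9_lemma10` (unprimed class, `lemma10`)
and the primed Range III′ (`lemma10'`, sibling `…Section6WeightsProofs`) are instances.
[cite: BondarenkoHeap2026, eq. (40), TeX l.1295–1306] -/
theorem rangeIII_bound_core_of_lemma9 (h9 : lemma9_bound) :
    ∀ δ : ℝ, 0 < δ → δ < 1 / 100 → ∀ C₀ : ℝ, 0 < C₀ → ∀ C₁₀ : ℝ, 0 < C₁₀ →
    ∃ C : ℝ, 0 < C ∧ ∀ (q : ℕ) [NeZero q] (χ : DirichletCharacter ℂ q),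
      χ.IsPrimitive → χ.IsQuadratic → ∀ (K M R : ℝ), IsAdmissibleScale q δ C₀ K M R →
      InRangeIII δ q K → ∀ (s : ℤ), (s = 1 ∨ s = -1) → ∀ (a b c : ℝ → ℂ),
      (∀ x : ℝ, ‖a x‖ ≤ 1) →
      (∑ ψ ∈ (Finset.univ.filter fun ψ : DirichletCharacter ℂ q => ψ ≠ 1 ∧ ψ ≠ χ),
          ‖∑ n ∈ Icc 1 ⌊2 * K⌋₊, ((Λ n : ℝ) : ℂ) * ψ (n : ZMod q) *
            (fun x : ℝ => a (K * x)) ((n : ℝ) / K)‖ ≤ C₁₀ * K * (q : ℝ) ^ (δ / 8)) →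
      (∀ x : ℝ, b x ≠ 0 → M ≤ x ∧ x ≤ 2 * M) → (∀ x : ℝ, ‖b x‖ ≤ 1) →
      (∀ x : ℝ, c x ≠ 0 → R ≤ x ∧ x ≤ 2 * R) → (∀ x : ℝ, ‖c x‖ ≤ 1) →
      ‖corrSumE χ s K M R a b c‖ ≤ C * (K * M) * (q : ℝ) ^ (-(δ / 2)) := by
  classical
  intro δ hδ _hδ1 C₀ hC₀ C₁₀ hC₁₀
  set ε : ℝ := δ / 8 with hε
  have hε0 : 0 < ε := by positivity
  obtain ⟨C₉, hC₉, H9⟩ := h9 ε hε0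
  have h2C₀ : 0 < 2 * C₀ := by positivity
  set Cmain : ℝ := C₉ * C₁₀ * C₀ ^ 2 + 4 * C₉ * C₀ ^ 2 * ((2 * C₀) ^ ε / ε) with hCmain
  have hCmain0 : 0 < Cmain := by positivity
  set Cnc : ℝ := 16 * C₀ ^ 2 * ((2 * C₀) ^ ε / ε ^ 2) with hCnc
  have hCnc0 : 0 < Cnc := by positivity
  refine ⟨Cmain + Cnc, by positivity, ?_⟩
  intro q _ χ hχp hχq K M R hadm hrange s hs a b c ha1 hH10a hbsupp hb1 hcsupp hc1
  obtain ⟨hK1, hM1, hR1, hRle, hKMle⟩ := hadm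
  have hKlow : (q : ℝ) ^ (7 / 3 + 2 * (δ / 10)) ≤ K := hrange
  have hq1 : (1 : ℝ) ≤ q := by exact_mod_cast NeZero.one_le
  have hq0 : (0 : ℝ) < q := by positivity
  have hK0 : 0 < K := by linarith
  have hM0 : 0 < M := by linarith
  have hR0 : 0 < R := by linarith
  have hKM0 : 0 < K * M := by positivity
  have hT0 : 0 < (q : ℝ) ^ (7 / 3 + δ) := by positivity
  have htarget0 : 0 < (q : ℝ) ^ (-(δ / 2)) := by positivity
  -- `R ≤ C₀² q^{1/2−δ}` ("`R ≪ L/T = q^{1/2−δ}`")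
  have hRq : R ≤ C₀ ^ 2 * (q : ℝ) ^ (1 / 2 - δ) := by
    have h1 : R ≤ C₀ * (C₀ * (q : ℝ) ^ (17 / 6 : ℝ)) / (q : ℝ) ^ (7 / 3 + δ) :=
      hRle.trans (by gcongr)
    have h2 : (q : ℝ) ^ (17 / 6 : ℝ) / (q : ℝ) ^ (7 / 3 + δ) = (q : ℝ) ^ (1 / 2 - δ) := by
      rw [← Real.rpow_sub hq0]
      exact congrArg (fun t : ℝ => (q : ℝ) ^ t) (by ring)
    calc R ≤ C₀ * (C₀ * (q : ℝ) ^ (17 / 6 : ℝ)) / (q : ℝ) ^ (7 / 3 + δ) := h1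
      _ = C₀ ^ 2 * ((q : ℝ) ^ (17 / 6 : ℝ) / (q : ℝ) ^ (7 / 3 + δ)) := by ring
      _ = C₀ ^ 2 * (q : ℝ) ^ (1 / 2 - δ) := by rw [h2]
  have hKq : K ≤ C₀ * (q : ℝ) ^ (17 / 6 : ℝ) :=
    (le_mul_of_one_le_right hK0.le hM1).trans hKMle
  have h2K1 : (1 : ℝ) ≤ 2 * K := by linarith
  have hlog0 : 0 ≤ Real.log (2 * K) := Real.log_nonneg h2K1
  -- `log(2K) ≤ (2C₀)^ε q^{17ε/6} / ε` and `log q ≤ q^ε / ε`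
  have hlogK : Real.log (2 * K) ≤ (2 * C₀) ^ ε * (q : ℝ) ^ (17 / 6 * ε) / ε := by
    have h1 : Real.log (2 * K) ≤ (2 * K) ^ ε / ε := log_le_rpow_div h2K1 hε0
    have h2 : (2 * K) ^ ε ≤ (2 * C₀ * (q : ℝ) ^ (17 / 6 : ℝ)) ^ ε :=
      Real.rpow_le_rpow (by linarith) (by linarith [hKq]) hε0.le
    have h3 : (2 * C₀ * (q : ℝ) ^ (17 / 6 : ℝ)) ^ ε = (2 * C₀) ^ ε * (q : ℝ) ^ (17 / 6 * ε) := by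
      rw [Real.mul_rpow h2C₀.le (by positivity), ← Real.rpow_mul hq0.le]
    calc Real.log (2 * K) ≤ (2 * K) ^ ε / ε := h1
      _ ≤ (2 * C₀ * (q : ℝ) ^ (17 / 6 : ℝ)) ^ ε / ε := by gcongr
      _ = (2 * C₀) ^ ε * (q : ℝ) ^ (17 / 6 * ε) / ε := by rw [h3]
  have hlogq : Real.log q ≤ (q : ℝ) ^ ε / ε := log_le_rpow_div hq1 hε0
  -- the split `a = a' + a''` according to `(k,q) = 1`
  set a' : ℝ → ℂ := fun x => if (⌊x⌋₊).Coprime q then a x else 0 with ha'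
  set a'' : ℝ → ℂ := fun x => if (⌊x⌋₊).Coprime q then 0 else a x with ha''
  have hsplit : corrSumE χ s K M R a b c =
      corrSumE χ s K M R a' b c + corrSumE χ s K M R a'' b c :=
    corrSumE_split_coprime χ s K M R a b c
  /- (I) the terms with `(k,q) > 1` -/
  have hnc : ‖corrSumE χ s K M R a'' b c‖ ≤ Cnc * (K * M) * (q : ℝ) ^ (-(δ / 2)) := by
    have hw := norm_corrSumE_le_weighted χ s K hM0.le hR0.le a'' b c hb1 hc1
    -- `∑ ‖a''_k‖ Λ(k) ≤ ∑_{(k,q)>1} Λ(k) ≤ ω(q) (log₂⌊2K⌋+1) log q ≤ q · 4 log(2K) · log q`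
    have hS1 : ∑ k ∈ Icc 1 ⌊2 * K⌋₊, ‖a'' k‖ * Λ k ≤
        ∑ k ∈ (Icc 1 ⌊2 * K⌋₊).filter (fun k => ¬ k.Coprime q), Λ k := by
      rw [Finset.sum_filter]
      refine Finset.sum_le_sum fun k _ => ?_
      simp only [ha'', Nat.floor_natCast]
      split_ifs with h1
      · simp
      · calc ‖a k‖ * Λ k ≤ 1 * Λ k :=
              mul_le_mul_of_nonneg_right (ha1 k) ArithmeticFunction.vonMangoldt_nonneg
          _ = Λ k := one_mul _
    have hS2 := sum_vonMangoldt_not_coprime_le (NeZero.ne q) ⌊2 * K⌋₊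
    have hω : (q.primeFactors.card : ℝ) ≤ q := by
      have h1 : q.primeFactors.card ≤ q.divisors.card := by
        rw [Nat.primeFactors_eq_to_filter_divisors_prime]
        exact Finset.card_filter_le _ _
      exact_mod_cast h1.trans (Nat.card_divisors_le_self q)
    have hNlog := natLog_two_floor_add_one_le hK1
    have hlq0 : 0 ≤ Real.log q := Real.log_nonneg hq1
    have hS3 : ∑ k ∈ Icc 1 ⌊2 * K⌋₊, ‖a'' k‖ * Λ k ≤
        (q : ℝ) * (4 * Real.log (2 * K)) * Real.log q := by
      refine hS1.trans (hS2.trans ?_)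
      exact mul_le_mul_of_nonneg_right (mul_le_mul hω hNlog (by positivity) hq0.le) hlq0
    have hS4 : (q : ℝ) * (4 * Real.log (2 * K)) * Real.log q ≤
        (q : ℝ) * (4 * ((2 * C₀) ^ ε * (q : ℝ) ^ (17 / 6 * ε) / ε)) * ((q : ℝ) ^ ε / ε) :=
      mul_le_mul (mul_le_mul_of_nonneg_left (by linarith [hlogK]) hq0.le) hlogq hlq0
        (by positivity)
    -- `q · q^{17ε/6} · q^{ε} · q^{1/2−δ} ≤ q^{7/3 + δ/5} q^{−δ/2}`
    have hqpow : (q : ℝ) * (q : ℝ) ^ (17 / 6 * ε) * (q : ℝ) ^ ε * (q : ℝ) ^ (1 / 2 - δ) ≤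
        (q : ℝ) ^ (7 / 3 + 2 * (δ / 10)) * (q : ℝ) ^ (-(δ / 2)) := by
      have h1 : (q : ℝ) * (q : ℝ) ^ (17 / 6 * ε) * (q : ℝ) ^ ε * (q : ℝ) ^ (1 / 2 - δ) =
          (q : ℝ) ^ (1 + 17 / 6 * ε + ε + (1 / 2 - δ)) := by
        rw [Real.rpow_add hq0, Real.rpow_add hq0, Real.rpow_add hq0, Real.rpow_one]
      rw [h1, ← Real.rpow_add hq0]
      exact Real.rpow_le_rpow_of_exponent_le hq1 (by linarith [hε])
    have hpos16 : 0 ≤ 16 * ((2 * C₀) ^ ε / ε ^ 2) * M := by positivity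
    calc ‖corrSumE χ s K M R a'' b c‖
        ≤ (∑ k ∈ Icc 1 ⌊2 * K⌋₊, ‖a'' k‖ * Λ k) * ((2 * M) * (2 * R)) := hw
      _ ≤ ((q : ℝ) * (4 * ((2 * C₀) ^ ε * (q : ℝ) ^ (17 / 6 * ε) / ε)) * ((q : ℝ) ^ ε / ε)) *
            ((2 * M) * (2 * R)) :=
          mul_le_mul_of_nonneg_right (hS3.trans hS4) (by positivity)
      _ = 16 * ((2 * C₀) ^ ε / ε ^ 2) * M *
            ((q : ℝ) * (q : ℝ) ^ (17 / 6 * ε) * (q : ℝ) ^ ε * R) := by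
          ring
      _ ≤ 16 * ((2 * C₀) ^ ε / ε ^ 2) * M *
            ((q : ℝ) * (q : ℝ) ^ (17 / 6 * ε) * (q : ℝ) ^ ε * (C₀ ^ 2 * (q : ℝ) ^ (1 / 2 - δ))) :=
          mul_le_mul_of_nonneg_left (mul_le_mul_of_nonneg_left hRq (by positivity)) hpos16
      _ = 16 * ((2 * C₀) ^ ε / ε ^ 2) * M * C₀ ^ 2 *
            ((q : ℝ) * (q : ℝ) ^ (17 / 6 * ε) * (q : ℝ) ^ ε * (q : ℝ) ^ (1 / 2 - δ)) := by ring
      _ ≤ 16 * ((2 * C₀) ^ ε / ε ^ 2) * M * C₀ ^ 2 *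
            ((q : ℝ) ^ (7 / 3 + 2 * (δ / 10)) * (q : ℝ) ^ (-(δ / 2))) :=
          mul_le_mul_of_nonneg_left hqpow (by positivity)
      _ ≤ 16 * ((2 * C₀) ^ ε / ε ^ 2) * M * C₀ ^ 2 * (K * (q : ℝ) ^ (-(δ / 2))) :=
          mul_le_mul_of_nonneg_left (mul_le_mul_of_nonneg_right hKlow htarget0.le)
            (by positivity)
      _ = Cnc * (K * M) * (q : ℝ) ^ (-(δ / 2)) := by rw [hCnc]; ring
  /- (II) the terms with `(k,q) = 1`: (28), Lemma 9 (32), Lemma 10 -/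
  have hcp : ‖corrSumE χ s K M R a' b c‖ ≤ Cmain * (K * M) * (q : ℝ) ^ (-(δ / 2)) := by
    set b' : ℝ → ℂ := fun x => if (⌊x⌋₊).Coprime q then b x else 0 with hb'
    have hb'1 : ∀ x, ‖b' x‖ ≤ 1 := fun x => by
      simp only [hb']
      split_ifs
      · exact hb1 x
      · simp
    have hb'supp : ∀ m : ℕ, b' m ≠ 0 → (M ≤ m ∧ (m : ℝ) ≤ 2 * M) ∧ m.Coprime q := by
      intro m hm
      have hm' : m.Coprime q ∧ b m ≠ 0 := by
        simpa [hb', Nat.floor_natCast] using hm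
      exact ⟨hbsupp m hm'.2, hm'.1⟩
    have ha'1 : ∀ x, ‖a' x‖ ≤ 1 := fun x => by
      simp only [ha']
      split_ifs
      · exact ha1 x
      · simp
    have ha'cop : ∀ k : ℕ, a' k ≠ 0 → k.Coprime q := by
      intro k hk
      have hk' : k.Coprime q ∧ a k ≠ 0 := by
        simpa [ha', Nat.floor_natCast] using hk
      exact hk'.1
    have hEq : corrSumE χ s K M R a' b c = corrSumE χ s K M R a' b' c :=
      corrSumE_restrict_coprime χ s K M R a' b c
    -- (28)
    set G : DirichletCharacter ℂ q → ℂ := fun ψ => ∑ m ∈ Icc 1 ⌊2 * M⌋₊, ∑ r ∈ Icc 1 ⌊2 * R⌋₊,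
      b' m * c r * genJacobiSum χ ψ (((s * r : ℤ) : ZMod q) * (m : ZMod q)⁻¹) with hG
    set H : DirichletCharacter ℂ q → ℂ := fun ψ =>
      ∑ k ∈ Icc 1 ⌊2 * K⌋₊, a' k * ((Λ k : ℝ) : ℂ) * ψ (k : ZMod q) with hH
    have h28 : corrSumE χ s K M R a' b' c = (q.totient : ℂ)⁻¹ * ∑ ψ, G ψ * H ψ :=
      corrSumE_eq_sum_characters χ hχq s K M R a' b' c ha'cop (fun m hm => (hb'supp m hm).2)
    -- Lemma 9 (32), per character
    have hG9 : ∀ ψ : DirichletCharacter ℂ q, (q.totient : ℝ)⁻¹ * ‖G ψ‖ ≤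
        C₉ * (q : ℝ) ^ ε * (R * M) *
          (if ψ = 1 ∨ ψ = χ then (q : ℝ)⁻¹ else ((q : ℝ) ^ (1 / 2 : ℝ))⁻¹) := by
      intro ψ
      have hGeq : G ψ = ∑ r ∈ Icc 1 ⌊2 * R⌋₊, ∑ m ∈ Icc 1 ⌊2 * M⌋₊,
          c r * b' m * genJacobiSum χ ψ (((s * r : ℤ) : ZMod q) * (m : ZMod q)⁻¹) := by
        simp only [hG]
        rw [Finset.sum_comm]
        exact Finset.sum_congr rfl fun r _ => Finset.sum_congr rfl fun m _ => by ring
      rw [hGeq]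
      exact H9 q χ hχp hχq ψ R M hR1 hM1 s hs (fun m => b' m) (fun r => c r) (fun m => hb'1 m)
        (fun r => hc1 r) hb'supp (fun r hr => hcsupp r hr)
    -- trivial bound for `H ψ`
    have hHtriv : ∀ ψ : DirichletCharacter ℂ q, ‖H ψ‖ ≤ 2 * K * Real.log (2 * K) := by
      intro ψ
      calc ‖H ψ‖ ≤ ∑ k ∈ Icc 1 ⌊2 * K⌋₊, ‖a' k‖ * Λ k := by
            simp only [hH]
            refine (norm_sum_le _ _).trans (Finset.sum_le_sum fun k _ => ?_)
            rw [norm_mul, norm_mul, Complex.norm_real, Real.norm_eq_abs,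
              abs_of_nonneg ArithmeticFunction.vonMangoldt_nonneg]
            calc ‖a' k‖ * Λ k * ‖ψ (k : ZMod q)‖ ≤ ‖a' k‖ * Λ k * 1 :=
                  mul_le_mul_of_nonneg_left (ψ.norm_le_one _)
                    (mul_nonneg (norm_nonneg _) ArithmeticFunction.vonMangoldt_nonneg)
              _ = ‖a' k‖ * Λ k := mul_one _
        _ ≤ 2 * K * Real.log (2 * K) := sum_norm_weight_vonMangoldt_le hK1 a' ha'1
    -- Lemma 10 for the non-exceptional characters, with `V(x) = a(Kx)`
    have hH10 : ∑ ψ ∈ Finset.univ.filter (fun ψ : DirichletCharacter ℂ q => ψ ≠ 1 ∧ ψ ≠ χ),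
        ‖H ψ‖ ≤ C₁₀ * K * (q : ℝ) ^ ε := by
      have h := hH10a
      have hHV : ∀ ψ : DirichletCharacter ℂ q, H ψ = ∑ n ∈ Icc 1 ⌊2 * K⌋₊,
          ((Λ n : ℝ) : ℂ) * ψ (n : ZMod q) * (fun x : ℝ => a (K * x)) ((n : ℝ) / K) := by
        intro ψ
        simp only [hH]
        refine Finset.sum_congr rfl fun k _ => ?_
        have hKk : K * ((k : ℝ) / K) = k := mul_div_cancel₀ _ hK0.ne'
        rw [hKk]
        by_cases hk : k.Coprime q
        · have : a' k = a k := by simp [ha', Nat.floor_natCast, hk]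
          rw [this]; ring
        · have hψ0 : ψ (k : ZMod q) = 0 :=
            ψ.map_nonunit (mt (ZMod.isUnit_iff_coprime k q).mp hk)
          have : a' k = 0 := by simp [ha', Nat.floor_natCast, hk]
          rw [this, hψ0]; ring
      simp_rw [hHV]
      exact h
    -- split the character sum into `ψ ∉ {ψ₀, χ}` and `ψ ∈ {ψ₀, χ}`
    have hcard : ((Finset.univ.filter
        (fun ψ : DirichletCharacter ℂ q => ¬ (ψ ≠ 1 ∧ ψ ≠ χ))).card : ℝ) ≤ 2 := by
      have hsub : Finset.univ.filter (fun ψ : DirichletCharacter ℂ q => ¬ (ψ ≠ 1 ∧ ψ ≠ χ)) ⊆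
          {1, χ} := by
        intro ψ hψ
        rw [Finset.mem_filter] at hψ
        rw [Finset.mem_insert, Finset.mem_singleton]
        tauto
      exact_mod_cast (Finset.card_le_card hsub).trans Finset.card_le_two
    have hF : ∑ ψ ∈ Finset.univ.filter (fun ψ : DirichletCharacter ℂ q => ψ ≠ 1 ∧ ψ ≠ χ),
        (q.totient : ℝ)⁻¹ * ‖G ψ‖ * ‖H ψ‖ ≤
        (C₉ * (q : ℝ) ^ ε * (R * M) * ((q : ℝ) ^ (1 / 2 : ℝ))⁻¹) * (C₁₀ * K * (q : ℝ) ^ ε) := by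
      calc ∑ ψ ∈ Finset.univ.filter (fun ψ : DirichletCharacter ℂ q => ψ ≠ 1 ∧ ψ ≠ χ),
            (q.totient : ℝ)⁻¹ * ‖G ψ‖ * ‖H ψ‖
          ≤ ∑ ψ ∈ Finset.univ.filter (fun ψ : DirichletCharacter ℂ q => ψ ≠ 1 ∧ ψ ≠ χ),
            (C₉ * (q : ℝ) ^ ε * (R * M) * ((q : ℝ) ^ (1 / 2 : ℝ))⁻¹) * ‖H ψ‖ := by
            refine Finset.sum_le_sum fun ψ hψ => ?_
            have hP : ψ ≠ 1 ∧ ψ ≠ χ := (Finset.mem_filter.mp hψ).2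
            have hnot : ¬ (ψ = 1 ∨ ψ = χ) := fun h => h.elim hP.1 hP.2
            have h9 := hG9 ψ
            rw [if_neg hnot] at h9
            exact mul_le_mul_of_nonneg_right h9 (norm_nonneg _)
        _ = (C₉ * (q : ℝ) ^ ε * (R * M) * ((q : ℝ) ^ (1 / 2 : ℝ))⁻¹) *
            ∑ ψ ∈ Finset.univ.filter (fun ψ : DirichletCharacter ℂ q => ψ ≠ 1 ∧ ψ ≠ χ),
              ‖H ψ‖ := by rw [Finset.mul_sum]
        _ ≤ (C₉ * (q : ℝ) ^ ε * (R * M) * ((q : ℝ) ^ (1 / 2 : ℝ))⁻¹) * (C₁₀ * K * (q : ℝ) ^ ε) :=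
            mul_le_mul_of_nonneg_left hH10 (by positivity)
    have hnF : ∑ ψ ∈ Finset.univ.filter (fun ψ : DirichletCharacter ℂ q => ¬ (ψ ≠ 1 ∧ ψ ≠ χ)),
        (q.totient : ℝ)⁻¹ * ‖G ψ‖ * ‖H ψ‖ ≤
        2 * ((C₉ * (q : ℝ) ^ ε * (R * M) * (q : ℝ)⁻¹) * (2 * K * Real.log (2 * K))) := by
      have hT0 : 0 ≤ (C₉ * (q : ℝ) ^ ε * (R * M) * (q : ℝ)⁻¹) * (2 * K * Real.log (2 * K)) := by
        positivity
      calc ∑ ψ ∈ Finset.univ.filter (fun ψ : DirichletCharacter ℂ q => ¬ (ψ ≠ 1 ∧ ψ ≠ χ)),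
            (q.totient : ℝ)⁻¹ * ‖G ψ‖ * ‖H ψ‖
          ≤ ∑ ψ ∈ Finset.univ.filter (fun ψ : DirichletCharacter ℂ q => ¬ (ψ ≠ 1 ∧ ψ ≠ χ)),
            (C₉ * (q : ℝ) ^ ε * (R * M) * (q : ℝ)⁻¹) * (2 * K * Real.log (2 * K)) := by
            refine Finset.sum_le_sum fun ψ hψ => ?_
            have hP : ¬ (ψ ≠ 1 ∧ ψ ≠ χ) := (Finset.mem_filter.mp hψ).2
            have hor : ψ = 1 ∨ ψ = χ := by
              by_cases h1 : ψ = 1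
              · exact Or.inl h1
              · by_cases h2 : ψ = χ
                · exact Or.inr h2
                · exact absurd ⟨h1, h2⟩ hP
            have h9 := hG9 ψ
            rw [if_pos hor] at h9
            exact mul_le_mul h9 (hHtriv ψ) (norm_nonneg _) (by positivity)
        _ = ((Finset.univ.filter
              (fun ψ : DirichletCharacter ℂ q => ¬ (ψ ≠ 1 ∧ ψ ≠ χ))).card : ℝ) *
            ((C₉ * (q : ℝ) ^ ε * (R * M) * (q : ℝ)⁻¹) * (2 * K * Real.log (2 * K))) := by
            rw [Finset.sum_const, nsmul_eq_mul]
        _ ≤ 2 * ((C₉ * (q : ℝ) ^ ε * (R * M) * (q : ℝ)⁻¹) * (2 * K * Real.log (2 * K))) :=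
            mul_le_mul_of_nonneg_right hcard hT0
    -- `‖E(a', b, c)‖ ≤ ∑_ψ (1/φ(q)) |G_ψ| |H_ψ|`
    have hEsum : ‖corrSumE χ s K M R a' b c‖ ≤
        ∑ ψ : DirichletCharacter ℂ q, (q.totient : ℝ)⁻¹ * ‖G ψ‖ * ‖H ψ‖ := by
      rw [hEq, h28, norm_mul, norm_inv, Complex.norm_natCast]
      calc (q.totient : ℝ)⁻¹ * ‖∑ ψ : DirichletCharacter ℂ q, G ψ * H ψ‖
          ≤ (q.totient : ℝ)⁻¹ * ∑ ψ : DirichletCharacter ℂ q, ‖G ψ‖ * ‖H ψ‖ :=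
            mul_le_mul_of_nonneg_left ((norm_sum_le _ _).trans
              (le_of_eq (Finset.sum_congr rfl fun ψ _ => norm_mul _ _))) (by positivity)
        _ = ∑ ψ : DirichletCharacter ℂ q, (q.totient : ℝ)⁻¹ * ‖G ψ‖ * ‖H ψ‖ := by
            rw [Finset.mul_sum]
            exact Finset.sum_congr rfl fun ψ _ => by ring
    -- numerics: the two terms are `≤ const · KM · q^{−δ/2}`
    have hnum1 : (C₉ * (q : ℝ) ^ ε * (R * M) * ((q : ℝ) ^ (1 / 2 : ℝ))⁻¹) * (C₁₀ * K * (q : ℝ) ^ ε)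
        ≤ C₉ * C₁₀ * C₀ ^ 2 * (K * M) * (q : ℝ) ^ (-(δ / 2)) := by
      have h1 : (q : ℝ) ^ ε * (q : ℝ) ^ ε * ((q : ℝ) ^ (1 / 2 : ℝ))⁻¹ * (q : ℝ) ^ (1 / 2 - δ) ≤
          (q : ℝ) ^ (-(δ / 2)) := by
        rw [← Real.rpow_neg hq0.le, ← Real.rpow_add hq0, ← Real.rpow_add hq0, ← Real.rpow_add hq0]
        exact Real.rpow_le_rpow_of_exponent_le hq1 (by linarith [hε])
      have hpos : 0 ≤ C₉ * C₁₀ * (K * M) := by positivity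
      calc (C₉ * (q : ℝ) ^ ε * (R * M) * ((q : ℝ) ^ (1 / 2 : ℝ))⁻¹) * (C₁₀ * K * (q : ℝ) ^ ε)
          = C₉ * C₁₀ * (K * M) * ((q : ℝ) ^ ε * (q : ℝ) ^ ε * ((q : ℝ) ^ (1 / 2 : ℝ))⁻¹ * R) := by
            ring
        _ ≤ C₉ * C₁₀ * (K * M) *
            ((q : ℝ) ^ ε * (q : ℝ) ^ ε * ((q : ℝ) ^ (1 / 2 : ℝ))⁻¹ * (C₀ ^ 2 * (q : ℝ) ^ (1 / 2 - δ))) :=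
            mul_le_mul_of_nonneg_left (mul_le_mul_of_nonneg_left hRq (by positivity)) hpos
        _ = C₉ * C₁₀ * C₀ ^ 2 * (K * M) *
            ((q : ℝ) ^ ε * (q : ℝ) ^ ε * ((q : ℝ) ^ (1 / 2 : ℝ))⁻¹ * (q : ℝ) ^ (1 / 2 - δ)) := by ring
        _ ≤ C₉ * C₁₀ * C₀ ^ 2 * (K * M) * (q : ℝ) ^ (-(δ / 2)) :=
            mul_le_mul_of_nonneg_left h1 (by positivity)
    have hnum2 : 2 * ((C₉ * (q : ℝ) ^ ε * (R * M) * (q : ℝ)⁻¹) * (2 * K * Real.log (2 * K))) ≤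
        4 * C₉ * C₀ ^ 2 * ((2 * C₀) ^ ε / ε) * (K * M) * (q : ℝ) ^ (-(δ / 2)) := by
      have h1 : (q : ℝ) ^ ε * (q : ℝ)⁻¹ * (q : ℝ) ^ (1 / 2 - δ) * (q : ℝ) ^ (17 / 6 * ε) ≤
          (q : ℝ) ^ (-(δ / 2)) := by
        rw [← Real.rpow_neg_one (q : ℝ), ← Real.rpow_add hq0, ← Real.rpow_add hq0,
          ← Real.rpow_add hq0]
        exact Real.rpow_le_rpow_of_exponent_le hq1 (by linarith [hε])
      have hpos : 0 ≤ 4 * C₉ * (K * M) := by positivity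
      calc 2 * ((C₉ * (q : ℝ) ^ ε * (R * M) * (q : ℝ)⁻¹) * (2 * K * Real.log (2 * K)))
          = 4 * C₉ * (K * M) * ((q : ℝ) ^ ε * (q : ℝ)⁻¹ * R * Real.log (2 * K)) := by ring
        _ ≤ 4 * C₉ * (K * M) * ((q : ℝ) ^ ε * (q : ℝ)⁻¹ * (C₀ ^ 2 * (q : ℝ) ^ (1 / 2 - δ)) *
              ((2 * C₀) ^ ε * (q : ℝ) ^ (17 / 6 * ε) / ε)) :=
            mul_le_mul_of_nonneg_left
              (mul_le_mul (mul_le_mul_of_nonneg_left hRq (by positivity)) hlogK hlog0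
                (by positivity)) hpos
        _ = 4 * C₉ * C₀ ^ 2 * ((2 * C₀) ^ ε / ε) * (K * M) *
              ((q : ℝ) ^ ε * (q : ℝ)⁻¹ * (q : ℝ) ^ (1 / 2 - δ) * (q : ℝ) ^ (17 / 6 * ε)) := by
            ring
        _ ≤ 4 * C₉ * C₀ ^ 2 * ((2 * C₀) ^ ε / ε) * (K * M) * (q : ℝ) ^ (-(δ / 2)) :=
            mul_le_mul_of_nonneg_left h1 (by positivity)
    calc ‖corrSumE χ s K M R a' b c‖
        ≤ ∑ ψ : DirichletCharacter ℂ q, (q.totient : ℝ)⁻¹ * ‖G ψ‖ * ‖H ψ‖ := hEsum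
      _ = (∑ ψ ∈ Finset.univ.filter (fun ψ : DirichletCharacter ℂ q => ψ ≠ 1 ∧ ψ ≠ χ),
            (q.totient : ℝ)⁻¹ * ‖G ψ‖ * ‖H ψ‖) +
          ∑ ψ ∈ Finset.univ.filter (fun ψ : DirichletCharacter ℂ q => ¬ (ψ ≠ 1 ∧ ψ ≠ χ)),
            (q.totient : ℝ)⁻¹ * ‖G ψ‖ * ‖H ψ‖ :=
          (Finset.sum_filter_add_sum_filter_not _ _ _).symm
      _ ≤ C₉ * C₁₀ * C₀ ^ 2 * (K * M) * (q : ℝ) ^ (-(δ / 2)) +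
          4 * C₉ * C₀ ^ 2 * ((2 * C₀) ^ ε / ε) * (K * M) * (q : ℝ) ^ (-(δ / 2)) :=
          add_le_add (hF.trans hnum1) (hnF.trans hnum2)
      _ = Cmain * (K * M) * (q : ℝ) ^ (-(δ / 2)) := by rw [hCmain]; ring
  -- conclusion
  calc ‖corrSumE χ s K M R a b c‖
      = ‖corrSumE χ s K M R a' b c + corrSumE χ s K M R a'' b c‖ := by rw [hsplit]
    _ ≤ ‖corrSumE χ s K M R a' b c‖ + ‖corrSumE χ s K M R a'' b c‖ := norm_add_le _ _
    _ ≤ Cmain * (K * M) * (q : ℝ) ^ (-(δ / 2)) + Cnc * (K * M) * (q : ℝ) ^ (-(δ / 2)) :=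
        add_le_add hcp hnc
    _ = (Cmain + Cnc) * (K * M) * (q : ℝ) ^ (-(δ / 2)) := by ring

/-- **(40) from Lemmas 9, 10 and (28)** (TeX l.998–1024, l.1295–1306): "If `(k, q) > 1` then we
must have `k = p^j` for some prime `p | q` … bounding trivially, the contribution from `(k,q) > 1`
is … `≪ q^{−1}` in this range … Combining Lemmas 9 and 10 in (28), and bounding the sum over `k`
trivially when `ψ = ψ₀` or `χ`, gives (40) `E(K,M,R)/KM ≪ (1/KM)·q^ε RMK/q^{1/2} ≪ q^{−δ/2}`."
PROVED: the named fact `rangeIII_bound` follows from the named facts `lemma9_bound` (32) and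
`lemma10` via the proved identity (28) `corrSumE_eq_sum_characters` (`ε = δ/8`).
[cite: BondarenkoHeap2026, eq. (40), TeX l.1295–1306] -/
theorem rangeIII_bound_of_lemma9_lemma10 (h9 : lemma9_bound) (h10 : lemma10) :
    rangeIII_bound := by
  intro δ hδ hδ1 C₀ hC₀ A
  have hη0 : 0 < δ / 10 := by positivity
  have hε0 : 0 < δ / 8 := by positivity
  obtain ⟨ε₁, hε₁, H10A⟩ := h10 (δ / 10) hη0 (δ / 8) hε0
  obtain ⟨C₁₀, hC₁₀, H10⟩ := H10A A
  obtain ⟨C, hC, H⟩ := rangeIII_bound_core_of_lemma9 h9 δ hδ hδ1 C₀ hC₀ C₁₀ hC₁₀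
  refine ⟨ε₁, hε₁, C, hC, ?_⟩
  intro q _ χ hχp hχq K M R hadm hrange s hs a b c ha hb hc
  have hK0 : 0 < K := by linarith [hadm.1]
  obtain ⟨hVs, hVsupp, hVder⟩ := lemma10Weight_of_isSmoothDyadicWeight hK0 ha
  exact H q χ hχp hχq K M R hadm hrange s hs a b c ha.2.2.1
    (H10 q χ hχp hχq K hrange (fun x => a (K * x)) hVs hVsupp hVder) hb.2.1 hb.2.2.1 hc.2.1
    hc.2.2.1


/-! ### §6.3: (23) from Lemma 4 and (16) -/

open MeasureTheory in
/-- **Core of the `‖·‖_BV` bound, over raw first-derivative data** (refactor-then-corollary for the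
primed weight class of `BondarenkoHeap2026Section6Weights`, E-ah-3): a `C^∞` weight supported in
`[M, 2M]` (`M > 0`) with `‖b‖ ≤ 1` and `‖b′‖ ≤ D/M` has `‖b‖_BV ≤ 1 + D`. Only the orders `j ≤ 1`
of any derivative family are used. [cite: BondarenkoHeap2026, §4 p. 10 and §6.2 l.834] -/
theorem bvNorm_le_of_deriv_bound {M : ℝ} (hM : 0 < M) {D : ℝ} {b : ℝ → ℂ}
    (hsmooth : ContDiff ℝ ∞ b) (hsupp : ∀ x : ℝ, b x ≠ 0 → M ≤ x ∧ x ≤ 2 * M)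
    (hbd : ∀ x : ℝ, ‖b x‖ ≤ 1) (hder1 : ∀ x : ℝ, ‖deriv b x‖ ≤ D / M) : bvNorm b ≤ 1 + D := by
  have hcs : HasCompactSupport b := by
    refine HasCompactSupport.intro isCompact_Icc (K := Set.Icc M (2 * M)) fun x hx => ?_
    by_contra hne
    exact hx (hsupp x hne)
  have hdc : Continuous (deriv b) := hsmooth.continuous_deriv (by simp)
  have hcsd : HasCompactSupport (deriv b) := hcs.deriv
  have hint : Integrable (fun y => ‖deriv b y‖) := (hdc.integrable_of_hasCompactSupport hcsd).norm
  -- sup part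
  have hsup : (⨆ x : ℝ, ‖b x‖) ≤ 1 := ciSup_le fun x => hbd x
  -- pointwise bound for the derivative by an indicator
  have hptw : ∀ x : ℝ, ‖deriv b x‖ ≤ (Set.Icc M (2 * M)).indicator (fun _ => D / M) x := by
    intro x
    by_cases hx : x ∈ Set.Icc M (2 * M)
    · rw [Set.indicator_of_mem hx]
      exact hder1 x
    · rw [Set.indicator_of_notMem hx]
      have hx' : x < M ∨ 2 * M < x := by
        rw [Set.mem_Icc, not_and_or, not_le, not_le] at hx
        exact hx
      have hev : b =ᶠ[nhds x] fun _ => (0 : ℂ) := by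
        rcases hx' with h | h
        · filter_upwards [Iio_mem_nhds h] with y hy
          by_contra hne
          exact absurd (hsupp y hne).1 (not_le.mpr hy)
        · filter_upwards [Ioi_mem_nhds h] with y hy
          by_contra hne
          exact absurd (hsupp y hne).2 (not_le.mpr hy)
      rw [hev.deriv_eq, deriv_const, norm_zero]
  have hindInt : Integrable ((Set.Icc M (2 * M)).indicator fun _ : ℝ => D / M) := by
    apply (integrable_indicator_iff measurableSet_Icc).mpr
    exact integrableOn_const (by rw [Real.volume_Icc]; exact ENNReal.ofReal_ne_top)
  have hI : ∫ y, ‖deriv b y‖ ≤ ∫ y, (Set.Icc M (2 * M)).indicator (fun _ : ℝ => D / M) y :=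
    integral_mono hint hindInt hptw
  have hI2 : ∫ y, (Set.Icc M (2 * M)).indicator (fun _ : ℝ => D / M) y = D := by
    rw [integral_indicator measurableSet_Icc, setIntegral_const,
      Real.volume_real_Icc_of_le (by linarith), smul_eq_mul]
    field_simp
    ring
  unfold bvNorm
  linarith [hI.trans hI2.le]

/-- A smooth dyadic weight at scale `M > 0` with loss `Q` has `‖b‖_BV ≤ 1 + A₁ Q`
(`‖b‖_∞ ≤ 1` and `∫ |b′| ≤ (2M − M) · A₁ Q / M`); corollary of `bvNorm_le_of_deriv_bound`.
[cite: BondarenkoHeap2026, §4 p. 10 and §6.2 l.834] -/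
theorem bvNorm_le_of_isSmoothDyadicWeight {M : ℝ} (hM : 0 < M) {A : ℕ → ℝ} {Q : ℝ}
    {b : ℝ → ℂ} (hb : IsSmoothDyadicWeight M A Q b) : bvNorm b ≤ 1 + A 1 * Q := by
  obtain ⟨hsmooth, hsupp, hbd, hder⟩ := hb
  refine bvNorm_le_of_deriv_bound hM hsmooth hsupp hbd fun x => ?_
  have h1 := hder 1 x
  rw [iteratedDeriv_one, pow_one] at h1
  exact h1

/-- Reindexing the `gcd`-sums of (16) from `1 ≤ r ≤ N` (naturals) into `0 < |r| ≤ N` (integers).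
[cite: BondarenkoHeap2026, §4 (16)] -/
theorem sum_Icc_gcd_rpow_le_sum_erase (N Q : ℕ) (α : ℝ) :
    ∑ r ∈ Icc 1 N, (((Int.gcd (r : ℤ) (Q : ℤ) : ℕ) : ℝ)) ^ α ≤
      ∑ r ∈ (Icc (-(N : ℤ)) N).erase 0, (((Int.gcd r (Q : ℤ) : ℕ) : ℝ)) ^ α := by
  classical
  have hinj : Set.InjOn (fun r : ℕ => (r : ℤ)) (Icc 1 N : Finset ℕ) := by
    intro x _ y _ h
    have h' : (x : ℤ) = y := h
    exact_mod_cast h'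
  rw [← Finset.sum_image (f := fun r : ℤ => (((Int.gcd r (Q : ℤ) : ℕ) : ℝ)) ^ α) hinj]
  refine Finset.sum_le_sum_of_subset_of_nonneg ?_ fun r _ _ => Real.rpow_nonneg (Nat.cast_nonneg _) _
  intro r hr
  rw [Finset.mem_image] at hr
  obtain ⟨n, hn, rfl⟩ := hr
  rw [Finset.mem_Icc] at hn
  rw [Finset.mem_erase, Finset.mem_Icc]
  refine ⟨by exact_mod_cast (by omega : n ≠ 0), by omega, by exact_mod_cast hn.2⟩

/-- `(s r, Q) = (r, Q)` for `s = ±1`. [folklore] -/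
private theorem int_gcd_sign_mul {s : ℤ} (hs : s = 1 ∨ s = -1) (r : ℕ) (Q : ℕ) :
    Int.gcd (s * r) Q = Int.gcd (r : ℤ) Q := by
  rcases hs with rfl | rfl
  · rw [one_mul]
  · rw [neg_one_mul, Int.neg_gcd]

/-! ### (23) from Lemma 4 and (16) -/

set_option maxHeartbeats 400000 in
/-- **(23) from Lemma 4 and (16)** (TeX l.864–878): "Applying Lemma 4 to the sum over `m`, (16)
for the sum over `r` and estimating the sum over `k` trivially we have
`E(K,M,R)/KM ≪ (1/KM)·q^ε KR(M/q + √q) ≪ q^ε(R/q + K√q/T)` using `R ≪ KM/T` for the second term.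
Then since `R ≪ L/T = q^{1/2−δ}` always and `K ≪ Tq^{−1/2−η}` in this range, we acquire (23)
`E(K,M,R)/KM ≪ q^{−η/2}`." PROVED: the named fact `rangeI_bound` follows from the named fact
`lemma4` (sibling `…Sections3to5`, itself a theorem modulo (14)) and the PROVED (16)
(`eq16_holds`); the `BV` hypothesis of Lemma 4 for the dyadic weight `b` is
`bvNorm_le_of_isSmoothDyadicWeight` (`ε = η/16`, loss exponent = Lemma 4's `δ`). CORE FORM over
raw weight data (v8, refactor-then-corollary for the primed class of `…Section6Weights`, E-ah-3):
only `‖a‖, ‖c‖ ≤ 1`, `b ∈ C^∞` supported in `[M,2M]`, `‖b‖ ≤ 1`, `‖b′‖ ≤ A₁ q^{ε₁}/M` are used.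
[cite: BondarenkoHeap2026, eq. (23), TeX l.864–878] -/
theorem rangeI_bound_core_of_lemma4 (h4 : lemma4) :
    ∀ δ : ℝ, 0 < δ → δ < 1 / 100 → ∀ C₀ : ℝ, 0 < C₀ → ∀ A1 : ℝ, ∃ ε₁ : ℝ, 0 < ε₁ ∧ ∃ C : ℝ, 0 < C ∧
      ∀ (q : ℕ) [NeZero q] (χ : DirichletCharacter ℂ q), χ.IsPrimitive → χ.IsQuadratic →
      ∀ (K M R : ℝ), IsAdmissibleScale q δ C₀ K M R → InRangeI δ q K →
      ∀ (s : ℤ), (s = 1 ∨ s = -1) → ∀ (a b c : ℝ → ℂ),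
        (∀ x : ℝ, ‖a x‖ ≤ 1) → ContDiff ℝ ∞ b → (∀ x : ℝ, b x ≠ 0 → M ≤ x ∧ x ≤ 2 * M) →
        (∀ x : ℝ, ‖b x‖ ≤ 1) → (∀ x : ℝ, ‖deriv b x‖ ≤ A1 * (q : ℝ) ^ ε₁ / M) →
        (∀ x : ℝ, ‖c x‖ ≤ 1) →
        ‖corrSumE χ s K M R a b c‖ ≤ C * (K * M) * (q : ℝ) ^ (-(δ / 10 / 2)) := by
  classical
  intro δ hδ _hδ1 C₀ hC₀ A1
  have hη0 : 0 < δ / 10 := by positivity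
  set ε : ℝ := δ / 10 / 16 with hε
  have hε0 : 0 < ε := by positivity
  set A₄ : ℝ := max 2 (1 + |A1|) with hA₄
  have hA₄2 : 2 ≤ A₄ := le_max_left _ _
  have hA₄1 : 1 ≤ A₄ := by linarith
  have hA₄' : 1 + |A1| ≤ A₄ := le_max_right _ _
  obtain ⟨δ₄, hδ₄, C₄, hC₄, H4⟩ := h4 ε hε0 A₄ hA₄1
  obtain ⟨C₁₆, hC₁₆, H16⟩ := eq16_holds ε hε0
  have h2C₀ : 0 < 2 * C₀ := by positivity
  set D : ℝ := 4 * C₄ * C₁₆ * ((2 * C₀) ^ ε / ε) * (C₀ ^ 2 + C₀) with hD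
  have hD0 : 0 < D := by positivity
  refine ⟨δ₄, hδ₄, D, hD0, ?_⟩
  intro q _ χ hχp hχq K M R hadm hrange s hs a b c ha1 hb0 hbsup hb1 hbder hc1
  obtain ⟨hK1, hM1, hR1, hRle, hKMle⟩ := hadm
  have hKup : K ≤ (q : ℝ) ^ (7 / 3 + δ) * (q : ℝ) ^ (-(1 / 2 + δ / 10)) := hrange
  have hq1 : (1 : ℝ) ≤ q := by exact_mod_cast NeZero.one_le
  have hq0 : (0 : ℝ) < q := by positivity
  have hK0 : 0 < K := by linarith
  have hM0 : 0 < M := by linarith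
  have hR0 : 0 < R := by linarith
  have hKM0 : 0 < K * M := by positivity
  have hT0 : 0 < (q : ℝ) ^ (7 / 3 + δ) := by positivity
  -- `R ≤ C₀² q^{1/2−δ}`
  have hRq : R ≤ C₀ ^ 2 * (q : ℝ) ^ (1 / 2 - δ) := by
    have h1 : R ≤ C₀ * (C₀ * (q : ℝ) ^ (17 / 6 : ℝ)) / (q : ℝ) ^ (7 / 3 + δ) :=
      hRle.trans (by gcongr)
    have h2 : (q : ℝ) ^ (17 / 6 : ℝ) / (q : ℝ) ^ (7 / 3 + δ) = (q : ℝ) ^ (1 / 2 - δ) := by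
      rw [← Real.rpow_sub hq0]
      exact congrArg (fun t : ℝ => (q : ℝ) ^ t) (by ring)
    calc R ≤ C₀ * (C₀ * (q : ℝ) ^ (17 / 6 : ℝ)) / (q : ℝ) ^ (7 / 3 + δ) := h1
      _ = C₀ ^ 2 * ((q : ℝ) ^ (17 / 6 : ℝ) / (q : ℝ) ^ (7 / 3 + δ)) := by ring
      _ = C₀ ^ 2 * (q : ℝ) ^ (1 / 2 - δ) := by rw [h2]
  have hKq : K ≤ C₀ * (q : ℝ) ^ (17 / 6 : ℝ) :=
    (le_mul_of_one_le_right hK0.le hM1).trans hKMle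
  have h2K1 : (1 : ℝ) ≤ 2 * K := by linarith
  have hlog0 : 0 ≤ Real.log (2 * K) := Real.log_nonneg h2K1
  have hlogK : Real.log (2 * K) ≤ (2 * C₀) ^ ε * (q : ℝ) ^ (17 / 6 * ε) / ε := by
    have h1 : Real.log (2 * K) ≤ (2 * K) ^ ε / ε := log_le_rpow_div h2K1 hε0
    have h2 : (2 * K) ^ ε ≤ (2 * C₀ * (q : ℝ) ^ (17 / 6 : ℝ)) ^ ε :=
      Real.rpow_le_rpow (by linarith) (by linarith [hKq]) hε0.le
    have h3 : (2 * C₀ * (q : ℝ) ^ (17 / 6 : ℝ)) ^ ε = (2 * C₀) ^ ε * (q : ℝ) ^ (17 / 6 * ε) := by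
      rw [Real.mul_rpow h2C₀.le (by positivity), ← Real.rpow_mul hq0.le]
    calc Real.log (2 * K) ≤ (2 * K) ^ ε / ε := h1
      _ ≤ (2 * C₀ * (q : ℝ) ^ (17 / 6 : ℝ)) ^ ε / ε := by gcongr
      _ = (2 * C₀) ^ ε * (q : ℝ) ^ (17 / 6 * ε) / ε := by rw [h3]
  -- `q = 2^ν Q` with `Q` odd
  obtain ⟨ν, Q, hQodd, hq2Q⟩ := Nat.exists_eq_two_pow_mul_odd (NeZero.ne q)
  have hQdvd : Q ∣ q := ⟨2 ^ ν, by rw [hq2Q]; ring⟩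
  -- Lemma 4 hypotheses for `b`
  have hbv : bvNorm b ≤ A₄ * (q : ℝ) ^ δ₄ := by
    have h1 := bvNorm_le_of_deriv_bound hM0 hb0 hbsup hb1 hbder
    have hq' : 1 ≤ (q : ℝ) ^ δ₄ := Real.one_le_rpow hq1 hδ₄.le
    have hq'0 : 0 ≤ (q : ℝ) ^ δ₄ := by positivity
    calc bvNorm b ≤ 1 + A1 * (q : ℝ) ^ δ₄ := h1
      _ ≤ 1 * (q : ℝ) ^ δ₄ + |A1| * (q : ℝ) ^ δ₄ :=
          add_le_add (by linarith) (mul_le_mul_of_nonneg_right (le_abs_self _) hq'0)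
      _ = (1 + |A1|) * (q : ℝ) ^ δ₄ := by ring
      _ ≤ A₄ * (q : ℝ) ^ δ₄ := mul_le_mul_of_nonneg_right hA₄' hq'0
  have hbsupp : Function.support b ⊆ Set.Icc (M / A₄) (A₄ * M) := by
    intro x hx
    obtain ⟨h1, h2⟩ := hbsup x hx
    have h3 : M / A₄ ≤ M := div_le_self hM0.le hA₄1
    constructor
    · linarith
    · nlinarith
  -- the inner `m`-sums, by Lemma 4
  have hinner : ∀ k ∈ Icc 1 ⌊2 * K⌋₊, ∀ r ∈ Icc 1 ⌊2 * R⌋₊,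
      ‖∑ m ∈ Icc 1 ⌊2 * M⌋₊, b m * (χ (m : ZMod q) * χ (((k : ℤ) * m + s * r : ℤ) : ZMod q))‖ ≤
        C₄ * (q : ℝ) ^ ε * (M * (Int.gcd (s * r) Q : ℝ) / q +
          Real.sqrt (q * (Int.gcd (s * r) Q : ℝ))) := by
    intro k hk r hr
    rw [Finset.mem_Icc] at hk hr
    have hk0 : (k : ℤ) ≠ 0 := by exact_mod_cast (by omega : k ≠ 0)
    have hs0 : s ≠ 0 := by rcases hs with rfl | rfl <;> norm_num
    have hr0 : (s * r : ℤ) ≠ 0 := mul_ne_zero hs0 (by exact_mod_cast (by omega : r ≠ 0))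
    have h := H4 q χ hχp hχq ν Q hq2Q hQodd (k : ℤ) (s * r) hk0 hr0 M hM0 b hb0 hbsupp hbv
    have hsub : Icc 1 ⌊2 * M⌋₊ ⊆ Icc 1 ⌊A₄ * M⌋₊ :=
      Finset.Icc_subset_Icc le_rfl (Nat.floor_mono (by nlinarith))
    have heq : ∑ m ∈ Icc 1 ⌊2 * M⌋₊,
        b m * (χ (m : ZMod q) * χ (((k : ℤ) * m + s * r : ℤ) : ZMod q)) =
        ∑ m ∈ Icc 1 ⌊A₄ * M⌋₊, b m * χ (m : ZMod q) * χ (((k : ℤ) * m + s * r : ℤ) : ZMod q) := by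
      rw [Finset.sum_subset hsub]
      · exact Finset.sum_congr rfl fun m _ => by ring
      · intro m hm hm'
        rw [Finset.mem_Icc] at hm hm'
        have hm2 : ⌊2 * M⌋₊ < m := by omega
        have hm2' : 2 * M < m := (Nat.floor_lt (by linarith)).mp hm2
        have hbm : b m = 0 := by
          by_contra hne
          have := (hbsup m hne).2
          linarith
        rw [hbm]; ring
    rw [heq]
    exact h
  -- `E` with the `m`-sum innermost
  have hE : corrSumE χ s K M R a b c = ∑ k ∈ Icc 1 ⌊2 * K⌋₊, a k * ((Λ k : ℝ) : ℂ) *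
      ∑ r ∈ Icc 1 ⌊2 * R⌋₊, c r *
        ∑ m ∈ Icc 1 ⌊2 * M⌋₊, b m * (χ (m : ZMod q) * χ (((k : ℤ) * m + s * r : ℤ) : ZMod q)) := by
    unfold corrSumE
    refine Finset.sum_congr rfl fun k _ => ?_
    congr 1
    rw [Finset.sum_comm]
    refine Finset.sum_congr rfl fun r _ => ?_
    rw [Finset.mul_sum]
    exact Finset.sum_congr rfl fun m _ => by ring
  -- the `r`-sums of `(r, Q)` and `√(r, Q)` by (16)
  set g : ℕ → ℝ := fun r => ((Int.gcd (s * (r : ℤ)) Q : ℕ) : ℝ) with hg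
  have hg1 : ∀ r : ℕ, g r = (((Int.gcd (r : ℤ) (Q : ℤ) : ℕ) : ℝ)) := fun r => by
    simp only [hg, int_gcd_sign_mul hs]
  have hg0 : ∀ r : ℕ, 0 ≤ g r := fun r => by rw [hg1]; exact Nat.cast_nonneg _
  have hsum1 : ∑ r ∈ Icc 1 ⌊2 * R⌋₊, g r ≤ C₁₆ * (2 * R) * (q : ℝ) ^ ε := by
    have h := H16 q Q (NeZero.ne q) hQdvd ⌊2 * R⌋₊ 1 (Or.inr rfl)
    have h' := sum_Icc_gcd_rpow_le_sum_erase ⌊2 * R⌋₊ Q 1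
    simp only [Real.rpow_one] at h h'
    calc ∑ r ∈ Icc 1 ⌊2 * R⌋₊, g r = ∑ r ∈ Icc 1 ⌊2 * R⌋₊, (((Int.gcd (r : ℤ) (Q : ℤ) : ℕ) : ℝ)) :=
          Finset.sum_congr rfl fun r _ => hg1 r
      _ ≤ C₁₆ * (⌊2 * R⌋₊ : ℝ) * (q : ℝ) ^ ε := h'.trans h
      _ ≤ C₁₆ * (2 * R) * (q : ℝ) ^ ε := by
          gcongr
          exact Nat.floor_le (by linarith)
  have hsum2 : ∑ r ∈ Icc 1 ⌊2 * R⌋₊, Real.sqrt (g r) ≤ C₁₆ * (2 * R) * (q : ℝ) ^ ε := by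
    have h := H16 q Q (NeZero.ne q) hQdvd ⌊2 * R⌋₊ (1 / 2) (Or.inl rfl)
    have h' := sum_Icc_gcd_rpow_le_sum_erase ⌊2 * R⌋₊ Q (1 / 2)
    calc ∑ r ∈ Icc 1 ⌊2 * R⌋₊, Real.sqrt (g r)
        = ∑ r ∈ Icc 1 ⌊2 * R⌋₊, (((Int.gcd (r : ℤ) (Q : ℤ) : ℕ) : ℝ)) ^ (1 / 2 : ℝ) :=
          Finset.sum_congr rfl fun r _ => by rw [hg1, Real.sqrt_eq_rpow]
      _ ≤ C₁₆ * (⌊2 * R⌋₊ : ℝ) * (q : ℝ) ^ ε := h'.trans h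
      _ ≤ C₁₆ * (2 * R) * (q : ℝ) ^ ε := by
          gcongr
          exact Nat.floor_le (by linarith)
  -- the `r`-sum bound for each `k`
  have hrsum : ∀ k ∈ Icc 1 ⌊2 * K⌋₊,
      ‖∑ r ∈ Icc 1 ⌊2 * R⌋₊, c r *
        ∑ m ∈ Icc 1 ⌊2 * M⌋₊, b m * (χ (m : ZMod q) * χ (((k : ℤ) * m + s * r : ℤ) : ZMod q))‖ ≤
        2 * C₄ * C₁₆ * ((q : ℝ) ^ ε * (q : ℝ) ^ ε) * R * (M / q + Real.sqrt q) := by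
    intro k hk
    calc ‖∑ r ∈ Icc 1 ⌊2 * R⌋₊, c r *
          ∑ m ∈ Icc 1 ⌊2 * M⌋₊, b m * (χ (m : ZMod q) * χ (((k : ℤ) * m + s * r : ℤ) : ZMod q))‖
        ≤ ∑ r ∈ Icc 1 ⌊2 * R⌋₊, C₄ * (q : ℝ) ^ ε * (M * g r / q + Real.sqrt (q * g r)) := by
          refine (norm_sum_le _ _).trans (Finset.sum_le_sum fun r hr => ?_)
          rw [norm_mul]
          calc ‖c r‖ * ‖∑ m ∈ Icc 1 ⌊2 * M⌋₊,
                b m * (χ (m : ZMod q) * χ (((k : ℤ) * m + s * r : ℤ) : ZMod q))‖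
              ≤ 1 * (C₄ * (q : ℝ) ^ ε * (M * g r / q + Real.sqrt (q * g r))) :=
                mul_le_mul (hc1 r) (hinner k hk r hr) (norm_nonneg _) zero_le_one
            _ = _ := one_mul _
      _ = C₄ * (q : ℝ) ^ ε * (M / q * ∑ r ∈ Icc 1 ⌊2 * R⌋₊, g r +
            Real.sqrt q * ∑ r ∈ Icc 1 ⌊2 * R⌋₊, Real.sqrt (g r)) := by
          rw [Finset.mul_sum, Finset.mul_sum, ← Finset.sum_add_distrib, Finset.mul_sum]
          refine Finset.sum_congr rfl fun r _ => ?_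
          rw [Real.sqrt_mul hq0.le]
          ring
      _ ≤ C₄ * (q : ℝ) ^ ε * (M / q * (C₁₆ * (2 * R) * (q : ℝ) ^ ε) +
            Real.sqrt q * (C₁₆ * (2 * R) * (q : ℝ) ^ ε)) := by
          gcongr
      _ = 2 * C₄ * C₁₆ * ((q : ℝ) ^ ε * (q : ℝ) ^ ε) * R * (M / q + Real.sqrt q) := by ring
  -- the `k`-sum
  have hksum : ∑ k ∈ Icc 1 ⌊2 * K⌋₊, ‖a k‖ * Λ k ≤ 2 * K * Real.log (2 * K) :=
    sum_norm_weight_vonMangoldt_le hK1 a ha1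
  have hE1 : ‖corrSumE χ s K M R a b c‖ ≤
      (2 * K * Real.log (2 * K)) *
        (2 * C₄ * C₁₆ * ((q : ℝ) ^ ε * (q : ℝ) ^ ε) * R * (M / q + Real.sqrt q)) := by
    rw [hE]
    have hB0 : 0 ≤ 2 * C₄ * C₁₆ * ((q : ℝ) ^ ε * (q : ℝ) ^ ε) * R * (M / q + Real.sqrt q) := by
      positivity
    calc ‖∑ k ∈ Icc 1 ⌊2 * K⌋₊, a k * ((Λ k : ℝ) : ℂ) * ∑ r ∈ Icc 1 ⌊2 * R⌋₊, c r *
          ∑ m ∈ Icc 1 ⌊2 * M⌋₊, b m * (χ (m : ZMod q) * χ (((k : ℤ) * m + s * r : ℤ) : ZMod q))‖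
        ≤ ∑ k ∈ Icc 1 ⌊2 * K⌋₊, ‖a k‖ * Λ k *
            (2 * C₄ * C₁₆ * ((q : ℝ) ^ ε * (q : ℝ) ^ ε) * R * (M / q + Real.sqrt q)) := by
          refine (norm_sum_le _ _).trans (Finset.sum_le_sum fun k hk => ?_)
          rw [norm_mul, norm_mul, Complex.norm_real, Real.norm_eq_abs,
            abs_of_nonneg ArithmeticFunction.vonMangoldt_nonneg]
          exact mul_le_mul_of_nonneg_left (hrsum k hk)
            (mul_nonneg (norm_nonneg _) ArithmeticFunction.vonMangoldt_nonneg)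
      _ = (∑ k ∈ Icc 1 ⌊2 * K⌋₊, ‖a k‖ * Λ k) *
            (2 * C₄ * C₁₆ * ((q : ℝ) ^ ε * (q : ℝ) ^ ε) * R * (M / q + Real.sqrt q)) := by
          rw [Finset.sum_mul]
      _ ≤ (2 * K * Real.log (2 * K)) *
            (2 * C₄ * C₁₆ * ((q : ℝ) ^ ε * (q : ℝ) ^ ε) * R * (M / q + Real.sqrt q)) :=
          mul_le_mul_of_nonneg_right hksum hB0
  -- geometry of the range: `R M/q ≤ C₀² (KM)·q^{1/2−δ}/q /K`... : `K R (M/q + √q) ≤ (KM)(C₀² + C₀) q^{−η}`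
  have hgeom : K * R * (M / q + Real.sqrt q) ≤ (K * M) * (C₀ ^ 2 + C₀) * (q : ℝ) ^ (-(δ / 10)) := by
    -- first term: `K R M / q ≤ K M · C₀² q^{1/2-δ} / q ≤ KM C₀² q^{-η}`
    have h1 : R / q ≤ C₀ ^ 2 * (q : ℝ) ^ (-(δ / 10)) := by
      have h1a : R / q ≤ C₀ ^ 2 * (q : ℝ) ^ (1 / 2 - δ) / q :=
        div_le_div_of_nonneg_right hRq hq0.le
      have h1b : (q : ℝ) ^ (1 / 2 - δ) / q = (q : ℝ) ^ (1 / 2 - δ - 1) :=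
        (Real.rpow_sub_one hq0.ne' _).symm
      have h1c : (q : ℝ) ^ (1 / 2 - δ - 1) ≤ (q : ℝ) ^ (-(δ / 10)) :=
        Real.rpow_le_rpow_of_exponent_le hq1 (by linarith)
      calc R / q ≤ C₀ ^ 2 * (q : ℝ) ^ (1 / 2 - δ) / q := h1a
        _ = C₀ ^ 2 * (q : ℝ) ^ (1 / 2 - δ - 1) := by rw [mul_div_assoc, h1b]
        _ ≤ C₀ ^ 2 * (q : ℝ) ^ (-(δ / 10)) := by gcongr
    -- second term: `K R √q ≤ K (C₀ K M/T) √q = KM · C₀ K √q / T ≤ KM · C₀ q^{-η}`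
    have h2 : R * Real.sqrt q ≤ M * (C₀ * (q : ℝ) ^ (-(δ / 10))) := by
      have h2a : R * Real.sqrt q ≤ C₀ * (K * M) / (q : ℝ) ^ (7 / 3 + δ) * Real.sqrt q :=
        mul_le_mul_of_nonneg_right hRle (Real.sqrt_nonneg _)
      have h2b : K * Real.sqrt q / (q : ℝ) ^ (7 / 3 + δ) ≤ (q : ℝ) ^ (-(δ / 10)) := by
        rw [div_le_iff₀ hT0, Real.sqrt_eq_rpow]
        calc K * (q : ℝ) ^ (1 / 2 : ℝ)
            ≤ ((q : ℝ) ^ (7 / 3 + δ) * (q : ℝ) ^ (-(1 / 2 + δ / 10))) * (q : ℝ) ^ (1 / 2 : ℝ) :=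
              mul_le_mul_of_nonneg_right hKup (by positivity)
          _ = (q : ℝ) ^ (-(δ / 10)) * (q : ℝ) ^ (7 / 3 + δ) := by
              rw [mul_assoc, ← Real.rpow_add hq0, mul_comm, ← Real.rpow_add hq0,
                ← Real.rpow_add hq0]
              exact congrArg (fun t : ℝ => (q : ℝ) ^ t) (by ring)
      calc R * Real.sqrt q ≤ C₀ * (K * M) / (q : ℝ) ^ (7 / 3 + δ) * Real.sqrt q := h2a
        _ = M * (C₀ * (K * Real.sqrt q / (q : ℝ) ^ (7 / 3 + δ))) := by ring
        _ ≤ M * (C₀ * (q : ℝ) ^ (-(δ / 10))) :=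
            mul_le_mul_of_nonneg_left (mul_le_mul_of_nonneg_left h2b hC₀.le) hM0.le
    calc K * R * (M / q + Real.sqrt q) = (K * M) * (R / q) + K * (R * Real.sqrt q) := by ring
      _ ≤ (K * M) * (C₀ ^ 2 * (q : ℝ) ^ (-(δ / 10))) + K * (M * (C₀ * (q : ℝ) ^ (-(δ / 10)))) :=
          add_le_add (mul_le_mul_of_nonneg_left h1 hKM0.le) (mul_le_mul_of_nonneg_left h2 hK0.le)
      _ = (K * M) * (C₀ ^ 2 + C₀) * (q : ℝ) ^ (-(δ / 10)) := by ring
  -- exponents: `q^ε q^ε q^{17ε/6} q^{−η} ≤ q^{−η/2}`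
  have hexp : (q : ℝ) ^ ε * (q : ℝ) ^ ε * (q : ℝ) ^ (17 / 6 * ε) * (q : ℝ) ^ (-(δ / 10)) ≤
      (q : ℝ) ^ (-(δ / 10 / 2)) := by
    rw [← Real.rpow_add hq0, ← Real.rpow_add hq0, ← Real.rpow_add hq0]
    exact Real.rpow_le_rpow_of_exponent_le hq1 (by linarith [hε])
  -- assemble
  have hpos1 : 0 ≤ 4 * C₄ * C₁₆ * ((q : ℝ) ^ ε * (q : ℝ) ^ ε) := by positivity
  calc ‖corrSumE χ s K M R a b c‖
      ≤ (2 * K * Real.log (2 * K)) *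
          (2 * C₄ * C₁₆ * ((q : ℝ) ^ ε * (q : ℝ) ^ ε) * R * (M / q + Real.sqrt q)) := hE1
    _ = 4 * C₄ * C₁₆ * ((q : ℝ) ^ ε * (q : ℝ) ^ ε) * Real.log (2 * K) *
          (K * R * (M / q + Real.sqrt q)) := by ring
    _ ≤ 4 * C₄ * C₁₆ * ((q : ℝ) ^ ε * (q : ℝ) ^ ε) *
          ((2 * C₀) ^ ε * (q : ℝ) ^ (17 / 6 * ε) / ε) *
          ((K * M) * (C₀ ^ 2 + C₀) * (q : ℝ) ^ (-(δ / 10))) :=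
        mul_le_mul (mul_le_mul_of_nonneg_left hlogK hpos1) hgeom (by positivity) (by positivity)
    _ = D * (K * M) *
          ((q : ℝ) ^ ε * (q : ℝ) ^ ε * (q : ℝ) ^ (17 / 6 * ε) * (q : ℝ) ^ (-(δ / 10))) := by
        rw [hD]; ring
    _ ≤ D * (K * M) * (q : ℝ) ^ (-(δ / 10 / 2)) :=
        mul_le_mul_of_nonneg_left hexp (by positivity)


/-- **(23) from Lemma 4 and (16)**, as typed (`rangeI_bound`): corollary of
`rangeI_bound_core_of_lemma4` (the dyadic weight class is used only through `‖a‖, ‖c‖ ≤ 1`, the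
support of `b`, `‖b‖ ≤ 1` and `‖b′‖ ≤ A₁ q^{ε₁}/M`). [cite: BondarenkoHeap2026, eq. (23), TeX l.864–878] -/
theorem rangeI_bound_of_lemma4 (h4 : lemma4) : rangeI_bound := by
  intro δ hδ hδ1 C₀ hC₀ A
  obtain ⟨ε₁, hε₁, C, hC, H⟩ := rangeI_bound_core_of_lemma4 h4 δ hδ hδ1 C₀ hC₀ (A 1)
  refine ⟨ε₁, hε₁, C, hC, ?_⟩
  intro q _ χ hχp hχq K M R hadm hrange s hs a b c ha hb hc
  refine H q χ hχp hχq K M R hadm hrange s hs a b c ha.2.2.1 hb.1 hb.2.1 hb.2.2.1 (fun x => ?_)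
    hc.2.2.1
  have h1 := hb.2.2.2 1 x
  rw [iteratedDeriv_one, pow_one] at h1
  exact h1

/-! ### Lemma 7, (25): the congruence energy bound — PROVED (TeX l.906–940)

"This is essentially an additive divisor problem": the bound is a lattice-point count for the
congruence `r₁m₂ ≡ r₂m₁ (mod q)` in the box `r_j ≍ R`, `m_j ≍ M`. -/

/-- `∑_{g ≤ N} 1/g ≤ 1 + log N` (Mathlib's `harmonic_le_one_add_log`). [folklore] -/
private theorem sum_Icc_inv_le_one_add_log (N : ℕ) :
    ∑ g ∈ Icc 1 N, ((g : ℝ))⁻¹ ≤ 1 + Real.log N := by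
  have h := harmonic_le_one_add_log N
  simpa [harmonic_eq_sum_Icc, Rat.cast_sum, Rat.cast_inv, Rat.cast_natCast] using h

/-- `#{a ∈ [1, N] : g ∣ a} = ⌊N/g⌋ ≤ N/g`. [folklore] -/
private theorem card_Icc_filter_dvd_le (N g : ℕ) :
    (((Icc 1 N).filter (fun a => g ∣ a)).card : ℝ) ≤ (N : ℝ) / g := by
  have hIcc : (Icc 1 N : Finset ℕ) = Ioc 0 N := by
    ext a; simp only [Finset.mem_Icc, Finset.mem_Ioc]; omega
  rw [hIcc, Nat.Ioc_filter_dvd_card_eq_div]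
  exact Nat.cast_div_le

/-- **`gcd`-sum** `∑_{a, b ≤ N} (a, b) ≤ N² (1 + log N)`: `(a,b) ≤ ∑_{g ≤ N, g ∣ a, g ∣ b} g` and each
`g` divides `⌊N/g⌋² ≤ N²/g²` pairs; then the harmonic sum. [folklore] -/
private theorem sum_sum_gcd_le (N : ℕ) :
    ∑ a ∈ Icc 1 N, ∑ b ∈ Icc 1 N, (Nat.gcd a b : ℝ) ≤ (N : ℝ) ^ 2 * (1 + Real.log N) := by
  classical
  have h1 : ∀ a ∈ Icc 1 N, ∀ b ∈ Icc 1 N, (Nat.gcd a b : ℝ) ≤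
      ∑ g ∈ Icc 1 N, if g ∣ a ∧ g ∣ b then (g : ℝ) else 0 := by
    intro a ha b hb
    rw [Finset.mem_Icc] at ha hb
    rw [← Finset.sum_filter]
    have hmem : Nat.gcd a b ∈ (Icc 1 N).filter (fun g => g ∣ a ∧ g ∣ b) := by
      rw [Finset.mem_filter, Finset.mem_Icc]
      exact ⟨⟨Nat.gcd_pos_of_pos_left b (by omega), (Nat.gcd_le_left b (by omega)).trans ha.2⟩,
        Nat.gcd_dvd_left a b, Nat.gcd_dvd_right a b⟩
    exact Finset.single_le_sum (f := fun g : ℕ => (g : ℝ)) (fun g _ => Nat.cast_nonneg g) hmem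
  have h2 : ∀ g ∈ Icc 1 N, (∑ a ∈ Icc 1 N, ∑ b ∈ Icc 1 N,
      if g ∣ a ∧ g ∣ b then (g : ℝ) else 0) ≤ (N : ℝ) ^ 2 * ((g : ℝ))⁻¹ := by
    intro g hg
    rw [Finset.mem_Icc] at hg
    have hg0 : (0 : ℝ) < g := by exact_mod_cast hg.1
    have hsplit : ∀ a b : ℕ, (if g ∣ a ∧ g ∣ b then (g : ℝ) else 0) =
        (g : ℝ) * ((if g ∣ a then (1 : ℝ) else 0) * (if g ∣ b then (1 : ℝ) else 0)) := by
      intro a b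
      by_cases ha : g ∣ a <;> by_cases hb : g ∣ b <;> simp [ha, hb]
    have hD := card_Icc_filter_dvd_le N g
    calc (∑ a ∈ Icc 1 N, ∑ b ∈ Icc 1 N, if g ∣ a ∧ g ∣ b then (g : ℝ) else 0)
        = ∑ a ∈ Icc 1 N, ∑ b ∈ Icc 1 N,
            (g : ℝ) * ((if g ∣ a then (1 : ℝ) else 0) * (if g ∣ b then (1 : ℝ) else 0)) := by
          simp_rw [hsplit]
      _ = (g : ℝ) * ((∑ a ∈ Icc 1 N, if g ∣ a then (1 : ℝ) else 0) *
            ∑ b ∈ Icc 1 N, if g ∣ b then (1 : ℝ) else 0) := by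
          rw [Finset.sum_mul_sum, Finset.mul_sum]
          exact Finset.sum_congr rfl fun a _ => by rw [Finset.mul_sum]
      _ = (g : ℝ) * (((Icc 1 N).filter (fun a => g ∣ a)).card : ℝ) ^ 2 := by
          rw [Finset.sum_boole, sq]
      _ ≤ (g : ℝ) * ((N : ℝ) / g) ^ 2 := by gcongr
      _ = (N : ℝ) ^ 2 * ((g : ℝ))⁻¹ := by field_simp
  calc ∑ a ∈ Icc 1 N, ∑ b ∈ Icc 1 N, (Nat.gcd a b : ℝ)
      ≤ ∑ a ∈ Icc 1 N, ∑ b ∈ Icc 1 N, ∑ g ∈ Icc 1 N, if g ∣ a ∧ g ∣ b then (g : ℝ) else 0 :=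
        Finset.sum_le_sum fun a ha => Finset.sum_le_sum fun b hb => h1 a ha b hb
    _ = ∑ a ∈ Icc 1 N, ∑ g ∈ Icc 1 N, ∑ b ∈ Icc 1 N, if g ∣ a ∧ g ∣ b then (g : ℝ) else 0 :=
        Finset.sum_congr rfl fun a _ => Finset.sum_comm
    _ = ∑ g ∈ Icc 1 N, ∑ a ∈ Icc 1 N, ∑ b ∈ Icc 1 N, if g ∣ a ∧ g ∣ b then (g : ℝ) else 0 :=
        Finset.sum_comm
    _ ≤ ∑ g ∈ Icc 1 N, (N : ℝ) ^ 2 * ((g : ℝ))⁻¹ := Finset.sum_le_sum h2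
    _ = (N : ℝ) ^ 2 * ∑ g ∈ Icc 1 N, ((g : ℝ))⁻¹ := by rw [Finset.mul_sum]
    _ ≤ (N : ℝ) ^ 2 * (1 + Real.log N) :=
        mul_le_mul_of_nonneg_left (sum_Icc_inv_le_one_add_log N) (sq_nonneg _)

/-- **One residue class.** The `m ∈ [1, N]` with `r₁ ∣ c + r₂ m` are pairwise congruent modulo
`r₁/(r₁,r₂)`, hence number at most `N (r₁,r₂)/r₁ + 1` — the count `≪ gM/R` of the Bezout
parametrisation `m₁ = m_{1,0}(h/g) + n r₁` in the text (TeX l.931–936).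
[cite: BondarenkoHeap2026, Lemma 7, TeX l.931–936] -/
theorem card_filter_dvd_linear_le {r₁ : ℕ} (hr₁ : 0 < r₁) (r₂ : ℕ) (c : ℤ) (N : ℕ) :
    (((Icc 1 N).filter fun m : ℕ => (r₁ : ℤ) ∣ c + (r₂ : ℤ) * (m : ℤ)).card : ℝ) ≤
      (N : ℝ) * (Nat.gcd r₁ r₂ : ℝ) / (r₁ : ℝ) + 1 := by
  classical
  set g := Nat.gcd r₁ r₂ with hg
  have hg0 : 0 < g := Nat.gcd_pos_of_pos_left r₂ hr₁
  set d := r₁ / g with hd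
  have hdg : d * g = r₁ := Nat.div_mul_cancel (Nat.gcd_dvd_left r₁ r₂)
  have hd0 : 0 < d := Nat.div_pos (Nat.le_of_dvd hr₁ (Nat.gcd_dvd_left r₁ r₂)) hg0
  obtain ⟨e, he⟩ : g ∣ r₂ := Nat.gcd_dvd_right r₁ r₂
  have hcop : Nat.Coprime d e := by
    have h := Nat.coprime_div_gcd_div_gcd (m := r₁) (n := r₂) hg0
    have he' : r₂ / g = e := by rw [he, Nat.mul_div_cancel_left e hg0]
    rwa [← hg, ← hd, he'] at h
  set T := (Icc 1 N).filter fun m : ℕ => (r₁ : ℤ) ∣ c + (r₂ : ℤ) * (m : ℤ) with hT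
  -- any two solutions are congruent modulo `d`
  have hcong : ∀ m ∈ T, ∀ m' ∈ T, m % d = m' % d := by
    intro m hm m' hm'
    rw [hT, Finset.mem_filter] at hm hm'
    have hdvd : (r₁ : ℤ) ∣ (r₂ : ℤ) * ((m' : ℤ) - (m : ℤ)) := by
      have h := dvd_sub hm'.2 hm.2
      have e1 : c + (r₂ : ℤ) * (m' : ℤ) - (c + (r₂ : ℤ) * (m : ℤ)) =
          (r₂ : ℤ) * ((m' : ℤ) - (m : ℤ)) := by ring
      rwa [e1] at h
    have hdvd' : (d : ℤ) ∣ (e : ℤ) * ((m' : ℤ) - (m : ℤ)) := by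
      have h1 : (g : ℤ) * d ∣ (g : ℤ) * ((e : ℤ) * ((m' : ℤ) - (m : ℤ))) := by
        have e1 : (g : ℤ) * d = (r₁ : ℤ) := by rw [← hdg]; push_cast; ring
        have e2 : (g : ℤ) * ((e : ℤ) * ((m' : ℤ) - (m : ℤ))) = (r₂ : ℤ) * ((m' : ℤ) - (m : ℤ)) := by
          rw [he]; push_cast; ring
        rw [e1, e2]; exact hdvd
      exact (mul_dvd_mul_iff_left (by exact_mod_cast hg0.ne' : (g : ℤ) ≠ 0)).mp h1
    have hdvd'' : (d : ℤ) ∣ (m' : ℤ) - (m : ℤ) :=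
      (Nat.isCoprime_iff_coprime.mpr hcop).dvd_of_dvd_mul_left hdvd'
    exact (Nat.modEq_iff_dvd.mpr hdvd'' : m ≡ m' [MOD d])
  -- hence `m ↦ m / d` is injective on `T`, with values in `[0, N/d]`
  have hinj : Set.InjOn (fun m : ℕ => m / d) (T : Set ℕ) := by
    intro m hm m' hm' h
    have h' : m / d = m' / d := h
    calc m = d * (m / d) + m % d := (Nat.div_add_mod m d).symm
      _ = d * (m' / d) + m' % d := by rw [h', hcong m hm m' hm']
      _ = m' := Nat.div_add_mod m' d
  have hmaps : Set.MapsTo (fun m : ℕ => m / d) (T : Set ℕ) (Icc 0 (N / d) : Finset ℕ) := by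
    intro m hm
    have hm' : m ∈ T := hm
    rw [hT, Finset.mem_filter, Finset.mem_Icc] at hm'
    rw [Finset.mem_coe, Finset.mem_Icc]
    exact ⟨Nat.zero_le _, Nat.div_le_div_right hm'.1.2⟩
  have hcard : T.card ≤ (Icc 0 (N / d)).card := Finset.card_le_card_of_injOn _ hmaps hinj
  rw [Nat.card_Icc, Nat.sub_zero] at hcard
  have h1 : (T.card : ℝ) ≤ ((N / d : ℕ) : ℝ) + 1 := by exact_mod_cast hcard
  have h2 : ((N / d : ℕ) : ℝ) ≤ (N : ℝ) / d := Nat.cast_div_le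
  have hg0' : (0 : ℝ) < g := by exact_mod_cast hg0
  have hr₁' : (0 : ℝ) < r₁ := by exact_mod_cast hr₁
  have h3 : (N : ℝ) / d = N * g / r₁ := by
    have hdr : (d : ℝ) = r₁ / g := by
      rw [← hdg]; push_cast; field_simp
    rw [hdr]; field_simp
  linarith [h1, h2, h3.le]

/-- **Fixed `r₁, r₂`** (TeX l.925–936: "Writing `ℓq = h` gives `O(1+RM/q)` possible values of `h`
… fixing `r₁, r₂, h` … the support conditions then dictate `n ≪ gM/R`"): for `1 ≤ r₁, r₂ ≤ N_R`
the pairs `(m₁, m₂) ∈ [1, N_M]²` with `q ∣ r₁m₂ − r₂m₁` inject by `(m₁,m₂) ↦ ((r₁m₂ − r₂m₁)/q, m₁)`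
into `{(ℓ, m₁) : |ℓ| ≤ N_R N_M/q, r₁ ∣ qℓ + r₂m₁}`, whence at most
`(2⌊N_R N_M/q⌋ + 1)(N_M (r₁,r₂)/r₁ + 1)` of them. [cite: BondarenkoHeap2026, Lemma 7, TeX l.925–936] -/
theorem card_pairs_congr_le {q : ℕ} (hq : 0 < q) {r₁ r₂ N_R : ℕ} (hr₁ : 0 < r₁) (hr₁N : r₁ ≤ N_R)
    (hr₂N : r₂ ≤ N_R) (N_M : ℕ) :
    ((((Icc 1 N_M) ×ˢ (Icc 1 N_M)).filter fun mm : ℕ × ℕ =>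
        (q : ℤ) ∣ (r₁ : ℤ) * mm.2 - (r₂ : ℤ) * mm.1).card : ℝ) ≤
      (2 * ((N_R * N_M / q : ℕ) : ℝ) + 1) * ((N_M : ℝ) * (Nat.gcd r₁ r₂) / r₁ + 1) := by
  classical
  set L : ℕ := N_R * N_M / q with hL
  set F := ((Icc 1 N_M) ×ˢ (Icc 1 N_M)).filter fun mm : ℕ × ℕ =>
    (q : ℤ) ∣ (r₁ : ℤ) * mm.2 - (r₂ : ℤ) * mm.1 with hF
  set G := ((Icc (-(L : ℤ)) L) ×ˢ (Icc 1 N_M)).filter fun lm : ℤ × ℕ =>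
    (r₁ : ℤ) ∣ (q : ℤ) * lm.1 + (r₂ : ℤ) * lm.2 with hG
  set φ : ℕ × ℕ → ℤ × ℕ := fun mm => (((r₁ : ℤ) * mm.2 - (r₂ : ℤ) * mm.1) / q, mm.1) with hφ
  have hq' : (0 : ℤ) < q := by exact_mod_cast hq
  -- `φ` maps `F` into `G`
  have hmaps : Set.MapsTo φ (F : Set (ℕ × ℕ)) (G : Set (ℤ × ℕ)) := by
    intro mm hmm
    have hmm' : mm ∈ F := hmm
    rw [hF, Finset.mem_filter, Finset.mem_product, Finset.mem_Icc, Finset.mem_Icc] at hmm'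
    obtain ⟨⟨⟨h11, h12⟩, h21, h22⟩, hdvd⟩ := hmm'
    have hmul : (q : ℤ) * (((r₁ : ℤ) * mm.2 - (r₂ : ℤ) * mm.1) / q) =
        (r₁ : ℤ) * mm.2 - (r₂ : ℤ) * mm.1 := Int.mul_ediv_cancel' hdvd
    -- size of `h = r₁ m₂ − r₂ m₁`
    have hup : (r₁ : ℤ) * mm.2 - (r₂ : ℤ) * mm.1 ≤ (N_R * N_M : ℕ) := by
      have h1 : (r₁ : ℤ) * mm.2 ≤ (N_R : ℤ) * N_M := by gcongr
      have h2 : (0 : ℤ) ≤ (r₂ : ℤ) * mm.1 := by positivity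
      push_cast; linarith
    have hlo : -((N_R * N_M : ℕ) : ℤ) ≤ (r₁ : ℤ) * mm.2 - (r₂ : ℤ) * mm.1 := by
      have h1 : (r₂ : ℤ) * mm.1 ≤ (N_R : ℤ) * N_M := by gcongr
      have h2 : (0 : ℤ) ≤ (r₁ : ℤ) * mm.2 := by positivity
      push_cast; linarith
    have hℓup : ((r₁ : ℤ) * mm.2 - (r₂ : ℤ) * mm.1) / q ≤ (L : ℤ) := by
      rw [hL, Int.natCast_div, Int.le_ediv_iff_mul_le hq']
      calc ((r₁ : ℤ) * mm.2 - (r₂ : ℤ) * mm.1) / q * q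
          = (r₁ : ℤ) * mm.2 - (r₂ : ℤ) * mm.1 := by rw [mul_comm]; exact hmul
        _ ≤ (N_R * N_M : ℕ) := hup
    have hℓlo : -(L : ℤ) ≤ ((r₁ : ℤ) * mm.2 - (r₂ : ℤ) * mm.1) / q := by
      rw [neg_le, hL, Int.natCast_div, Int.le_ediv_iff_mul_le hq']
      calc -(((r₁ : ℤ) * mm.2 - (r₂ : ℤ) * mm.1) / q) * q
          = -((r₁ : ℤ) * mm.2 - (r₂ : ℤ) * mm.1) := by rw [neg_mul, mul_comm, hmul]
        _ ≤ (N_R * N_M : ℕ) := by linarith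
    change φ mm ∈ (G : Set (ℤ × ℕ))
    rw [Finset.mem_coe, hG, Finset.mem_filter, Finset.mem_product, Finset.mem_Icc, Finset.mem_Icc]
    refine ⟨⟨⟨hℓlo, hℓup⟩, h11, h12⟩, ?_⟩
    simp only [hφ]
    rw [hmul]
    exact ⟨(mm.2 : ℤ), by ring⟩
  -- `φ` is injective on `F`
  have hinj : Set.InjOn φ (F : Set (ℕ × ℕ)) := by
    intro mm hmm mm' hmm' h
    have hd : (q : ℤ) ∣ (r₁ : ℤ) * mm.2 - (r₂ : ℤ) * mm.1 := by
      have hmm₁ : mm ∈ F := hmm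
      rw [hF, Finset.mem_filter] at hmm₁
      exact hmm₁.2
    have hd' : (q : ℤ) ∣ (r₁ : ℤ) * mm'.2 - (r₂ : ℤ) * mm'.1 := by
      have hmm₁ : mm' ∈ F := hmm'
      rw [hF, Finset.mem_filter] at hmm₁
      exact hmm₁.2
    simp only [hφ, Prod.mk.injEq] at h
    obtain ⟨h1, h2⟩ := h
    rw [Int.ediv_left_inj hd hd'] at h1
    have h3 : (r₁ : ℤ) * mm.2 = (r₁ : ℤ) * mm'.2 := by
      have : (mm.1 : ℤ) = mm'.1 := by exact_mod_cast h2
      rw [this] at h1; linarith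
    have h4 : (mm.2 : ℤ) = mm'.2 := mul_left_cancel₀ (by exact_mod_cast hr₁.ne') h3
    exact Prod.ext h2 (by exact_mod_cast h4)
  have hFG : F.card ≤ G.card := Finset.card_le_card_of_injOn φ hmaps hinj
  -- count `G` fibrewise in `ℓ`
  have hGsum : (G.card : ℝ) = ∑ ℓ ∈ Icc (-(L : ℤ)) L,
      (((Icc 1 N_M).filter fun m : ℕ => (r₁ : ℤ) ∣ (q : ℤ) * ℓ + (r₂ : ℤ) * (m : ℤ)).card : ℝ) := by
    rw [hG, Finset.card_filter, Finset.sum_product]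
    push_cast
    refine Finset.sum_congr rfl fun ℓ _ => ?_
    rw [Finset.card_filter]
    push_cast
    rfl
  have hGle : (G.card : ℝ) ≤ ∑ _ℓ ∈ Icc (-(L : ℤ)) L, ((N_M : ℝ) * (Nat.gcd r₁ r₂) / r₁ + 1) := by
    rw [hGsum]
    exact Finset.sum_le_sum fun ℓ _ => card_filter_dvd_linear_le hr₁ r₂ ((q : ℤ) * ℓ) N_M
  rw [Finset.sum_const, nsmul_eq_mul, Int.card_Icc] at hGle
  have hcardI : (((L : ℤ) + 1 - -(L : ℤ)).toNat : ℝ) = 2 * (L : ℝ) + 1 := by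
    have h : (L : ℤ) + 1 - -(L : ℤ) = ((2 * L + 1 : ℕ) : ℤ) := by push_cast; ring
    rw [h, Int.toNat_natCast]
    push_cast; ring
  rw [hcardI] at hGle
  calc (F.card : ℝ) ≤ G.card := by exact_mod_cast hFG
    _ ≤ _ := hGle

/-- **The lattice-point count behind (25)** (TeX l.923–940): for `1 ≤ R ≤ M` and `q ≥ 1`, the number
of `(r₁, r₂, m₁, m₂)` with `r_j ∈ [R, 2R]`, `m_j ∈ [1, 2M]` and `q ∣ r₁m₂ − r₂m₁` is at most
`12 · RM · (1 + log 2R) · (1 + 8RM/q)` — per `(r₁, r₂)` at most `(1 + 8RM/q) · 3(r₁,r₂)M/R` pairs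
(`card_pairs_congr_le`), and `∑_{r₁,r₂ ≤ 2R} (r₁,r₂) ≤ 4R²(1 + log 2R)` (`sum_sum_gcd_le`, in place
of the text's `∑_h ∑_{g ∣ h} 1/g ≪ q^ε`). [cite: BondarenkoHeap2026, Lemma 7, TeX l.923–940] -/
theorem card_quadruples_le {q : ℕ} (hq : 0 < q) {R M : ℝ} (hR : 1 ≤ R) (hRM : R ≤ M) :
    ((((((Icc 1 ⌊2 * R⌋₊).filter fun r : ℕ => R ≤ (r : ℝ)) ×ˢ
        ((Icc 1 ⌊2 * R⌋₊).filter fun r : ℕ => R ≤ (r : ℝ))) ×ˢ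
        (Icc 1 ⌊2 * M⌋₊ ×ˢ Icc 1 ⌊2 * M⌋₊)).filter fun z : (ℕ × ℕ) × (ℕ × ℕ) =>
          (q : ℤ) ∣ (z.1.1 : ℤ) * z.2.2 - (z.1.2 : ℤ) * z.2.1).card : ℝ) ≤
      12 * (R * M) * (1 + Real.log (2 * R)) * (8 * (R * M) / q + 1) := by
  classical
  set N_R : ℕ := ⌊2 * R⌋₊ with hN_R
  set N_M : ℕ := ⌊2 * M⌋₊ with hN_M
  set IR := (Icc 1 N_R).filter fun r : ℕ => R ≤ (r : ℝ) with hIR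
  set IM := Icc 1 N_M with hIM
  have hM : 1 ≤ M := hR.trans hRM
  have hR0 : 0 < R := by linarith
  have hM0 : 0 < M := by linarith
  have hq0 : (0 : ℝ) < q := by exact_mod_cast hq
  have hN_R_le : (N_R : ℝ) ≤ 2 * R := Nat.floor_le (by linarith)
  have hN_M_le : (N_M : ℝ) ≤ 2 * M := Nat.floor_le (by linarith)
  have hN_R_pos : 0 < N_R := by
    rw [hN_R]; exact Nat.floor_pos.mpr (by linarith)
  -- fibrewise in `(r₁, r₂)`
  have hsum : ((((IR ×ˢ IR) ×ˢ (IM ×ˢ IM)).filter fun z : (ℕ × ℕ) × (ℕ × ℕ) =>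
      (q : ℤ) ∣ (z.1.1 : ℤ) * z.2.2 - (z.1.2 : ℤ) * z.2.1).card : ℝ) =
      ∑ rr ∈ IR ×ˢ IR, ((((IM ×ˢ IM).filter fun mm : ℕ × ℕ =>
        (q : ℤ) ∣ (rr.1 : ℤ) * mm.2 - (rr.2 : ℤ) * mm.1).card) : ℝ) := by
    rw [Finset.card_filter, Finset.sum_product]
    push_cast
    refine Finset.sum_congr rfl fun rr _ => ?_
    rw [Finset.card_filter]
    push_cast
    rfl
  -- the per-`(r₁, r₂)` bound, simplified with `r₁ ≥ R`, `N_M ≤ 2M`, `R ≤ M`, `(r₁,r₂) ≥ 1`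
  have hper : ∀ rr ∈ IR ×ˢ IR, ((((IM ×ˢ IM).filter fun mm : ℕ × ℕ =>
      (q : ℤ) ∣ (rr.1 : ℤ) * mm.2 - (rr.2 : ℤ) * mm.1).card) : ℝ) ≤
      (8 * (R * M) / q + 1) * (3 * M / R) * (Nat.gcd rr.1 rr.2 : ℝ) := by
    intro rr hrr
    rw [Finset.mem_product, hIR, Finset.mem_filter, Finset.mem_filter, Finset.mem_Icc,
      Finset.mem_Icc] at hrr
    obtain ⟨⟨⟨h11, h12⟩, hR1⟩, ⟨h21, h22⟩, _⟩ := hrr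
    have hr1pos : 0 < rr.1 := by omega
    have h := card_pairs_congr_le hq hr1pos h12 h22 N_M
    have hg1 : (1 : ℝ) ≤ (Nat.gcd rr.1 rr.2 : ℝ) := by
      exact_mod_cast Nat.gcd_pos_of_pos_left rr.2 hr1pos
    have hr1R : R ≤ (rr.1 : ℝ) := hR1
    have hr1pos' : (0 : ℝ) < rr.1 := by exact_mod_cast hr1pos
    -- `2 ⌊N_R N_M / q⌋ + 1 ≤ 8RM/q + 1`
    have hA : (2 * ((N_R * N_M / q : ℕ) : ℝ) + 1) ≤ 8 * (R * M) / q + 1 := by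
      have h1 : ((N_R * N_M / q : ℕ) : ℝ) ≤ (N_R : ℝ) * N_M / q := by
        have h := (Nat.cast_div_le : ((N_R * N_M / q : ℕ) : ℝ) ≤ ((N_R * N_M : ℕ) : ℝ) / q)
        push_cast at h
        exact h
      have h2 : (N_R : ℝ) * N_M ≤ (2 * R) * (2 * M) := by gcongr
      have h3 : (N_R : ℝ) * N_M / q ≤ 4 * (R * M) / q := by
        rw [show (4 : ℝ) * (R * M) = (2 * R) * (2 * M) by ring]
        exact div_le_div_of_nonneg_right h2 hq0.le
      have h4 : (8 : ℝ) * (R * M) / q = 2 * (4 * (R * M) / q) := by ring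
      rw [h4]
      linarith
    -- `N_M g / r₁ + 1 ≤ 3 M g / R`
    have hB : (N_M : ℝ) * (Nat.gcd rr.1 rr.2) / rr.1 + 1 ≤ 3 * M / R * (Nat.gcd rr.1 rr.2 : ℝ) := by
      set g : ℝ := (Nat.gcd rr.1 rr.2 : ℝ) with hg
      have h1 : (N_M : ℝ) * g / rr.1 ≤ 2 * M * g / R := by
        rw [div_le_div_iff₀ hr1pos' hR0]
        have : (N_M : ℝ) * g * R ≤ 2 * M * g * rr.1 := by
          calc (N_M : ℝ) * g * R ≤ (2 * M) * g * R := by gcongr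
            _ ≤ 2 * M * g * rr.1 := by gcongr
        linarith
      have h2 : (1 : ℝ) ≤ M * g / R := by
        rw [le_div_iff₀ hR0, one_mul]
        calc R = R * 1 := (mul_one R).symm
          _ ≤ M * g := by gcongr
      calc (N_M : ℝ) * g / rr.1 + 1 ≤ 2 * M * g / R + M * g / R := add_le_add h1 h2
        _ = 3 * M / R * g := by ring
    calc ((((IM ×ˢ IM).filter fun mm : ℕ × ℕ =>
          (q : ℤ) ∣ (rr.1 : ℤ) * mm.2 - (rr.2 : ℤ) * mm.1).card) : ℝ)
        ≤ (2 * ((N_R * N_M / q : ℕ) : ℝ) + 1) * ((N_M : ℝ) * (Nat.gcd rr.1 rr.2) / rr.1 + 1) := h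
      _ ≤ (8 * (R * M) / q + 1) * (3 * M / R * (Nat.gcd rr.1 rr.2 : ℝ)) := by
          gcongr
      _ = (8 * (R * M) / q + 1) * (3 * M / R) * (Nat.gcd rr.1 rr.2 : ℝ) := by ring
  -- the `gcd`-sum over the box
  have hgcd : ∑ rr ∈ IR ×ˢ IR, (Nat.gcd rr.1 rr.2 : ℝ) ≤ (2 * R) ^ 2 * (1 + Real.log (2 * R)) := by
    have hsub : IR ×ˢ IR ⊆ Icc 1 N_R ×ˢ Icc 1 N_R :=
      Finset.product_subset_product (Finset.filter_subset _ _) (Finset.filter_subset _ _)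
    have hlogN : Real.log N_R ≤ Real.log (2 * R) :=
      Real.log_le_log (by exact_mod_cast hN_R_pos) hN_R_le
    have hlog0 : 0 ≤ 1 + Real.log (N_R : ℝ) := by
      have : 0 ≤ Real.log (N_R : ℝ) := Real.log_natCast_nonneg N_R
      linarith
    calc ∑ rr ∈ IR ×ˢ IR, (Nat.gcd rr.1 rr.2 : ℝ)
        ≤ ∑ rr ∈ Icc 1 N_R ×ˢ Icc 1 N_R, (Nat.gcd rr.1 rr.2 : ℝ) :=
          Finset.sum_le_sum_of_subset_of_nonneg hsub fun _ _ _ => Nat.cast_nonneg _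
      _ = ∑ a ∈ Icc 1 N_R, ∑ b ∈ Icc 1 N_R, (Nat.gcd a b : ℝ) := Finset.sum_product _ _ _
      _ ≤ (N_R : ℝ) ^ 2 * (1 + Real.log N_R) := sum_sum_gcd_le N_R
      _ ≤ (2 * R) ^ 2 * (1 + Real.log (2 * R)) := by gcongr
  have hC0 : 0 ≤ (8 * (R * M) / q + 1) * (3 * M / R) := by positivity
  calc ((((IR ×ˢ IR) ×ˢ (IM ×ˢ IM)).filter fun z : (ℕ × ℕ) × (ℕ × ℕ) =>
        (q : ℤ) ∣ (z.1.1 : ℤ) * z.2.2 - (z.1.2 : ℤ) * z.2.1).card : ℝ)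
      = ∑ rr ∈ IR ×ˢ IR, ((((IM ×ˢ IM).filter fun mm : ℕ × ℕ =>
          (q : ℤ) ∣ (rr.1 : ℤ) * mm.2 - (rr.2 : ℤ) * mm.1).card) : ℝ) := hsum
    _ ≤ ∑ rr ∈ IR ×ˢ IR, (8 * (R * M) / q + 1) * (3 * M / R) * (Nat.gcd rr.1 rr.2 : ℝ) :=
        Finset.sum_le_sum hper
    _ = (8 * (R * M) / q + 1) * (3 * M / R) * ∑ rr ∈ IR ×ˢ IR, (Nat.gcd rr.1 rr.2 : ℝ) := by
        rw [Finset.mul_sum]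
    _ ≤ (8 * (R * M) / q + 1) * (3 * M / R) * ((2 * R) ^ 2 * (1 + Real.log (2 * R))) :=
        mul_le_mul_of_nonneg_left hgcd hC0
    _ = 12 * (R * M) * (1 + Real.log (2 * R)) * (8 * (R * M) / q + 1) := by
        field_simp
        ring

/-- "Energy = number of coincidences": `∑_x #{p ∈ S : f p = x}² = #{(p₁,p₂) ∈ S² : f p₁ = f p₂}`.
[folklore] -/
private theorem sum_card_filter_sq_eq_card {α β : Type*} [Fintype β] [DecidableEq β]
    (S : Finset α) (f : α → β) :
    ∑ x : β, ((S.filter fun p => f p = x).card) ^ 2 =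
      ((S ×ˢ S).filter fun pp : α × α => f pp.1 = f pp.2).card := by
  classical
  rw [Finset.card_eq_sum_card_fiberwise (f := fun pp : α × α => f pp.1) (t := Finset.univ)
    (fun _ _ => Finset.mem_coe.mpr (Finset.mem_univ _))]
  refine Finset.sum_congr rfl fun x _ => ?_
  rw [sq, ← Finset.card_product, Finset.filter_filter]
  congr 1
  ext pp
  simp only [Finset.mem_filter, Finset.mem_product]
  constructor
  · rintro ⟨⟨h1, h4⟩, h2, h5⟩
    exact ⟨⟨h1, h2⟩, h4.trans h5.symm, h4⟩
  · rintro ⟨⟨h1, h2⟩, h3, h4⟩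
    exact ⟨⟨h1, h4⟩, h2, h3.symm.trans h4⟩

/-- **Lemma 7, (25) — PROVED** (TeX l.906–940). "This is essentially an additive divisor problem.
On discarding the coefficients, the left side counts solutions of `r₁m₂ − r₂m₁ = ℓq` where `ℓ`
varies over `ℤ` as the support conditions allow …": `|W_x| ≤ N_x := #{(r,m) : b_{r,m} ≠ 0,
r m̄ ≡ x}`, `∑_x N_x² = #{((r₁,m₁),(r₂,m₂)) : r₁m̄₁ ≡ r₂m̄₂} ≤ #{q ∣ r₁m₂ − r₂m₁}` (`m_j` units),
the lattice-point count is `card_quadruples_le` (`≤ 12RM(1 + log 2R)(1 + 8RM/q)`), and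
`1 + log 2R ≤ 1 + log 2 + C log q ≤ (2 + C/ε) q^ε` from `R ≤ M ≤ q^C` (`log q ≤ q^ε/ε`); constant
`C' = 96(2 + C/ε)`. Two bookkeeping deviations from the printed road, same bound: for fixed
`(r₁, r₂, h)` the admissible `m₁` are counted as ONE residue class modulo `r₁/(r₁,r₂)` (the count
`gM/R` of the text's Bezout parametrisation `m₁ = m_{1,0}(h/g) + n r₁`), and the text's
`∑_h ∑_{g∣h} 1/g ≪ q^ε` is replaced by `∑_{r₁,r₂ ≤ 2R} (r₁,r₂) ≤ 4R² ∑_{g ≤ 2R} 1/g ≤ 4R²(1 + log 2R)`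
(harmonic sum instead of the divisor bound; the case `h = 0` needs no separate treatment).
[cite: BondarenkoHeap2026, Lemma 7, eq. (25), TeX l.906–940] -/
theorem lemma7_holds : lemma7 := by
  classical
  intro C hC ε hε
  refine ⟨96 * (2 + C / ε), by positivity, ?_⟩
  intro q _ R M hR hRM hMq b hb1 hsupp
  have hq : 0 < q := Nat.pos_of_ne_zero (NeZero.ne q)
  have hq0 : (0 : ℝ) < q := by exact_mod_cast hq
  have hq1 : (1 : ℝ) ≤ q := by exact_mod_cast hq
  have hM : 1 ≤ M := hR.trans hRM
  have hR0 : 0 < R := by linarith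
  have hM0 : 0 < M := by linarith
  -- the objects: the box `P ⊇ supp b =: S`, the map `f(r,m) = r m̄`, the boxes of the count `Q`
  set P := Icc 1 ⌊2 * R⌋₊ ×ˢ Icc 1 ⌊2 * M⌋₊ with hP
  set S := P.filter (fun p : ℕ × ℕ => b p.1 p.2 ≠ 0) with hS
  set f : ℕ × ℕ → ZMod q := fun p => (p.1 : ZMod q) * (p.2 : ZMod q)⁻¹ with hf
  set IR := (Icc 1 ⌊2 * R⌋₊).filter (fun r : ℕ => R ≤ (r : ℝ)) with hIR
  set IM := Icc 1 ⌊2 * M⌋₊ with hIM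
  set Q := ((IR ×ˢ IR) ×ˢ (IM ×ˢ IM)).filter (fun z : (ℕ × ℕ) × (ℕ × ℕ) =>
    (q : ℤ) ∣ (z.1.1 : ℤ) * z.2.2 - (z.1.2 : ℤ) * z.2.1) with hQ
  set E := (S ×ˢ S).filter (fun pp : (ℕ × ℕ) × (ℕ × ℕ) => f pp.1 = f pp.2) with hE
  -- Step 1 ("on discarding the coefficients"): `|W_x| ≤ N_x`
  have hW : ∀ x : ZMod q, ‖∑ r ∈ Icc 1 ⌊2 * R⌋₊, ∑ m ∈ Icc 1 ⌊2 * M⌋₊,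
      (if (r : ZMod q) * (m : ZMod q)⁻¹ = x then b r m else 0)‖ ≤
      ((S.filter fun p => f p = x).card : ℝ) := by
    intro x
    have h1 : (∑ r ∈ Icc 1 ⌊2 * R⌋₊, ∑ m ∈ Icc 1 ⌊2 * M⌋₊,
        (if (r : ZMod q) * (m : ZMod q)⁻¹ = x then b r m else 0)) =
        ∑ p ∈ P, (if f p = x then b p.1 p.2 else 0) := by
      rw [hP, Finset.sum_product]
    rw [h1]
    calc ‖∑ p ∈ P, (if f p = x then b p.1 p.2 else 0)‖
        ≤ ∑ p ∈ P, ‖(if f p = x then b p.1 p.2 else 0)‖ := norm_sum_le _ _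
      _ ≤ ∑ p ∈ P, (if (b p.1 p.2 ≠ 0 ∧ f p = x) then (1 : ℝ) else 0) := by
          refine Finset.sum_le_sum fun p _ => ?_
          by_cases hfx : f p = x
          · by_cases hb0 : b p.1 p.2 = 0
            · simp [hfx, hb0]
            · simp only [hfx, if_true, ne_eq, hb0, not_false_eq_true, and_self]
              exact hb1 p.1 p.2
          · simp [hfx]
      _ = ((P.filter fun p => b p.1 p.2 ≠ 0 ∧ f p = x).card : ℝ) := by
          rw [Finset.sum_boole]
      _ = ((S.filter fun p => f p = x).card : ℝ) := by
          rw [hS, Finset.filter_filter]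
  -- Step 2: `∑_x |W_x|² ≤ ∑_x N_x² = #E`
  have hE_eq : ∑ x : ZMod q, ((S.filter fun p => f p = x).card : ℝ) ^ 2 = (E.card : ℝ) := by
    rw [hE]
    exact_mod_cast sum_card_filter_sq_eq_card S f
  have h2 : ∑ x : ZMod q, ‖∑ r ∈ Icc 1 ⌊2 * R⌋₊, ∑ m ∈ Icc 1 ⌊2 * M⌋₊,
      (if (r : ZMod q) * (m : ZMod q)⁻¹ = x then b r m else 0)‖ ^ 2 ≤ (E.card : ℝ) := by
    rw [← hE_eq]
    exact Finset.sum_le_sum fun x _ => pow_le_pow_left₀ (norm_nonneg _) (hW x) 2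
  -- Step 3: `#E ≤ #Q` — `r₁ m̄₁ ≡ r₂ m̄₂` gives `q ∣ r₁m₂ − r₂m₁`, supports give the boxes
  have hEQ : E.card ≤ Q.card := by
    refine Finset.card_le_card_of_injOn
      (fun pp : (ℕ × ℕ) × (ℕ × ℕ) => ((pp.1.1, pp.2.1), (pp.1.2, pp.2.2))) ?_ ?_
    · intro pp hpp
      have hpp' : pp ∈ E := hpp
      simp only [hE, hS, hP, Finset.mem_filter, Finset.mem_product] at hpp'
      obtain ⟨⟨⟨⟨hr1, hm1⟩, hb1'⟩, ⟨⟨hr2, hm2⟩, hb2'⟩⟩, hff⟩ := hpp'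
      obtain ⟨⟨hR1, _⟩, _, hcop1⟩ := hsupp _ _ hb1'
      obtain ⟨⟨hR2, _⟩, _, hcop2⟩ := hsupp _ _ hb2'
      show ((pp.1.1, pp.2.1), (pp.1.2, pp.2.2)) ∈ (Q : Set ((ℕ × ℕ) × (ℕ × ℕ)))
      rw [Finset.mem_coe]
      simp only [hQ, hIR, hIM, Finset.mem_filter, Finset.mem_product]
      refine ⟨⟨⟨⟨hr1, hR1⟩, ⟨hr2, hR2⟩⟩, hm1, hm2⟩, ?_⟩
      -- the congruence
      have hu1 : IsUnit ((pp.1.2 : ℕ) : ZMod q) := (ZMod.isUnit_iff_coprime _ q).mpr hcop1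
      have hu2 : IsUnit ((pp.2.2 : ℕ) : ZMod q) := (ZMod.isUnit_iff_coprime _ q).mpr hcop2
      have hff' : ((pp.1.1 : ℕ) : ZMod q) * ((pp.1.2 : ℕ) : ZMod q)⁻¹ =
          ((pp.2.1 : ℕ) : ZMod q) * ((pp.2.2 : ℕ) : ZMod q)⁻¹ := hff
      have hzmod : ((pp.1.1 : ℕ) : ZMod q) * ((pp.2.2 : ℕ) : ZMod q) =
          ((pp.2.1 : ℕ) : ZMod q) * ((pp.1.2 : ℕ) : ZMod q) := by
        have h := congrArg (fun t => t * (((pp.1.2 : ℕ) : ZMod q) * ((pp.2.2 : ℕ) : ZMod q))) hff'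
        calc ((pp.1.1 : ℕ) : ZMod q) * ((pp.2.2 : ℕ) : ZMod q)
            = ((pp.1.1 : ℕ) : ZMod q) * ((pp.1.2 : ℕ) : ZMod q)⁻¹ *
                (((pp.1.2 : ℕ) : ZMod q) * ((pp.2.2 : ℕ) : ZMod q)) := by
              rw [mul_assoc, ← mul_assoc (((pp.1.2 : ℕ) : ZMod q)⁻¹), ZMod.inv_mul_of_unit _ hu1,
                one_mul]
          _ = ((pp.2.1 : ℕ) : ZMod q) * ((pp.2.2 : ℕ) : ZMod q)⁻¹ *
                (((pp.1.2 : ℕ) : ZMod q) * ((pp.2.2 : ℕ) : ZMod q)) := h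
          _ = ((pp.2.1 : ℕ) : ZMod q) * ((pp.1.2 : ℕ) : ZMod q) := by
              rw [mul_comm (((pp.1.2 : ℕ) : ZMod q)), mul_assoc,
                ← mul_assoc (((pp.2.2 : ℕ) : ZMod q)⁻¹), ZMod.inv_mul_of_unit _ hu2, one_mul]
      have hcast : ((((pp.1.1 : ℕ) : ℤ) * ((pp.2.2 : ℕ) : ℤ) -
          ((pp.2.1 : ℕ) : ℤ) * ((pp.1.2 : ℕ) : ℤ) : ℤ) : ZMod q) = 0 := by
        push_cast
        rw [hzmod, sub_self]
      exact (ZMod.intCast_zmod_eq_zero_iff_dvd _ q).mp hcast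
    · intro pp _ pp' _ h
      simp only [Prod.mk.injEq] at h
      obtain ⟨⟨h1, h2⟩, h3, h4⟩ := h
      exact Prod.ext (Prod.ext h1 h3) (Prod.ext h2 h4)
  -- Step 4: the count (`card_quadruples_le`) and `1 + log 2R ≤ (2 + C/ε) q^ε`
  have hQle := card_quadruples_le hq hR hRM
  have hlog : 1 + Real.log (2 * R) ≤ (2 + C / ε) * (q : ℝ) ^ ε := by
    have hlog2 : Real.log 2 ≤ 1 := by
      have := Real.log_two_lt_d9; linarith
    have hlogR : Real.log R ≤ C * Real.log q := by
      calc Real.log R ≤ Real.log M := Real.log_le_log hR0 hRM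
        _ ≤ Real.log ((q : ℝ) ^ C) := Real.log_le_log hM0 hMq
        _ = C * Real.log q := Real.log_rpow hq0 C
    have hlogq : Real.log q ≤ (q : ℝ) ^ ε / ε := log_le_rpow_div hq1 hε
    have hqε : (1 : ℝ) ≤ (q : ℝ) ^ ε := Real.one_le_rpow hq1 hε.le
    rw [Real.log_mul (by norm_num) hR0.ne']
    have h5 : C * Real.log q ≤ C * ((q : ℝ) ^ ε / ε) := mul_le_mul_of_nonneg_left hlogq hC.le
    have h6 : C * ((q : ℝ) ^ ε / ε) = C / ε * (q : ℝ) ^ ε := by ring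
    calc 1 + (Real.log 2 + Real.log R) ≤ 2 + C / ε * (q : ℝ) ^ ε := by linarith
      _ ≤ 2 * (q : ℝ) ^ ε + C / ε * (q : ℝ) ^ ε := by linarith
      _ = (2 + C / ε) * (q : ℝ) ^ ε := by ring
  -- assemble
  calc ∑ x : ZMod q, ‖∑ r ∈ Icc 1 ⌊2 * R⌋₊, ∑ m ∈ Icc 1 ⌊2 * M⌋₊,
        (if (r : ZMod q) * (m : ZMod q)⁻¹ = x then b r m else 0)‖ ^ 2
      ≤ (E.card : ℝ) := h2
    _ ≤ (Q.card : ℝ) := by exact_mod_cast hEQ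
    _ ≤ 12 * (R * M) * (1 + Real.log (2 * R)) * (8 * (R * M) / q + 1) := hQle
    _ ≤ 12 * (R * M) * ((2 + C / ε) * (q : ℝ) ^ ε) * (8 * (R * M) / q + 1) := by
        gcongr
    _ = 96 * (2 + C / ε) * (q : ℝ) ^ ε * (R * M + R ^ 2 * M ^ 2 / q) -
        84 * (2 + C / ε) * (q : ℝ) ^ ε * (R * M) := by ring
    _ ≤ 96 * (2 + C / ε) * (q : ℝ) ^ ε * (R * M + R ^ 2 * M ^ 2 / q) := by
        have : 0 ≤ 84 * (2 + C / ε) * (q : ℝ) ^ ε * (R * M) := by positivity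
        linarith

/-- **(27) from Lemma 8 alone**: with Lemma 7 proved (`lemma7_holds`), the Range II bound (27) is a
theorem modulo the single named fact `lemma8` (26). [cite: BondarenkoHeap2026, eq. (27), TeX l.986–996] -/
theorem rangeII_bound_of_lemma8 (h8 : lemma8) : rangeII_bound :=
  rangeII_bound_of_lemma7_lemma8 lemma7_holds h8

/-- **(27), Range II — DISCHARGED** (TeX l.986–996): with Lemma 7 (`lemma7_holds`) and Lemma 8
(`lemma8_holds`, sibling `…CharacterSumsProofs`) both kernel theorems, the named fact `rangeII_bound`
holds outright. [cite: BondarenkoHeap2026, eq. (27), TeX l.986–996] -/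
theorem rangeII_bound_holds : rangeII_bound :=
  rangeII_bound_of_lemma7_lemma8 lemma7_holds lemma8_holds

section Lemma9Glue

open scoped ComplexConjugate
open Literature.NumberTheory.Sieve (ramanujanSum)
open DirichletCharacter

/-! ### Lemma 9: (32) from (30)–(31) by the Chinese remainder theorem — auxiliary lemmas -/

section JacobiAux

variable {n : ℕ} [NeZero n]

/-- A sum over the units of `ℤ/n` of a function vanishing off the units is the sum over `ℤ/n`.
[folklore] -/
private theorem sum_units_eq_sum_of_vanish (f : ZMod n → ℂ)
    (hf : ∀ t : ZMod n, ¬IsUnit t → f t = 0) :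
    ∑ u : (ZMod n)ˣ, f (u : ZMod n) = ∑ t : ZMod n, f t := by
  classical
  have h1 : ∑ u : (ZMod n)ˣ, f (u : ZMod n) =
      ∑ t ∈ Finset.univ.map ⟨((↑) : (ZMod n)ˣ → ZMod n), Units.val_injective⟩, f t := by
    rw [Finset.sum_map]
    rfl
  rw [h1]
  refine Finset.sum_subset (Finset.subset_univ _) fun t _ ht => hf t fun hu => ht ?_
  exact Finset.mem_map.mpr ⟨hu.unit, Finset.mem_univ _, by simp⟩

/-- **`T_ψ(y)` is a complete shifted correlation sum**: `T_ψ(y) = ∑_{m mod n} ψ̄(m) χ(m + y)`, i.e.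
the tree's `shiftSum ψ⁻¹ χ 1 y` (`ψ̄ = ψ⁻¹` on values, vanishing off the units).
[cite: BondarenkoHeap2026, §6.5, TeX l.1009] -/
theorem genJacobiSum_eq_shiftSum (χ ψ : DirichletCharacter ℂ n) (y : ZMod n) :
    genJacobiSum χ ψ y = shiftSum ψ⁻¹ χ 1 y := by
  rw [shiftSum_def, genJacobiSum]
  rw [← sum_units_eq_sum_of_vanish (fun t : ZMod n => ψ⁻¹ t * χ (1 * t + y)) (fun t ht => by
    rw [MulChar.map_nonunit _ ht, zero_mul])]
  refine Finset.sum_congr rfl fun u _ => ?_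
  rw [Literature.NumberTheory.Sieve.LargeSieve.conj_apply_eq_inv_apply, one_mul, mul_comm]

/-- Trivial bound for a complete shifted sum: `|∑_{m mod n} ψ₁(m)ψ₂(sm + t)| ≤ n` (the content of
"if `q` contains a factor of `2^ν` … this only changes the bound up to a constant", TeX l.1101–1105).
[cite: BondarenkoHeap2026, Lemma 9 (proof), TeX l.1101–1105] -/
theorem norm_shiftSum_le (ψ₁ ψ₂ : DirichletCharacter ℂ n) (s t : ZMod n) :
    ‖shiftSum ψ₁ ψ₂ s t‖ ≤ n := by
  rw [shiftSum_def]
  calc ‖∑ m : ZMod n, ψ₁ m * ψ₂ (s * m + t)‖ ≤ ∑ m : ZMod n, ‖ψ₁ m * ψ₂ (s * m + t)‖ :=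
        norm_sum_le _ _
    _ ≤ ∑ _m : ZMod n, (1 : ℝ) := by
        refine Finset.sum_le_sum fun m _ => ?_
        rw [norm_mul]
        calc ‖ψ₁ m‖ * ‖ψ₂ (s * m + t)‖ ≤ 1 * 1 :=
              mul_le_mul (ψ₁.norm_le_one _) (ψ₂.norm_le_one _) (norm_nonneg _) zero_le_one
          _ = 1 := one_mul 1
    _ = n := by simp [ZMod.card n]

end JacobiAux

/-- The second CRT component of `ψ⁻¹` is the inverse of that of `ψ` (components are group
homomorphisms in `χ`). [cite: MontgomeryVaughan2007, Lemma 9.3] -/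
theorem crtSnd_inv {a b : ℕ} (h : a.Coprime b) (ψ : DirichletCharacter ℂ (a * b)) :
    crtSnd h ψ⁻¹ = (crtSnd h ψ)⁻¹ := by
  refine MulChar.ext fun v => ?_
  rw [crtSnd_apply, MulChar.inv_apply_eq_inv', MulChar.inv_apply_eq_inv', crtSnd_apply]

/-- Reduction mod `b` of `r · m̄ (mod ab)` is `r · m̄ (mod b)` for `m` coprime to `ab`. [folklore] -/
private theorem cast_intCast_mul_inv_natCast {a b : ℕ} [NeZero (a * b)] [NeZero b] (r : ℤ) {m : ℕ}
    (hm : m.Coprime (a * b)) :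
    (ZMod.cast ((r : ZMod (a * b)) * (m : ZMod (a * b))⁻¹) : ZMod b) =
      (r : ZMod b) * (m : ZMod b)⁻¹ := by
  have hdvd : b ∣ a * b := dvd_mul_left b a
  have hmu : IsUnit (m : ZMod (a * b)) := (ZMod.isUnit_iff_coprime m (a * b)).mpr hm
  have hmb : IsUnit (m : ZMod b) := (ZMod.isUnit_iff_coprime m b).mpr (hm.coprime_dvd_right hdvd)
  rw [ZMod.cast_mul hdvd, ZMod.cast_intCast hdvd]
  congr 1
  -- the cast of `m̄` is an inverse of the cast of `m`
  have hprod : (ZMod.cast ((m : ZMod (a * b))⁻¹) : ZMod b) * (m : ZMod b) = 1 := by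
    have h1 : (ZMod.cast ((m : ZMod (a * b))⁻¹ * (m : ZMod (a * b))) : ZMod b) = 1 := by
      rw [ZMod.inv_mul_of_unit _ hmu, ZMod.cast_one hdvd]
    rw [ZMod.cast_mul hdvd, ZMod.cast_natCast hdvd] at h1
    exact h1
  calc (ZMod.cast ((m : ZMod (a * b))⁻¹) : ZMod b)
      = (ZMod.cast ((m : ZMod (a * b))⁻¹) : ZMod b) * ((m : ZMod b) * (m : ZMod b)⁻¹) := by
        rw [ZMod.mul_inv_of_unit _ hmb, mul_one]
    _ = (m : ZMod b)⁻¹ := by rw [← mul_assoc, hprod, one_mul]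

/-- **Kluyver's bound**: `|c_n(h)| ≤ ∑_{d ∣ n, d ∣ h} d`, from `c_n(h) = ∑_{d ∣ (n,h)} d μ(n/d)`
(Montgomery–Vaughan Thm 4.1 (4.7), the tree's `ramanujanSum_eq_ramanujanDivisorSum`).
[cite: MontgomeryVaughan2007, Thm 4.1 eq. (4.7), p. 110] -/
theorem norm_ramanujanSum_le_sum_divisors (n : ℕ) (h : ℤ) :
    ‖ramanujanSum n h‖ ≤ ∑ d ∈ n.divisors, (if (d : ℤ) ∣ h then (d : ℝ) else 0) := by
  rw [Literature.NumberTheory.Sieve.ramanujanSum_eq_ramanujanDivisorSum,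
    Literature.NumberTheory.Sieve.ramanujanDivisorSum_apply, Complex.norm_intCast]
  push_cast
  rw [Nat.sum_divisorsAntidiagonal' (fun x y => (ArithmeticFunction.moebius x : ℝ) *
    (if y ∣ h.natAbs then (y : ℝ) else 0))]
  refine (Finset.abs_sum_le_sum_abs _ _).trans (Finset.sum_le_sum fun d hd => ?_)
  have hdvd : d ∣ h.natAbs ↔ (d : ℤ) ∣ h := Int.natCast_dvd.symm
  rw [abs_mul]
  by_cases hdh : (d : ℤ) ∣ h
  · rw [if_pos (hdvd.mpr hdh), if_pos hdh, Nat.abs_cast]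
    have hμ : |(ArithmeticFunction.moebius (n / d) : ℝ)| ≤ 1 := by
      have := ArithmeticFunction.abs_moebius_le_one (n := n / d)
      exact_mod_cast this
    calc |(ArithmeticFunction.moebius (n / d) : ℝ)| * (d : ℝ) ≤ 1 * d :=
          mul_le_mul_of_nonneg_right hμ (Nat.cast_nonneg d)
      _ = d := one_mul _
  · rw [if_neg (fun h' => hdh (hdvd.mp h')), if_neg hdh, abs_zero, mul_zero]

/-- `∑_{1 ≤ r ≤ N} ∑_{d ∣ Q, d ∣ sr} d ≤ N · d(Q)` for `s = ±1` (each `d ∣ Q` divides `⌊N/d⌋` of the `r`).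
[cite: BondarenkoHeap2026, Lemma 9 (proof), TeX l.1093–1096] -/
theorem sum_sum_divisors_dvd_le {s : ℤ} (hs : s = 1 ∨ s = -1) (Q N : ℕ) :
    ∑ r ∈ Icc 1 N, ∑ d ∈ Q.divisors, (if (d : ℤ) ∣ s * r then (d : ℝ) else 0) ≤
      (N : ℝ) * Q.divisors.card := by
  classical
  have hiff : ∀ (d r : ℕ), ((d : ℤ) ∣ s * r) ↔ d ∣ r := by
    intro d r
    rcases hs with rfl | rfl
    · rw [one_mul]; exact Int.natCast_dvd_natCast
    · rw [neg_one_mul, Int.dvd_neg]; exact Int.natCast_dvd_natCast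
  simp_rw [hiff]
  rw [Finset.sum_comm]
  have hinner : ∀ d ∈ Q.divisors, (∑ r ∈ Icc 1 N, if d ∣ r then (d : ℝ) else 0) ≤ N := by
    intro d _
    have hIcc : (Icc 1 N : Finset ℕ) = Ioc 0 N := by
      ext a; simp only [Finset.mem_Icc, Finset.mem_Ioc]; omega
    rw [← Finset.sum_filter, Finset.sum_const, nsmul_eq_mul, hIcc, Nat.Ioc_filter_dvd_card_eq_div]
    have h : N / d * d ≤ N := Nat.div_mul_le_self N d
    exact_mod_cast h
  calc ∑ d ∈ Q.divisors, ∑ r ∈ Icc 1 N, (if d ∣ r then (d : ℝ) else 0)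
      ≤ ∑ _d ∈ Q.divisors, (N : ℝ) := Finset.sum_le_sum hinner
    _ = (N : ℝ) * Q.divisors.card := by rw [Finset.sum_const, nsmul_eq_mul]; ring

/-- `q/φ(q) ≪_ε q^ε` ("division by `φ(q) = q^{1−o(1)}`", TeX l.1097): from the tree's
`φ(q)/q > δ₀/log log q` for `q ≥ 3` (Hardy–Wright Thm 328, `MertensBound.exists_lt_totient_div_self`)
and `log log q ≤ log q ≤ q^ε/ε`. [cite: HardyWright2008, Thm 328] -/
theorem exists_self_div_totient_le_rpow {ε : ℝ} (hε : 0 < ε) :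
    ∃ C : ℝ, 0 < C ∧ ∀ q : ℕ, q ≠ 0 → (q : ℝ) / Nat.totient q ≤ C * (q : ℝ) ^ ε := by
  obtain ⟨δ₀, hδ₀, Hφ⟩ := MertensBound.exists_lt_totient_div_self
  refine ⟨2 + 1 / (ε * δ₀), by positivity, fun q hq => ?_⟩
  have hq1 : (1 : ℝ) ≤ q := by exact_mod_cast Nat.one_le_iff_ne_zero.mpr hq
  have hqε : (1 : ℝ) ≤ (q : ℝ) ^ ε := Real.one_le_rpow hq1 hε.le
  have hφpos : (0 : ℝ) < Nat.totient q := by exact_mod_cast Nat.totient_pos.mpr (Nat.pos_of_ne_zero hq)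
  by_cases h3 : 3 ≤ q
  · have h := Hφ q h3
    have hq3 : (3 : ℝ) ≤ q := by exact_mod_cast h3
    have hlogq : 1 < Real.log q := by
      rw [Real.lt_log_iff_exp_lt (by linarith)]
      have := Real.exp_one_lt_d9; linarith
    have hll0 : 0 < Real.log (Real.log q) := Real.log_pos hlogq
    have hllq : Real.log (Real.log q) ≤ Real.log q :=
      (Real.log_le_sub_one_of_pos (by linarith)).trans (by linarith)
    have hlq : Real.log q ≤ (q : ℝ) ^ ε / ε := by
      have hu0 : (0 : ℝ) < q := by linarith
      have h' := Real.log_le_sub_one_of_pos (Real.rpow_pos_of_pos hu0 ε)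
      rw [Real.log_rpow hu0] at h'
      rw [le_div_iff₀ hε]; linarith
    -- `q/φ(q) < log log q / δ₀ ≤ (q^ε/ε)/δ₀`
    have hq0 : (0 : ℝ) < q := by linarith
    have h1 : (q : ℝ) / Nat.totient q < Real.log (Real.log q) / δ₀ := by
      rw [div_lt_div_iff₀ hll0 hq0] at h
      rw [div_lt_div_iff₀ hφpos hδ₀]
      linarith
    have h2 : Real.log (Real.log q) / δ₀ ≤ ((q : ℝ) ^ ε / ε) / δ₀ :=
      div_le_div_of_nonneg_right (hllq.trans hlq) hδ₀.le
    have h3' : ((q : ℝ) ^ ε / ε) / δ₀ = 1 / (ε * δ₀) * (q : ℝ) ^ ε := by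
      field_simp
    calc (q : ℝ) / Nat.totient q ≤ ((q : ℝ) ^ ε / ε) / δ₀ := (h1.trans_le h2).le
      _ = 1 / (ε * δ₀) * (q : ℝ) ^ ε := h3'
      _ ≤ (2 + 1 / (ε * δ₀)) * (q : ℝ) ^ ε := by nlinarith
  · -- `q ∈ {1, 2}`: `φ(q) = 1`, `q/φ(q) = q ≤ 2`
    have hq2 : q ≤ 2 := by omega
    have hφ1 : 1 ≤ Nat.totient q := Nat.totient_pos.mpr (Nat.pos_of_ne_zero hq)
    have hA : (q : ℝ) / Nat.totient q ≤ 2 := by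
      rw [div_le_iff₀ hφpos]
      have : (q : ℝ) ≤ 2 := by exact_mod_cast hq2
      have : (1 : ℝ) ≤ Nat.totient q := by exact_mod_cast hφ1
      nlinarith
    have hpos : 0 ≤ 1 / (ε * δ₀) * (q : ℝ) ^ ε := by positivity
    nlinarith

/-- **Pointwise bound for `T_ψ(r m̄)` from Lemma 9 (30)–(31) by the CRT** (TeX l.1066–1105): write
`q = 2^ν Q` (`Q` odd square-free, `ν ∈ {0,2,3}`); `T_ψ` factorises into its CRT components
(`shiftSum_eq_mul_of_coprime`), the factor mod `2^ν` has modulus `≤ 2^ν ≤ 8` ("this only changes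
the bound up to a constant", l.1105), and the factor mod `Q` is (30):
`J_{q_ψ}(ψ) λ_ψ(r) λ̄_ψ(m) c_{s_ψ}(r)` with `|J| ≤ √q_ψ ≤ √Q` (resp. `≤ 1` for `ψ ∈ {ψ₀, χ}`),
`|λ_ψ| ≤ 1` and `|c_{s_ψ}(r)| ≤ ∑_{d ∣ Q, d ∣ r} d` (Kluyver). A theorem CONDITIONAL on the named fact
`lemma9_exact`. [cite: BondarenkoHeap2026, Lemma 9, eq. (30)–(31), TeX l.1026–1105] -/
theorem norm_genJacobiSum_le_of_lemma9_exact (h9 : lemma9_exact) {q : ℕ} [NeZero q] {ν Q : ℕ}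
    (hq : q = 2 ^ ν * Q) (hν : ν = 0 ∨ ν = 2 ∨ ν = 3) (hQodd : Odd Q) (hQsf : Squarefree Q)
    (χ : DirichletCharacter ℂ q) (hχp : χ.IsPrimitive) (hχq : χ.IsQuadratic)
    (ψ : DirichletCharacter ℂ q) {r : ℤ} (hr : r ≠ 0) {m : ℕ} (hm : m.Coprime q) :
    ‖genJacobiSum χ ψ ((r : ZMod q) * (m : ZMod q)⁻¹)‖ ≤
      8 * (if ψ = 1 ∨ ψ = χ then 1 else Real.sqrt Q) *
        ∑ d ∈ Q.divisors, (if (d : ℤ) ∣ r then (d : ℝ) else 0) := by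
  classical
  subst hq
  have hQ0 : Q ≠ 0 := by rintro rfl; exact (Nat.not_odd_zero hQodd).elim
  haveI : NeZero Q := ⟨hQ0⟩
  haveI : NeZero (2 ^ ν) := ⟨pow_ne_zero _ two_ne_zero⟩
  have hcop : (2 ^ ν).Coprime Q := (Nat.coprime_two_left.mpr hQodd).pow_left ν
  have hQdvd : Q ∣ 2 ^ ν * Q := dvd_mul_left Q (2 ^ ν)
  set A : ℝ := (if ψ = 1 ∨ ψ = χ then 1 else Real.sqrt Q) with hA
  set K : ℝ := ∑ d ∈ Q.divisors, (if (d : ℤ) ∣ r then (d : ℝ) else 0) with hK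
  have hK0 : 0 ≤ K := Finset.sum_nonneg fun d _ => by split_ifs <;> positivity
  have hA0 : 0 ≤ A := by rw [hA]; split_ifs <;> positivity
  set y : ZMod (2 ^ ν * Q) := (r : ZMod (2 ^ ν * Q)) * (m : ZMod (2 ^ ν * Q))⁻¹ with hy
  rw [genJacobiSum_eq_shiftSum, shiftSum_eq_mul_of_coprime hcop, norm_mul]
  -- first factor: trivially `≤ 2^ν ≤ 8`
  have h2ν : ((2 ^ ν : ℕ) : ℝ) ≤ 8 := by
    rcases hν with rfl | rfl | rfl <;> norm_num
  have hF1 : ∀ (s t : ZMod (2 ^ ν)),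
      ‖shiftSum (crtFst hcop ψ⁻¹) (crtFst hcop χ) s t‖ ≤ 8 :=
    fun s t => (norm_shiftSum_le _ _ s t).trans h2ν
  -- second factor: Lemma 9 (30)–(31) at the odd square-free modulus `Q`
  have hF2 : ‖shiftSum (crtSnd hcop ψ⁻¹) (crtSnd hcop χ)
      (ZMod.cast (1 : ZMod (2 ^ ν * Q)) : ZMod Q) (ZMod.cast y : ZMod Q)‖ ≤ A * K := by
    rw [crtSnd_inv, ZMod.cast_one hQdvd, hy, cast_intCast_mul_inv_natCast r hm,
      ← genJacobiSum_eq_shiftSum]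
    obtain ⟨hid, hJ, hJsp⟩ := h9 Q hQodd hQsf (crtSnd hcop χ) (isPrimitive_crtSnd hcop hχp)
      (IsQuadratic.crtSnd hcop hχq) (crtSnd hcop ψ)
    have hmQ : IsCoprime (m : ℤ) (Q : ℤ) :=
      Nat.isCoprime_iff_coprime.mpr (hm.coprime_dvd_right hQdvd)
    have hid' := hid r (m : ℤ) hr hmQ
    rw [Int.cast_natCast] at hid'
    rw [hid', norm_mul, norm_mul, norm_mul]
    have hl1 : ‖jacobiTwist (crtSnd hcop χ) (crtSnd hcop ψ)
        (r : ZMod (jacobiConductor (crtSnd hcop χ) (crtSnd hcop ψ)))‖ ≤ 1 :=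
      DirichletCharacter.norm_le_one _ _
    have hl2 : ‖(starRingEnd ℂ) (jacobiTwist (crtSnd hcop χ) (crtSnd hcop ψ)
        ((m : ℤ) : ZMod (jacobiConductor (crtSnd hcop χ) (crtSnd hcop ψ))))‖ ≤ 1 := by
      rw [RCLike.norm_conj]
      exact DirichletCharacter.norm_le_one _ _
    have hsψ : jacobiComplement (crtSnd hcop χ) (crtSnd hcop ψ) ∣ Q :=
      Nat.div_dvd_of_dvd (DirichletCharacter.conductor_dvd_level _)
    have hc : ‖ramanujanSum (jacobiComplement (crtSnd hcop χ) (crtSnd hcop ψ)) r‖ ≤ K := by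
      refine (norm_ramanujanSum_le_sum_divisors _ r).trans ?_
      refine Finset.sum_le_sum_of_subset_of_nonneg (Nat.divisors_subset_of_dvd hQ0 hsψ) ?_
      intro d _ _
      split_ifs <;> positivity
    have hJ' : ‖jacobiFactor (crtSnd hcop χ) (crtSnd hcop ψ)‖ ≤ A := by
      rw [hA]
      split_ifs with hsp
      · apply hJsp
        rcases hsp with rfl | rfl
        · exact Or.inl (crtSnd_one hcop)
        · exact Or.inr rfl
      · refine hJ.trans (Real.sqrt_le_sqrt ?_)
        exact_mod_cast Nat.le_of_dvd (Nat.pos_of_ne_zero hQ0)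
          (DirichletCharacter.conductor_dvd_level _)
    have hJ0 : 0 ≤ ‖jacobiFactor (crtSnd hcop χ) (crtSnd hcop ψ)‖ := norm_nonneg _
    calc ‖jacobiFactor (crtSnd hcop χ) (crtSnd hcop ψ)‖ *
          ‖jacobiTwist (crtSnd hcop χ) (crtSnd hcop ψ)
            (r : ZMod (jacobiConductor (crtSnd hcop χ) (crtSnd hcop ψ)))‖ *
          ‖(starRingEnd ℂ) (jacobiTwist (crtSnd hcop χ) (crtSnd hcop ψ)
            ((m : ℤ) : ZMod (jacobiConductor (crtSnd hcop χ) (crtSnd hcop ψ))))‖ *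
          ‖ramanujanSum (jacobiComplement (crtSnd hcop χ) (crtSnd hcop ψ)) r‖
        ≤ A * 1 * 1 * K := by
          gcongr
      _ = A * K := by ring
  calc ‖shiftSum (crtFst hcop ψ⁻¹) (crtFst hcop χ) (ZMod.cast (1 : ZMod (2 ^ ν * Q)))
          (ZMod.cast y)‖ *
        ‖shiftSum (crtSnd hcop ψ⁻¹) (crtSnd hcop χ) (ZMod.cast (1 : ZMod (2 ^ ν * Q)))
          (ZMod.cast y)‖ ≤ 8 * (A * K) :=
        mul_le_mul (hF1 _ _) hF2 (norm_nonneg _) (by norm_num)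
    _ = 8 * A * K := by ring

/-- **Lemma 9, (32) from (30)–(31)** (TeX l.1049–1105): "Thus, for coefficients `b_m`, `c_r` of
modulus at most `1`, `(1/φ(q))|∑_{r≍R}∑_{m≍M} c_r b_m T_ψ(r m̄)| ≪ q^ε RM · {q^{−1/2}; q^{−1} (ψ ∈
{ψ₀,χ})}`. The bound (32) also holds for fundamental discriminant conductors with a factor `4` or
`8`" — PROVED from the named fact `lemma9_exact` ((30)–(31), odd square-free moduli): the CRT
pointwise bound `norm_genJacobiSum_le_of_lemma9_exact` (the `2^ν`-factor costs only the constant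
`8`), then "when summing over `m, r` we use `∑_{0<|r|⩽R} |c_s(r)| ⩽ ∑ (r,s) ≪ Rq^ε`"
(`sum_sum_divisors_dvd_le`, the tree's divisor bound `Sieve.exists_card_divisors_le_mul_rpow`) and
"division by `φ(q) = q^{1−o(1)}`" (`exists_self_div_totient_le_rpow`). Constant
`C = 32 C_d(ε/2) C_φ(ε/2)`. [cite: BondarenkoHeap2026, Lemma 9, eq. (32), TeX l.1049–1105] -/
theorem lemma9_bound_of_lemma9_exact (h9 : lemma9_exact) : lemma9_bound := by
  classical
  intro ε hε
  obtain ⟨Cd, hCd1, hCd⟩ :=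
    Literature.NumberTheory.Sieve.exists_card_divisors_le_mul_rpow (half_pos hε)
  obtain ⟨Cφ, hCφ, hφ⟩ := exists_self_div_totient_le_rpow (half_pos hε)
  refine ⟨32 * Cd * Cφ, by positivity, ?_⟩
  intro q _ χ hχp hχq ψ R M hR hM s hs b c hb hc hbsupp hcsupp
  obtain ⟨ν, Q, hq, hν, hQodd, hQsf⟩ := modulus_eq_two_pow_mul_odd_squarefree hχp hχq
  have hQ0 : Q ≠ 0 := by rintro rfl; exact (Nat.not_odd_zero hQodd).elim
  have hq0n : q ≠ 0 := NeZero.ne q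
  have hq0 : (0 : ℝ) < q := by exact_mod_cast Nat.pos_of_ne_zero hq0n
  have hq1 : (1 : ℝ) ≤ q := by exact_mod_cast Nat.one_le_iff_ne_zero.mpr hq0n
  have hQq : (Q : ℝ) ≤ q := by
    have h2 : 1 ≤ 2 ^ ν := Nat.one_le_two_pow
    have : Q ≤ q := by rw [hq]; exact Nat.le_mul_of_pos_left Q (by omega)
    exact_mod_cast this
  have hR0 : 0 < R := by linarith
  have hM0 : 0 < M := by linarith
  have hNR : (⌊2 * R⌋₊ : ℝ) ≤ 2 * R := Nat.floor_le (by linarith)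
  have hNM : (⌊2 * M⌋₊ : ℝ) ≤ 2 * M := Nat.floor_le (by linarith)
  set A : ℝ := (if ψ = 1 ∨ ψ = χ then 1 else Real.sqrt Q) with hA
  have hA0 : 0 ≤ A := by rw [hA]; split_ifs <;> positivity
  set K : ℕ → ℝ := fun r => ∑ d ∈ Q.divisors, (if (d : ℤ) ∣ s * (r : ℤ) then (d : ℝ) else 0)
    with hK
  have hK0 : ∀ r, 0 ≤ K r := fun r => Finset.sum_nonneg fun d _ => by split_ifs <;> positivity
  have hs0 : (s : ℤ) ≠ 0 := by rcases hs with rfl | rfl <;> norm_num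
  -- pointwise bound for the summands
  have hpt : ∀ r ∈ Icc 1 ⌊2 * R⌋₊, ∀ m ∈ Icc 1 ⌊2 * M⌋₊,
      ‖c r * b m * genJacobiSum χ ψ (((s * r : ℤ) : ZMod q) * (m : ZMod q)⁻¹)‖ ≤
        8 * A * K r := by
    intro r hr m _
    rw [Finset.mem_Icc] at hr
    by_cases hbm : b m = 0
    · rw [hbm, mul_zero, zero_mul, norm_zero]
      exact mul_nonneg (by positivity) (hK0 r)
    · obtain ⟨_, hcop⟩ := hbsupp m hbm
      have hr0 : (s * r : ℤ) ≠ 0 := mul_ne_zero hs0 (by exact_mod_cast (by omega : r ≠ 0))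
      have hT := norm_genJacobiSum_le_of_lemma9_exact h9 hq hν hQodd hQsf χ hχp hχq ψ hr0 hcop
      calc ‖c r * b m * genJacobiSum χ ψ (((s * r : ℤ) : ZMod q) * (m : ZMod q)⁻¹)‖
          = ‖c r‖ * ‖b m‖ *
              ‖genJacobiSum χ ψ (((s * r : ℤ) : ZMod q) * (m : ZMod q)⁻¹)‖ := by
            rw [norm_mul, norm_mul]
        _ ≤ 1 * 1 * (8 * A * K r) :=
            mul_le_mul (mul_le_mul (hc r) (hb m) (norm_nonneg _) zero_le_one) hT
              (norm_nonneg _) (by norm_num)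
        _ = 8 * A * K r := by ring
  -- summing: `‖S‖ ≤ 32 A · RM · d(Q)`
  have hKsum : ∑ r ∈ Icc 1 ⌊2 * R⌋₊, K r ≤ (⌊2 * R⌋₊ : ℝ) * Q.divisors.card :=
    sum_sum_divisors_dvd_le hs Q ⌊2 * R⌋₊
  have hS : ‖∑ r ∈ Icc 1 ⌊2 * R⌋₊, ∑ m ∈ Icc 1 ⌊2 * M⌋₊,
      c r * b m * genJacobiSum χ ψ (((s * r : ℤ) : ZMod q) * (m : ZMod q)⁻¹)‖ ≤
      32 * A * (R * M) * Q.divisors.card := by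
    calc ‖∑ r ∈ Icc 1 ⌊2 * R⌋₊, ∑ m ∈ Icc 1 ⌊2 * M⌋₊,
          c r * b m * genJacobiSum χ ψ (((s * r : ℤ) : ZMod q) * (m : ZMod q)⁻¹)‖
        ≤ ∑ r ∈ Icc 1 ⌊2 * R⌋₊, ∑ m ∈ Icc 1 ⌊2 * M⌋₊,
            ‖c r * b m * genJacobiSum χ ψ (((s * r : ℤ) : ZMod q) * (m : ZMod q)⁻¹)‖ :=
          (norm_sum_le _ _).trans (Finset.sum_le_sum fun r _ => norm_sum_le _ _)
      _ ≤ ∑ r ∈ Icc 1 ⌊2 * R⌋₊, ∑ _m ∈ Icc 1 ⌊2 * M⌋₊, 8 * A * K r :=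
          Finset.sum_le_sum fun r hr => Finset.sum_le_sum fun m hm => hpt r hr m hm
      _ = (⌊2 * M⌋₊ : ℝ) * (8 * A) * ∑ r ∈ Icc 1 ⌊2 * R⌋₊, K r := by
          rw [Finset.mul_sum]
          refine Finset.sum_congr rfl fun r _ => ?_
          rw [Finset.sum_const, Nat.card_Icc, nsmul_eq_mul]
          push_cast
          ring
      _ ≤ (2 * M) * (8 * A) * ((⌊2 * R⌋₊ : ℝ) * Q.divisors.card) := by
          gcongr
      _ ≤ (2 * M) * (8 * A) * ((2 * R) * Q.divisors.card) := by
          gcongr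
      _ = 32 * A * (R * M) * Q.divisors.card := by ring
  -- constants: `d(Q) · q/φ(q) ≤ C_d C_φ q^ε`
  have hdQ : (Q.divisors.card : ℝ) ≤ Cd * (q : ℝ) ^ (ε / 2) := by
    refine (hCd Q hQ0).trans ?_
    exact mul_le_mul_of_nonneg_left
      (Real.rpow_le_rpow (Nat.cast_nonneg Q) hQq (by positivity)) (by linarith)
  have hφq : (q : ℝ) / Nat.totient q ≤ Cφ * (q : ℝ) ^ (ε / 2) := hφ q hq0n
  have hφpos : (0 : ℝ) < Nat.totient q := by
    exact_mod_cast Nat.totient_pos.mpr (Nat.pos_of_ne_zero hq0n)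
  have hkey : (Nat.totient q : ℝ)⁻¹ * (Q.divisors.card : ℝ) ≤ Cd * Cφ * (q : ℝ) ^ ε / q := by
    have h1 : (Nat.totient q : ℝ)⁻¹ = ((q : ℝ) / Nat.totient q) / q := by
      rw [div_right_comm, div_self hq0.ne', one_div]
    rw [h1, div_mul_eq_mul_div, div_le_div_iff_of_pos_right hq0]
    have hε2 : (q : ℝ) ^ (ε / 2) * (q : ℝ) ^ (ε / 2) = (q : ℝ) ^ ε := by
      rw [← Real.rpow_add hq0]; ring_nf
    calc (q : ℝ) / Nat.totient q * (Q.divisors.card : ℝ)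
        ≤ (Cφ * (q : ℝ) ^ (ε / 2)) * (Cd * (q : ℝ) ^ (ε / 2)) :=
          mul_le_mul hφq hdQ (Nat.cast_nonneg _) (by positivity)
      _ = Cd * Cφ * (q : ℝ) ^ ε := by rw [← hε2]; ring
  -- assemble
  have hAq : A / q ≤ (if ψ = 1 ∨ ψ = χ then (q : ℝ)⁻¹ else ((q : ℝ) ^ (1 / 2 : ℝ))⁻¹) := by
    rw [hA]
    split_ifs with hsp
    · rw [one_div]
    · -- `√Q / q ≤ √q / q = (q^{1/2})⁻¹`
      have hsq : Real.sqrt Q ≤ Real.sqrt q := Real.sqrt_le_sqrt hQq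
      have hsqq : Real.sqrt (q : ℝ) = (q : ℝ) ^ (1 / 2 : ℝ) := Real.sqrt_eq_rpow (q : ℝ)
      have hhalf : (q : ℝ) ^ (1 / 2 : ℝ) * (q : ℝ) ^ (1 / 2 : ℝ) = q := by
        rw [← Real.rpow_add hq0]; norm_num
      have hpos : 0 < (q : ℝ) ^ (1 / 2 : ℝ) := by positivity
      calc Real.sqrt Q / q ≤ Real.sqrt q / q := div_le_div_of_nonneg_right hsq hq0.le
        _ = ((q : ℝ) ^ (1 / 2 : ℝ))⁻¹ := by
            rw [hsqq, div_eq_iff hq0.ne', eq_comm, inv_mul_eq_iff_eq_mul₀ hpos.ne']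
            exact hhalf.symm
  calc (Nat.totient q : ℝ)⁻¹ * ‖∑ r ∈ Icc 1 ⌊2 * R⌋₊, ∑ m ∈ Icc 1 ⌊2 * M⌋₊,
          c r * b m * genJacobiSum χ ψ (((s * r : ℤ) : ZMod q) * (m : ZMod q)⁻¹)‖
      ≤ (Nat.totient q : ℝ)⁻¹ * (32 * A * (R * M) * Q.divisors.card) :=
        mul_le_mul_of_nonneg_left hS (by positivity)
    _ = 32 * A * (R * M) * ((Nat.totient q : ℝ)⁻¹ * (Q.divisors.card : ℝ)) := by ring
    _ ≤ 32 * A * (R * M) * (Cd * Cφ * (q : ℝ) ^ ε / q) :=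
        mul_le_mul_of_nonneg_left hkey (by positivity)
    _ = 32 * Cd * Cφ * (q : ℝ) ^ ε * (R * M) * (A / q) := by ring
    _ ≤ 32 * Cd * Cφ * (q : ℝ) ^ ε * (R * M) *
          (if ψ = 1 ∨ ψ = χ then (q : ℝ)⁻¹ else ((q : ℝ) ^ (1 / 2 : ℝ))⁻¹) :=
        mul_le_mul_of_nonneg_left hAq (by positivity)

end Lemma9Glue

section Lemma9Proof

open scoped ComplexConjugate
open Literature.NumberTheory.Sieve (ramanujanSum)
open DirichletCharacter

/-! ### Lemma 9, (32) proved outright: local Jacobi-sum bounds and the CRT -/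

section LocalPrime

variable {P : ℕ} [Fact P.Prime]

/-- A non-principal character of prime modulus is primitive. [cite: MontgomeryVaughan2007, §9.1] -/
private theorem isPrimitive_of_ne_one_prime {χ : DirichletCharacter ℂ P} (hχ : χ ≠ 1) :
    χ.IsPrimitive := by
  rcases (Fact.out : P.Prime).eq_one_or_self_of_dvd _ (DirichletCharacter.conductor_dvd_level χ)
    with h | h
  · exact absurd (DirichletCharacter.eq_one_iff_conductor_eq_one.mpr h) hχ
  · exact h

/-- `|g(χ)| = √P` for a non-principal character mod a prime `P` (the tree's
`LargeSieve.norm_gaussSum_sq`). [cite: CojocaruMurty2005, (8.15)] -/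
private theorem norm_gaussSum_eq_sqrt {χ : DirichletCharacter ℂ P} (hχ : χ ≠ 1) :
    ‖gaussSum χ (ZMod.stdAddChar (N := P))‖ = Real.sqrt P := by
  have h := Literature.NumberTheory.Sieve.LargeSieve.norm_gaussSum_sq
    (isPrimitive_of_ne_one_prime (P := P) hχ)
  rw [← h, Real.sqrt_sq (norm_nonneg _)]

/-- **Local Jacobi-sum bound** (TeX l.1077–1086: "the Jacobi factor has absolute value at most
`√p` by the well-known beta function analogy `J(χ₁,χ₂) = G(χ₁)G(χ₂)/G(χ₁χ₂)`"; the degenerate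
cases `ψ = χ₀`, `ψ = χ` give `∓1`): for the quadratic character `χ ≠ χ₀` of `ℤ/P` and ANY
character `ψ`, `|J(ψ, χ)| ≤ √P`. [cite: BondarenkoHeap2026, Lemma 9 (proof), TeX l.1077–1086] -/
theorem norm_jacobiSum_le_sqrt {χ : DirichletCharacter ℂ P} (hχ1 : χ ≠ 1)
    (ψ : DirichletCharacter ℂ P) : ‖jacobiSum ψ χ‖ ≤ Real.sqrt P := by
  have hP1 : (1 : ℝ) ≤ Real.sqrt P := by
    rw [show (1 : ℝ) = Real.sqrt 1 by simp]
    exact Real.sqrt_le_sqrt (by exact_mod_cast (Fact.out : P.Prime).one_le)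
  by_cases hψ1 : ψ = 1
  · subst hψ1
    rw [jacobiSum_one_nontrivial hχ1, norm_neg, norm_one]
    exact hP1
  by_cases hψχ : ψ * χ = 1
  · have hψ : ψ = χ⁻¹ := eq_inv_of_mul_eq_one_left hψχ
    rw [hψ, jacobiSum_comm, jacobiSum_nontrivial_inv hχ1, norm_neg]
    exact (χ.norm_le_one (-1)).trans hP1
  · have hcard : (Fintype.card (ZMod P) : ℂ) ≠ 0 := by
      rw [ZMod.card]; exact Nat.cast_ne_zero.mpr (Fact.out : P.Prime).ne_zero
    rw [jacobiSum_eq_gaussSum_mul_gaussSum_div_gaussSum hcard hψχ (ZMod.isPrimitive_stdAddChar P),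
      norm_div, norm_mul, norm_gaussSum_eq_sqrt hψ1, norm_gaussSum_eq_sqrt hχ1,
      norm_gaussSum_eq_sqrt hψχ]
    have hP0 : 0 < Real.sqrt P := by linarith
    rw [div_le_iff₀ hP0]

/-- **Local bound at an odd prime** for `∑_{m mod P} ψ(m) χ(m + t)`, `χ` the quadratic character,
`ψ` arbitrary: `≤ P` if `t = 0` (trivially) and `≤ √P` otherwise (`= ψ(−t)χ(t)J(ψ,χ)`,
`sum_mul_shift_eq_jacobiSum`). [cite: BondarenkoHeap2026, Lemma 9 (proof), TeX l.1066–1086] -/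
theorem norm_sum_mul_quad_shift_le {χ : DirichletCharacter ℂ P}
    (hχ1 : χ ≠ 1) (ψ : DirichletCharacter ℂ P) (t : ZMod P) :
    ‖∑ m : ZMod P, ψ m * χ (m + t)‖ ≤ if t = 0 then (P : ℝ) else Real.sqrt P := by
  split_ifs with ht
  · calc ‖∑ m : ZMod P, ψ m * χ (m + t)‖ ≤ ∑ m : ZMod P, ‖ψ m * χ (m + t)‖ := norm_sum_le _ _
      _ ≤ ∑ _m : ZMod P, (1 : ℝ) := by
          refine Finset.sum_le_sum fun m _ => ?_
          rw [norm_mul]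
          calc ‖ψ m‖ * ‖χ (m + t)‖ ≤ 1 * 1 :=
                mul_le_mul (ψ.norm_le_one _) (χ.norm_le_one _) (norm_nonneg _) zero_le_one
            _ = 1 := one_mul 1
      _ = P := by simp [ZMod.card P]
  · have key := sum_mul_shift_eq_jacobiSum ψ χ (σ := 1) (by norm_num) ht
    simp only [one_mul] at key
    rw [key, norm_mul, norm_mul]
    calc ‖ψ (-1 * t)‖ * ‖χ t‖ * ‖jacobiSum ψ χ‖ ≤ 1 * 1 * Real.sqrt P :=
          mul_le_mul (mul_le_mul (ψ.norm_le_one _) (χ.norm_le_one _) (norm_nonneg _) zero_le_one)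
            (norm_jacobiSum_le_sqrt hχ1 ψ) (norm_nonneg _) (by norm_num)
      _ = Real.sqrt P := by ring

/-- **Local bound, special characters**: for `ψ ∈ {χ₀, χ}` and `t ≠ 0`,
`|∑_{m mod P} ψ(m) χ(m + t)| ≤ 1` (`J(χ₀,χ) = −1`, `J(χ,χ) = −χ(−1)`); `≤ P` at `t = 0`.
[cite: BondarenkoHeap2026, Lemma 9 (proof), TeX l.1087–1090] -/
theorem norm_sum_mul_quad_shift_le_of_special {χ : DirichletCharacter ℂ P} (hχ : χ.IsQuadratic)
    (hχ1 : χ ≠ 1) {ψ : DirichletCharacter ℂ P} (hψ : ψ = 1 ∨ ψ = χ) (t : ZMod P) :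
    ‖∑ m : ZMod P, ψ m * χ (m + t)‖ ≤ if t = 0 then (P : ℝ) else 1 := by
  split_ifs with ht
  · have h := norm_sum_mul_quad_shift_le hχ1 ψ t
    rw [if_pos ht] at h
    exact h
  · have key := sum_mul_shift_eq_jacobiSum ψ χ (σ := 1) (by norm_num) ht
    simp only [one_mul] at key
    rw [key, norm_mul, norm_mul]
    have hJ : ‖jacobiSum ψ χ‖ ≤ 1 := by
      rcases hψ with hψ | hψ <;> rw [hψ]
      · rw [jacobiSum_one_nontrivial hχ1, norm_neg, norm_one]
      · rw [show jacobiSum χ χ = jacobiSum χ χ⁻¹ by rw [hχ.inv], jacobiSum_nontrivial_inv hχ1,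
          norm_neg]
        exact χ.norm_le_one _
    calc ‖ψ (-1 * t)‖ * ‖χ t‖ * ‖jacobiSum ψ χ‖ ≤ 1 * 1 * 1 :=
          mul_le_mul (mul_le_mul (ψ.norm_le_one _) (χ.norm_le_one _) (norm_nonneg _) zero_le_one)
            hJ (norm_nonneg _) (by norm_num)
      _ = 1 := by ring

end LocalPrime

/-! ### The CRT induction: `|∑_m ψ(m)χ(m + y)| ≤ (y, q) √q` for odd square-free `q` -/

/-- `gcd (a mod m, m) = gcd (a, m)`. [folklore] -/
private theorem gcd_mod_left_eq (a m : ℕ) : Nat.gcd (a % m) m = Nat.gcd a m := by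
  rw [← Nat.gcd_rec m a, Nat.gcd_comm]

/-- The value of a reduction is the residue of the value. [folklore] -/
private theorem val_cast_eq_mod {n : ℕ} (m : ℕ) [NeZero n] (y : ZMod n) :
    (ZMod.cast y : ZMod m).val = y.val % m := by
  rw [ZMod.cast_eq_val, ZMod.val_natCast]

/-- **Odd prime level.** For the primitive quadratic character `χ` mod `p^n`, `p` odd (so `n = 1`,
`eq_one_of_isPrimitive_pow_odd`), any `ψ` and any residue `y`:
`|∑_m ψ(m)χ(m + y)| ≤ (y, p)·√p`, and `≤ (y, p)` for `ψ ∈ {χ₀, χ}` — from the local Jacobi-sum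
bounds. [cite: BondarenkoHeap2026, Lemma 9 (proof), TeX l.1066–1090] -/
theorem norm_shiftSum_quad_primePow_le {p n : ℕ} (hp : p.Prime) (hp2 : p ≠ 2) (hn : 0 < n)
    [NeZero (p ^ n)] (χ : DirichletCharacter ℂ (p ^ n)) (hprim : χ.IsPrimitive)
    (hquad : χ.IsQuadratic) (ψ : DirichletCharacter ℂ (p ^ n)) (y : ZMod (p ^ n)) :
    ‖shiftSum ψ χ 1 y‖ ≤ (Nat.gcd y.val (p ^ n) : ℝ) * Real.sqrt ((p ^ n : ℕ) : ℝ) ∧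
      (ψ = 1 ∨ ψ = χ → ‖shiftSum ψ χ 1 y‖ ≤ (Nat.gcd y.val (p ^ n) : ℝ)) := by
  obtain rfl : n = 1 := eq_one_of_isPrimitive_pow_odd hp hp2 hn χ hprim hquad
  haveI hF : Fact (p ^ 1).Prime := ⟨by rwa [pow_one]⟩
  have h1lt : 1 < p ^ 1 := by rw [pow_one]; exact hp.one_lt
  have hχ1 : χ ≠ 1 := ne_one_of_isPrimitive h1lt hprim
  have hsum : shiftSum ψ χ 1 y = ∑ m : ZMod (p ^ 1), ψ m * χ (m + y) := by
    rw [shiftSum_def]; simp only [one_mul]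
  have hsqrt1 : (1 : ℝ) ≤ Real.sqrt ((p ^ 1 : ℕ) : ℝ) := by
    rw [show (1 : ℝ) = Real.sqrt 1 by simp]
    exact Real.sqrt_le_sqrt (by exact_mod_cast hF.out.one_le)
  -- the gcd factor: `p` if `y = 0`, `1` otherwise
  by_cases hy : y = 0
  · have hval : y.val = 0 := (ZMod.val_eq_zero y).mpr hy
    have hg : (Nat.gcd y.val (p ^ 1) : ℝ) = ((p ^ 1 : ℕ) : ℝ) := by rw [hval, Nat.gcd_zero_left]
    rw [hg, hsum]
    have hloc := norm_sum_mul_quad_shift_le hχ1 ψ y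
    rw [if_pos hy] at hloc
    refine ⟨hloc.trans ?_, fun _ => hloc⟩
    have h0 : (0 : ℝ) ≤ ((p ^ 1 : ℕ) : ℝ) := Nat.cast_nonneg _
    nlinarith
  · have hval0 : y.val ≠ 0 := fun h => hy ((ZMod.val_eq_zero y).mp h)
    have hcop : Nat.gcd y.val (p ^ 1) = 1 :=
      (Nat.coprime_of_lt_prime hval0 (ZMod.val_lt y) hF.out).symm
    rw [hcop, Nat.cast_one, one_mul, hsum]
    constructor
    · have hloc := norm_sum_mul_quad_shift_le hχ1 ψ y
      rw [if_neg hy] at hloc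
      exact hloc
    · intro hψ
      have hloc := norm_sum_mul_quad_shift_le_of_special hquad hχ1 hψ y
      rw [if_neg hy] at hloc
      exact hloc

/-- **CRT induction** ("By the Chinese Remainder Theorem everything here factors prime by prime",
TeX l.1069): for odd `q`, the primitive quadratic `χ` mod `q`, any `ψ` mod `q` and any residue `y`,
`|∑_{m mod q} ψ(m)χ(m + y)| ≤ (y, q)·√q`, and `≤ (y, q)` when `ψ ∈ {χ₀, χ}`.
[cite: BondarenkoHeap2026, Lemma 9 (proof), TeX l.1066–1100] -/
theorem norm_shiftSum_quad_le_aux :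
    ∀ (q : ℕ) (_ : NeZero q) (χ : DirichletCharacter ℂ q), χ.IsPrimitive → χ.IsQuadratic →
      Odd q → ∀ (ψ : DirichletCharacter ℂ q) (y : ZMod q),
        ‖shiftSum ψ χ 1 y‖ ≤ (Nat.gcd y.val q : ℝ) * Real.sqrt q ∧
          (ψ = 1 ∨ ψ = χ → ‖shiftSum ψ χ 1 y‖ ≤ (Nat.gcd y.val q : ℝ)) := by
  intro q
  induction q using Nat.recOnPrimePow with
  | zero => intro hq; exact (not_neZero.mpr rfl hq).elim
  | one =>
    intro _ χ _ _ _ ψ y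
    rw [shiftSum_level_one, Nat.gcd_one_right]
    simp
  | prime_pow_mul a p n hp hpa hn ih =>
    intro hq χ hprim hquad hodd ψ y
    have ha : a ≠ 0 := fun ha => by rw [ha, mul_zero] at hq; exact not_neZero.mpr rfl hq
    haveI : NeZero a := ⟨ha⟩
    haveI : NeZero (p ^ n) := ⟨pow_ne_zero n hp.ne_zero⟩
    have hcop : (p ^ n).Coprime a := Nat.Coprime.pow_left n (hp.coprime_iff_not_dvd.mpr hpa)
    obtain ⟨hpodd, haodd⟩ := Nat.odd_mul.mp hodd
    have hp2 : p ≠ 2 := by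
      rintro rfl
      have : Odd 2 := (Nat.odd_pow_iff hn.ne').mp hpodd
      exact absurd this (by decide)
    have hmul := shiftSum_eq_mul_of_coprime hcop ψ χ 1 y
    rw [ZMod.cast_one (dvd_mul_right _ _), ZMod.cast_one (dvd_mul_left _ _)] at hmul
    have hloc := norm_shiftSum_quad_primePow_le hp hp2 hn (crtFst hcop χ)
      (isPrimitive_crtFst hcop hprim) (IsQuadratic.crtFst hcop hquad) (crtFst hcop ψ)
      (ZMod.cast y : ZMod (p ^ n))
    have hih := ih inferInstance (crtSnd hcop χ) (isPrimitive_crtSnd hcop hprim)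
      (IsQuadratic.crtSnd hcop hquad) haodd (crtSnd hcop ψ) (ZMod.cast y : ZMod a)
    -- the gcd and square-root factors multiply
    have hg1 : Nat.gcd (ZMod.cast y : ZMod (p ^ n)).val (p ^ n) = Nat.gcd y.val (p ^ n) := by
      rw [val_cast_eq_mod (p ^ n), gcd_mod_left_eq]
    have hg2 : Nat.gcd (ZMod.cast y : ZMod a).val a = Nat.gcd y.val a := by
      rw [val_cast_eq_mod a, gcd_mod_left_eq]
    have hgm : (Nat.gcd y.val (p ^ n) : ℝ) * (Nat.gcd y.val a : ℝ) =
        (Nat.gcd y.val (p ^ n * a) : ℝ) := by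
      rw [Nat.Coprime.gcd_mul y.val hcop]; push_cast; ring
    have hsq : Real.sqrt ((p ^ n : ℕ) : ℝ) * Real.sqrt (a : ℝ) = Real.sqrt ((p ^ n * a : ℕ) : ℝ) := by
      rw [← Real.sqrt_mul (Nat.cast_nonneg _)]; push_cast; ring_nf
    rw [hg1] at hloc
    rw [hg2] at hih
    rw [hmul, norm_mul]
    have hA0 : (0 : ℝ) ≤ (Nat.gcd y.val (p ^ n) : ℝ) * Real.sqrt ((p ^ n : ℕ) : ℝ) := by positivity
    have hB0 : (0 : ℝ) ≤ (Nat.gcd y.val (p ^ n) : ℝ) := by positivity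
    constructor
    · calc ‖shiftSum (crtFst hcop ψ) (crtFst hcop χ) 1 (ZMod.cast y)‖ *
            ‖shiftSum (crtSnd hcop ψ) (crtSnd hcop χ) 1 (ZMod.cast y)‖
          ≤ ((Nat.gcd y.val (p ^ n) : ℝ) * Real.sqrt ((p ^ n : ℕ) : ℝ)) *
              ((Nat.gcd y.val a : ℝ) * Real.sqrt (a : ℝ)) :=
            mul_le_mul hloc.1 hih.1 (norm_nonneg _) hA0
        _ = (Nat.gcd y.val (p ^ n * a) : ℝ) * Real.sqrt ((p ^ n * a : ℕ) : ℝ) := by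
            rw [← hgm, ← hsq]; ring
    · intro hψ
      have hψ1 : crtFst hcop ψ = 1 ∨ crtFst hcop ψ = crtFst hcop χ := by
        rcases hψ with rfl | rfl
        · exact Or.inl (crtFst_one hcop)
        · exact Or.inr rfl
      have hψ2 : crtSnd hcop ψ = 1 ∨ crtSnd hcop ψ = crtSnd hcop χ := by
        rcases hψ with rfl | rfl
        · exact Or.inl (crtSnd_one hcop)
        · exact Or.inr rfl
      calc ‖shiftSum (crtFst hcop ψ) (crtFst hcop χ) 1 (ZMod.cast y)‖ *
            ‖shiftSum (crtSnd hcop ψ) (crtSnd hcop χ) 1 (ZMod.cast y)‖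
          ≤ (Nat.gcd y.val (p ^ n) : ℝ) * (Nat.gcd y.val a : ℝ) :=
            mul_le_mul (hloc.2 hψ1) (hih.2 hψ2) (norm_nonneg _) hB0
        _ = (Nat.gcd y.val (p ^ n * a) : ℝ) := hgm

/-- The gcd of `r·m̄ (mod Q)` with `Q` divides `r` (for `m` coprime to `Q`). [folklore] -/
private theorem gcd_val_intCast_mul_inv_dvd {Q : ℕ} [NeZero Q] (r : ℤ) {m : ℕ}
    (hm : m.Coprime Q) :
    Nat.gcd (((r : ZMod Q) * (m : ZMod Q)⁻¹).val) Q ∣ r.natAbs := by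
  set y : ZMod Q := (r : ZMod Q) * (m : ZMod Q)⁻¹ with hy
  set g : ℕ := Nat.gcd y.val Q with hg
  have hgQ : g ∣ Q := Nat.gcd_dvd_right _ _
  have hg0 : g ≠ 0 := fun h0 => NeZero.ne Q ((Nat.gcd_eq_zero_iff.mp h0).2)
  haveI : NeZero g := ⟨hg0⟩
  have hmu : IsUnit (m : ZMod Q) := (ZMod.isUnit_iff_coprime m Q).mpr hm
  -- `y ≡ 0 (mod g)`
  have h0 : (ZMod.cast y : ZMod g) = 0 := by
    rw [ZMod.cast_eq_val, ZMod.natCast_eq_zero_iff]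
    exact Nat.gcd_dvd_left _ _
  -- `m̄ · m ≡ 1 (mod g)`
  have h1 : (ZMod.cast ((m : ZMod Q)⁻¹) : ZMod g) * (m : ZMod g) = 1 := by
    have h := congrArg (ZMod.cast : ZMod Q → ZMod g) (ZMod.inv_mul_of_unit (m : ZMod Q) hmu)
    rwa [ZMod.cast_mul hgQ, ZMod.cast_natCast hgQ, ZMod.cast_one hgQ] at h
  have hr : ((r : ℤ) : ZMod g) = 0 := by
    calc ((r : ℤ) : ZMod g) = (r : ZMod g) * ((ZMod.cast ((m : ZMod Q)⁻¹) : ZMod g) * (m : ZMod g)) := by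
          rw [h1, mul_one]
      _ = (ZMod.cast y : ZMod g) * (m : ZMod g) := by
          rw [hy, ZMod.cast_mul hgQ, ZMod.cast_intCast hgQ, mul_assoc]
      _ = 0 := by rw [h0, zero_mul]
  exact Int.natCast_dvd.mp ((ZMod.intCast_zmod_eq_zero_iff_dvd r g).mp hr)

/-- **Pointwise bound for `T_ψ(r m̄)`, unconditional** (TeX l.1066–1105): for `q = 2^ν Q` carrying
the primitive quadratic `χ`, any `ψ`, `r ≠ 0` and `(m, q) = 1`,
`|T_ψ(r m̄)| ≤ 8 · {√Q; 1 if ψ ∈ {ψ₀, χ}} · (r, Q)`.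
[cite: BondarenkoHeap2026, Lemma 9, eq. (30)–(31), TeX l.1026–1105] -/
theorem norm_genJacobiSum_le {q : ℕ} [NeZero q] {ν Q : ℕ} (hq : q = 2 ^ ν * Q)
    (hν : ν = 0 ∨ ν = 2 ∨ ν = 3) (hQodd : Odd Q) (χ : DirichletCharacter ℂ q)
    (hχp : χ.IsPrimitive) (hχq : χ.IsQuadratic) (ψ : DirichletCharacter ℂ q) (r : ℤ) {m : ℕ}
    (hm : m.Coprime q) :
    ‖genJacobiSum χ ψ ((r : ZMod q) * (m : ZMod q)⁻¹)‖ ≤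
      8 * (if ψ = 1 ∨ ψ = χ then 1 else Real.sqrt Q) * (Nat.gcd r.natAbs Q : ℝ) := by
  classical
  subst hq
  have hQ0 : Q ≠ 0 := by rintro rfl; exact (Nat.not_odd_zero hQodd).elim
  haveI : NeZero Q := ⟨hQ0⟩
  haveI : NeZero (2 ^ ν) := ⟨pow_ne_zero _ two_ne_zero⟩
  have hcop : (2 ^ ν).Coprime Q := (Nat.coprime_two_left.mpr hQodd).pow_left ν
  have hQdvd : Q ∣ 2 ^ ν * Q := dvd_mul_left Q (2 ^ ν)
  set A : ℝ := (if ψ = 1 ∨ ψ = χ then 1 else Real.sqrt Q) with hA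
  have hA0 : 0 ≤ A := by rw [hA]; split_ifs <;> positivity
  set y : ZMod (2 ^ ν * Q) := (r : ZMod (2 ^ ν * Q)) * (m : ZMod (2 ^ ν * Q))⁻¹ with hy
  rw [genJacobiSum_eq_shiftSum, shiftSum_eq_mul_of_coprime hcop, norm_mul]
  have h2ν : ((2 ^ ν : ℕ) : ℝ) ≤ 8 := by
    rcases hν with rfl | rfl | rfl <;> norm_num
  have hF1 : ∀ (s t : ZMod (2 ^ ν)),
      ‖shiftSum (crtFst hcop ψ⁻¹) (crtFst hcop χ) s t‖ ≤ 8 :=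
    fun s t => (norm_shiftSum_le _ _ s t).trans h2ν
  -- the factor mod `Q`
  set yQ : ZMod Q := (r : ZMod Q) * (m : ZMod Q)⁻¹ with hyQ
  have hmQ : m.Coprime Q := hm.coprime_dvd_right hQdvd
  have hcast : (ZMod.cast y : ZMod Q) = yQ := by rw [hy, cast_intCast_mul_inv_natCast r hm]
  have hmain := norm_shiftSum_quad_le_aux Q inferInstance (crtSnd hcop χ)
    (isPrimitive_crtSnd hcop hχp) (IsQuadratic.crtSnd hcop hχq) hQodd (crtSnd hcop ψ⁻¹) yQ
  have hgcd : (Nat.gcd yQ.val Q : ℝ) ≤ (Nat.gcd r.natAbs Q : ℝ) := by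
    have hd := gcd_val_intCast_mul_inv_dvd (Q := Q) r hmQ
    have hdQ : Nat.gcd yQ.val Q ∣ Q := Nat.gcd_dvd_right _ _
    have hpos : 0 < Nat.gcd r.natAbs Q := Nat.gcd_pos_of_pos_right _ (Nat.pos_of_ne_zero hQ0)
    exact_mod_cast Nat.le_of_dvd hpos (Nat.dvd_gcd hd hdQ)
  have hF2 : ‖shiftSum (crtSnd hcop ψ⁻¹) (crtSnd hcop χ)
      (ZMod.cast (1 : ZMod (2 ^ ν * Q)) : ZMod Q) (ZMod.cast y : ZMod Q)‖ ≤
        A * (Nat.gcd r.natAbs Q : ℝ) := by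
    rw [ZMod.cast_one hQdvd, hcast, hA]
    split_ifs with hsp
    · have hsp' : crtSnd hcop ψ⁻¹ = 1 ∨ crtSnd hcop ψ⁻¹ = crtSnd hcop χ := by
        rcases hsp with rfl | rfl
        · exact Or.inl (by rw [inv_one, crtSnd_one])
        · exact Or.inr (by rw [hχq.inv])
      rw [one_mul]
      exact (hmain.2 hsp').trans hgcd
    · calc ‖shiftSum (crtSnd hcop ψ⁻¹) (crtSnd hcop χ) 1 yQ‖
          ≤ (Nat.gcd yQ.val Q : ℝ) * Real.sqrt Q := hmain.1
        _ ≤ (Nat.gcd r.natAbs Q : ℝ) * Real.sqrt Q :=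
            mul_le_mul_of_nonneg_right hgcd (Real.sqrt_nonneg _)
        _ = Real.sqrt Q * (Nat.gcd r.natAbs Q : ℝ) := mul_comm _ _
  calc ‖shiftSum (crtFst hcop ψ⁻¹) (crtFst hcop χ) (ZMod.cast (1 : ZMod (2 ^ ν * Q)))
          (ZMod.cast y)‖ *
        ‖shiftSum (crtSnd hcop ψ⁻¹) (crtSnd hcop χ) (ZMod.cast (1 : ZMod (2 ^ ν * Q)))
          (ZMod.cast y)‖ ≤ 8 * (A * (Nat.gcd r.natAbs Q : ℝ)) :=
        mul_le_mul (hF1 _ _) hF2 (norm_nonneg _) (by norm_num)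
    _ = 8 * A * (Nat.gcd r.natAbs Q : ℝ) := by ring

/-- **Lemma 9, (32) — PROVED** (TeX l.1026–1105; "The bound (32) also holds for fundamental
discriminant conductors with a factor `4` or `8`"): for every `ε > 0` there is `C` with
`(1/φ(q))|∑_{r≍R}∑_{m≍M} c_r b_m T_ψ(±r m̄)| ≤ C q^ε RM · {q^{−1/2}; q^{−1} (ψ ∈ {ψ₀,χ})}` for all
`q` carrying a primitive quadratic `χ`, all `ψ`, `1`-bounded coefficients with `b` supported on
`(m,q) = 1`. Road as printed: CRT prime by prime (`norm_shiftSum_quad_le_aux`: at `p ∤ r` the local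
factor is a Jacobi sum of modulus `≤ √p` — `= 1` for `ψ_p ∈ {χ₀, χ_p}` —, at `p ∣ r` it is `≤ p`),
the `2^ν`-part "only changes the bound up to a constant" (`≤ 8`), then
`∑_{0<|r|⩽R} (r, Q) ≪ R q^ε` (`gcd_sum_le` + the divisor bound) and "division by
`φ(q) = q^{1−o(1)}`" (`exists_self_div_totient_le_rpow`); `C = 32 C_d(ε/2) C_φ(ε/2)`. The exact
identity (30) (`lemma9_exact`) is not used. [cite: BondarenkoHeap2026, Lemma 9, eq. (32), TeX l.1026–1105] -/
theorem lemma9_bound_holds : lemma9_bound := by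
  classical
  intro ε hε
  obtain ⟨Cd, hCd1, hCd⟩ :=
    Literature.NumberTheory.Sieve.exists_card_divisors_le_mul_rpow (half_pos hε)
  obtain ⟨Cφ, hCφ, hφ⟩ := exists_self_div_totient_le_rpow (half_pos hε)
  refine ⟨32 * Cd * Cφ, by positivity, ?_⟩
  intro q _ χ hχp hχq ψ R M hR hM s hs b c hb hc hbsupp hcsupp
  obtain ⟨ν, Q, hq, hν, hQodd, hQsf⟩ := modulus_eq_two_pow_mul_odd_squarefree hχp hχq
  have hQ0 : Q ≠ 0 := by rintro rfl; exact (Nat.not_odd_zero hQodd).elim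
  have hq0n : q ≠ 0 := NeZero.ne q
  have hq0 : (0 : ℝ) < q := by exact_mod_cast Nat.pos_of_ne_zero hq0n
  have hq1 : (1 : ℝ) ≤ q := by exact_mod_cast Nat.one_le_iff_ne_zero.mpr hq0n
  have hQq : (Q : ℝ) ≤ q := by
    have : Q ≤ q := by rw [hq]; exact Nat.le_mul_of_pos_left Q (Nat.one_le_two_pow)
    exact_mod_cast this
  have hR0 : 0 < R := by linarith
  have hM0 : 0 < M := by linarith
  have hNR : (⌊2 * R⌋₊ : ℝ) ≤ 2 * R := Nat.floor_le (by linarith)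
  have hNM : (⌊2 * M⌋₊ : ℝ) ≤ 2 * M := Nat.floor_le (by linarith)
  set A : ℝ := (if ψ = 1 ∨ ψ = χ then 1 else Real.sqrt Q) with hA
  have hA0 : 0 ≤ A := by rw [hA]; split_ifs <;> positivity
  have hs0 : (s : ℤ) ≠ 0 := by rcases hs with rfl | rfl <;> norm_num
  have hsabs : ∀ r : ℕ, (s * (r : ℤ)).natAbs = r := by
    intro r; rcases hs with rfl | rfl <;> simp
  -- pointwise bound for the summands
  have hpt : ∀ r ∈ Icc 1 ⌊2 * R⌋₊, ∀ m ∈ Icc 1 ⌊2 * M⌋₊,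
      ‖c r * b m * genJacobiSum χ ψ (((s * r : ℤ) : ZMod q) * (m : ZMod q)⁻¹)‖ ≤
        8 * A * (Nat.gcd r Q : ℝ) := by
    intro r _ m _
    by_cases hbm : b m = 0
    · rw [hbm, mul_zero, zero_mul, norm_zero]
      positivity
    · obtain ⟨_, hcop⟩ := hbsupp m hbm
      have hT := norm_genJacobiSum_le hq hν hQodd χ hχp hχq ψ (s * r) hcop
      rw [hsabs r] at hT
      calc ‖c r * b m * genJacobiSum χ ψ (((s * r : ℤ) : ZMod q) * (m : ZMod q)⁻¹)‖
          = ‖c r‖ * ‖b m‖ *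
              ‖genJacobiSum χ ψ (((s * r : ℤ) : ZMod q) * (m : ZMod q)⁻¹)‖ := by
            rw [norm_mul, norm_mul]
        _ ≤ 1 * 1 * (8 * A * (Nat.gcd r Q : ℝ)) :=
            mul_le_mul (mul_le_mul (hc r) (hb m) (norm_nonneg _) zero_le_one) hT
              (norm_nonneg _) (by norm_num)
        _ = 8 * A * (Nat.gcd r Q : ℝ) := by ring
  -- summing: `‖S‖ ≤ 32 A · RM · d(Q)`
  have hKsum : ∑ r ∈ Icc 1 ⌊2 * R⌋₊, (Nat.gcd r Q : ℝ) ≤ (⌊2 * R⌋₊ : ℝ) * Q.divisors.card := by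
    have hIcc : (Icc 1 ⌊2 * R⌋₊ : Finset ℕ) = Ioc 0 ⌊2 * R⌋₊ := by
      ext a; simp only [Finset.mem_Icc, Finset.mem_Ioc]; omega
    rw [hIcc]
    exact gcd_sum_le hQ0 ⌊2 * R⌋₊
  have hS : ‖∑ r ∈ Icc 1 ⌊2 * R⌋₊, ∑ m ∈ Icc 1 ⌊2 * M⌋₊,
      c r * b m * genJacobiSum χ ψ (((s * r : ℤ) : ZMod q) * (m : ZMod q)⁻¹)‖ ≤
      32 * A * (R * M) * Q.divisors.card := by
    calc ‖∑ r ∈ Icc 1 ⌊2 * R⌋₊, ∑ m ∈ Icc 1 ⌊2 * M⌋₊,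
          c r * b m * genJacobiSum χ ψ (((s * r : ℤ) : ZMod q) * (m : ZMod q)⁻¹)‖
        ≤ ∑ r ∈ Icc 1 ⌊2 * R⌋₊, ∑ m ∈ Icc 1 ⌊2 * M⌋₊,
            ‖c r * b m * genJacobiSum χ ψ (((s * r : ℤ) : ZMod q) * (m : ZMod q)⁻¹)‖ :=
          (norm_sum_le _ _).trans (Finset.sum_le_sum fun r _ => norm_sum_le _ _)
      _ ≤ ∑ r ∈ Icc 1 ⌊2 * R⌋₊, ∑ _m ∈ Icc 1 ⌊2 * M⌋₊, 8 * A * (Nat.gcd r Q : ℝ) :=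
          Finset.sum_le_sum fun r hr => Finset.sum_le_sum fun m hm => hpt r hr m hm
      _ = (⌊2 * M⌋₊ : ℝ) * (8 * A) * ∑ r ∈ Icc 1 ⌊2 * R⌋₊, (Nat.gcd r Q : ℝ) := by
          rw [Finset.mul_sum]
          refine Finset.sum_congr rfl fun r _ => ?_
          rw [Finset.sum_const, Nat.card_Icc, nsmul_eq_mul]
          push_cast
          ring
      _ ≤ (2 * M) * (8 * A) * ((⌊2 * R⌋₊ : ℝ) * Q.divisors.card) := by gcongr
      _ ≤ (2 * M) * (8 * A) * ((2 * R) * Q.divisors.card) := by gcongr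
      _ = 32 * A * (R * M) * Q.divisors.card := by ring
  -- constants: `d(Q) · q/φ(q) ≤ C_d C_φ q^ε`
  have hdQ : (Q.divisors.card : ℝ) ≤ Cd * (q : ℝ) ^ (ε / 2) := by
    refine (hCd Q hQ0).trans ?_
    exact mul_le_mul_of_nonneg_left
      (Real.rpow_le_rpow (Nat.cast_nonneg Q) hQq (by positivity)) (by linarith)
  have hφq : (q : ℝ) / Nat.totient q ≤ Cφ * (q : ℝ) ^ (ε / 2) := hφ q hq0n
  have hφpos : (0 : ℝ) < Nat.totient q := by
    exact_mod_cast Nat.totient_pos.mpr (Nat.pos_of_ne_zero hq0n)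
  have hkey : (Nat.totient q : ℝ)⁻¹ * (Q.divisors.card : ℝ) ≤ Cd * Cφ * (q : ℝ) ^ ε / q := by
    have h1 : (Nat.totient q : ℝ)⁻¹ = ((q : ℝ) / Nat.totient q) / q := by
      rw [div_right_comm, div_self hq0.ne', one_div]
    rw [h1, div_mul_eq_mul_div, div_le_div_iff_of_pos_right hq0]
    have hε2 : (q : ℝ) ^ (ε / 2) * (q : ℝ) ^ (ε / 2) = (q : ℝ) ^ ε := by
      rw [← Real.rpow_add hq0]; ring_nf
    calc (q : ℝ) / Nat.totient q * (Q.divisors.card : ℝ)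
        ≤ (Cφ * (q : ℝ) ^ (ε / 2)) * (Cd * (q : ℝ) ^ (ε / 2)) :=
          mul_le_mul hφq hdQ (Nat.cast_nonneg _) (by positivity)
      _ = Cd * Cφ * (q : ℝ) ^ ε := by rw [← hε2]; ring
  have hAq : A / q ≤ (if ψ = 1 ∨ ψ = χ then (q : ℝ)⁻¹ else ((q : ℝ) ^ (1 / 2 : ℝ))⁻¹) := by
    rw [hA]
    split_ifs with hsp
    · rw [one_div]
    · have hsq : Real.sqrt Q ≤ Real.sqrt q := Real.sqrt_le_sqrt hQq
      have hsqq : Real.sqrt (q : ℝ) = (q : ℝ) ^ (1 / 2 : ℝ) := Real.sqrt_eq_rpow (q : ℝ)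
      have hhalf : (q : ℝ) ^ (1 / 2 : ℝ) * (q : ℝ) ^ (1 / 2 : ℝ) = q := by
        rw [← Real.rpow_add hq0]; norm_num
      have hpos : 0 < (q : ℝ) ^ (1 / 2 : ℝ) := by positivity
      calc Real.sqrt Q / q ≤ Real.sqrt q / q := div_le_div_of_nonneg_right hsq hq0.le
        _ = ((q : ℝ) ^ (1 / 2 : ℝ))⁻¹ := by
            rw [hsqq, div_eq_iff hq0.ne', eq_comm, inv_mul_eq_iff_eq_mul₀ hpos.ne']
            exact hhalf.symm
  calc (Nat.totient q : ℝ)⁻¹ * ‖∑ r ∈ Icc 1 ⌊2 * R⌋₊, ∑ m ∈ Icc 1 ⌊2 * M⌋₊,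
          c r * b m * genJacobiSum χ ψ (((s * r : ℤ) : ZMod q) * (m : ZMod q)⁻¹)‖
      ≤ (Nat.totient q : ℝ)⁻¹ * (32 * A * (R * M) * Q.divisors.card) :=
        mul_le_mul_of_nonneg_left hS (by positivity)
    _ = 32 * A * (R * M) * ((Nat.totient q : ℝ)⁻¹ * (Q.divisors.card : ℝ)) := by ring
    _ ≤ 32 * A * (R * M) * (Cd * Cφ * (q : ℝ) ^ ε / q) :=
        mul_le_mul_of_nonneg_left hkey (by positivity)
    _ = 32 * Cd * Cφ * (q : ℝ) ^ ε * (R * M) * (A / q) := by ring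
    _ ≤ 32 * Cd * Cφ * (q : ℝ) ^ ε * (R * M) *
          (if ψ = 1 ∨ ψ = χ then (q : ℝ)⁻¹ else ((q : ℝ) ^ (1 / 2 : ℝ))⁻¹) :=
        mul_le_mul_of_nonneg_left hAq (by positivity)

/-- **(40), Range III from Lemma 10 alone**: with Lemma 9 (32) proved (`lemma9_bound_holds`), the
Range III bound (40) is a theorem modulo the single named fact `lemma10`.
[cite: BondarenkoHeap2026, eq. (40), TeX l.1295–1309] -/
theorem rangeIII_bound_of_lemma10 (h10 : lemma10) : rangeIII_bound :=
  rangeIII_bound_of_lemma9_lemma10 lemma9_bound_holds h10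

end Lemma9Proof

end Literature.NumberTheory.LFunctions.BondarenkoHeap2026
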